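import Literature.Analysis.FluidPDE.PalasekCylindricalWeight
import HarnessLib

/-!
# Palasek 2021, Prop 9: the backward-uniqueness Carleman estimate in truncated cylindrical shells

Analysis/FluidPDE proof file (theorems only, no definitions, no named facts): a complete proof of
**Prop 9** of S. Palasek, *Improved quantitative regularity for the Navier–Stokes equations in a
scale of critical spaces*, Arch. Ration. Mech. Anal. 242 (2021) 1479–1531 (arXiv:2101.08586), §4 —
the backward-uniqueness Carleman inequality in truncated cylindrical shells
`{r₋ ≤ r ≤ r₊, |z| ≤ r₊}` (`r` the distance to an axis, `z` the axial coordinate; Palasek's case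
`d₁ = 2`, `d₂ = 1`), which replaces Tao's annular Prop. 4.2 (`TaoCarlemanFirst*.lean`) in the proof
of Palasek's main estimate (Prop 11) and hence of
`Literature.Analysis.FluidPDE.palasek2021_axisym_quantitative_ess` (Thm 1, `q = 3`, axisymmetric),
inside whose inline programme this file sits.

Palasek, §4: "Unfortunately [the annular] estimate relies on the differential inequality holding in
an annular region …, which cannot possibly be contained in the cylindrical regions of regularity
provided by Proposition 8. Thus we prove a variant that is suited to this geometry. … **Prop 9
(Backward uniqueness Carleman estimate).** Let `T > 0`, `0 < r₋ < r₊`, and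
`𝒞 = {t ∈ [0,T], r₋ ≤ r ≤ r₊, |z| ≤ r₊}`. Let `u : 𝒞 → ℝ` be smooth with
`|Lu| ≤ (C₀T)⁻¹|u| + (C₀T)^{-1/2}|∇u|` on `𝒞`. Assume `r₋² ≥ 4C₀T`. Then
`∫₀^{T/4}∫_{10r₋ ≤ r ≤ r₊/2, |z| ≤ r₊/2} (T⁻¹|u|² + |∇u|²) ≲ C₀ e^{−r₋r₊/(4C₀T)} (X + e^{2r₊²/(C₀T)} Y)`,
`X = ∫∫_𝒞 e^{2|x|²/(C₀T)}(T⁻¹|u|² + |∇u|²)`, `Y = ∫ |u(0,x)|²`." Proof (ibid.): pigeonhole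
`T₀ ∈ [T/2, T]`; the weight `g = r₊(T₀−t)r/(2C₀T²) + |x|²/(C₀T)`; Lemma 2 (= Tao's Lemma 4.1) for `ψu`
with a cut-off of the truncated shell; "Since the function `r` is convex, `D²g ≥ (2/(C₀T))Id`";
`F ≤ 0`, `LF ≥ 4/(C₀T²)`; absorption of the plateau; the bounds on the transition regions
("`g − 2|x|²/(C₀T) − 5r₋r₊/(4C₀T) ≤ −r₊r₋/(4C₀T)`" on `r ≤ 2r₋`, on `r ≥ r₊/2`, and on `|z| ≥ r₊/2`), at
`t = T₀` and at `t = 0`.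

The proof follows the tree's formalisation of Tao's Prop. 4.2 (`TaoCarlemanFirstWeight/Core/Ineq`)
step by step, in an abstract real inner product space `E` of dimension `3` with a unit vector `a`
(the axis) and the **cylindrical square** `m(x) = |x|² − ⟪x,a⟫² = r²`; the first two items below are
the companion file `PalasekCylindricalWeight.lean`, the last two are this file:

* calculus of `m` and of `⟪x,a⟫²` in the frame operators of `CarlemanCalculus.lean`
  (`|∇m|² = 4m`, `Δm = 2(d−1)`, `|∇⟪x,a⟫²|² = 4⟪x,a⟫²`, `Δ⟪x,a⟫² = 2`), cylindrical and axial profiles;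
* the weight `g = α(T₀−t)P(m) + b|x|²` (`P` the regularised radius, `α = br₊/(2T)`, `b = (C₀T)⁻¹`):
  `∂ₜg, ∇g, D²g, Δg, |∇g|²`, Palasek's `F` and `LF` on the region `m > r₋²/4` for general `d`
  (`F = −αr − (d−2)α(T₀−t)/r − 2bd − α²(T₀−t)² − 4bα(T₀−t)r − 4b²|x|²`,
  `LF = 2α²(T₀−t) + 4bαr − 4(d−2)bα(T₀−t)/r − (d−2)(4−d)α(T₀−t)/r³ − 8b²d`), and **the convexity of
  the distance to the axis** `2D²g(X,X) ≥ 4bΣ|Xᵢ|²` through the Bessel-type inequality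
  `norm_sq_sum_smul_add_le`; the specialised rate inequality `cyl_carleman_rate`;
* the cut-off of the truncated shell (`exists_cyl_cutoff`: the annular profile in the variable `m`
  times an axial plateau in `⟪x,a⟫²`, `|∇ψ|², |Δψ| ≤ C/r₋²`);
* the cut-off field `W = ψu`, `|L(ψu)|²` on plateau / transition layers / outside, the core
  integrated inequality `core_cyl_carleman`, the four terms, and the assembly
  `cyl_carleman_inequality` (**Prop 9**).

Rendering (as for the annular `TaoCarleman.first_carleman_inequality`): open regions (null-set
changes), `|∇u|` the operator norm of the slice derivative, the implied constant `K C₀³` with `K`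
depending only on `E`, the axial plateau at `|z| ≤ r₊/2` with support in `|z| ≤ (3/5)r₊`, and the
factor `e^{3r₊²/(C₀T)}` in front of `Y` — on the truncated shell `|x|² = r² + z² ≤ 2r₊²`, so
`e^{g(0,x)} ≤ e^{(5/2)r₊²/(C₀T)}` (the printed `e^{3r₊²/(2C₀T)}`, giving `e^{2r₊²/(C₀T)}`, would need
`|x| ≤ r₊`); any `e^{O(r₊²/(C₀T))} = e^{O(A₆²)}` serves the application in Prop 11.

## References

* S. Palasek, arXiv:2101.08586 (Arch. Ration. Mech. Anal. 242, 2021), §4: Lemma 2, Prop 9 and its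
  proof. [Palasek2021]
* T. Tao, arXiv:1908.04958v2 (2021), §4, Lemma 4.1 and Prop. 4.2 (the annular model, formalised in
  `TaoCarlemanLemma.lean`, `TaoCarlemanFirst*.lean`). [Tao2021QuantitativeNS]
-/

noncomputable section

open MeasureTheory Set Function Filter Topology Metric
open scoped InnerProductSpace RealInnerProductSpace Laplacian

namespace Literature.Analysis.FluidPDE

namespace PalasekCarleman

open Carleman TaoCarleman

variable {E : Type*} [NormedAddCommGroup E] [InnerProductSpace ℝ E]
variable {F : Type*} [NormedAddCommGroup F] [InnerProductSpace ℝ F]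

/-! ### The cylindrical cut-off field `W = ψ • u` -/

section CylField

variable [FiniteDimensional ℝ E] [MeasurableSpace E] [BorelSpace E]
variable {F : Type*} [NormedAddCommGroup F] [InnerProductSpace ℝ F]
variable {a : E} {m : ℝ × E → ℝ} (hm : m = fun y : ℝ × E => ‖y.2‖ ^ 2 - ⟪y.2, a⟫ ^ 2)
variable {T r₁ r₂ Cψ b : ℝ} {u : ℝ → E → F} {ψ : ℝ × E → ℝ} {W : ℝ × E → F} {GS GW : ℝ × E → ℝ}
variable (hT : 0 < T) (hr₁ : 0 < r₁) (hr₁₂ : 8 * r₁ ≤ r₂)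
  (hu : ContDiffOn ℝ 2 (uncurry u) (Icc 0 T ×ˢ univ))
  (hψs : ContDiff ℝ (⊤ : ℕ∞) ψ)
  (hψnn : ∀ z, 0 ≤ ψ z) (hψle : ∀ z, ψ z ≤ 1) (hψt : ∀ z, dt ψ z = 0)
  (hψ1 : ∀ z : ℝ × E, 4 * r₁ ^ 2 ≤ m z → m z ≤ r₂ ^ 2 / 4 → ⟪z.2, a⟫ ^ 2 ≤ r₂ ^ 2 / 4 → ψ z = 1)
  (hψ0 : ∀ z : ℝ × E, m z ≤ 36 / 25 * r₁ ^ 2 ∨ 81 / 100 * r₂ ^ 2 ≤ m z ∨ 9 / 25 * r₂ ^ 2 ≤ ⟪z.2, a⟫ ^ 2 → ψ z = 0)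
  (hψd0 : ∀ z : ℝ × E, (m z < 36 / 25 * r₁ ^ 2 ∨ 81 / 100 * r₂ ^ 2 < m z ∨ 9 / 25 * r₂ ^ 2 < ⟪z.2, a⟫ ^ 2 ∨
      (4 * r₁ ^ 2 < m z ∧ m z < r₂ ^ 2 / 4 ∧ ⟪z.2, a⟫ ^ 2 < r₂ ^ 2 / 4)) → (∀ e, dx e ψ z = 0) ∧ lap ψ z = 0)
  (hψg : ∀ z, gradSq ψ z ≤ Cψ / r₁ ^ 2) (hψl : ∀ z, |lap ψ z| ≤ Cψ / r₁ ^ 2)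
  (hW : W = fun z => ψ z • uncurry u z)
  (hGS : GS = fun z : ℝ × E => ∑ i, ‖fderiv ℝ (u z.1) z.2 (stdOrthonormalBasis ℝ E i)‖ ^ 2)
  (hGW : GW = fun z : ℝ × E => ∑ i, ‖ψ z • fderiv ℝ (u z.1) z.2 (stdOrthonormalBasis ℝ E i) +
    dx (stdOrthonormalBasis ℝ E i) ψ z • u z.1 z.2‖ ^ 2)

include hm in
omit [FiniteDimensional ℝ E] [MeasurableSpace E] [BorelSpace E] in
/-- The slices of `m`: `m(s, y) = |y|² − ⟪y,a⟫²`. [folklore] -/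
theorem cylSq_slice (s : ℝ) (y : E) : m (s, y) = ‖y‖ ^ 2 - ⟪y, a⟫ ^ 2 := by rw [hm]

omit [FiniteDimensional ℝ E] in
/-- **The sets.** The plateau `PL = {4r₁² < m < r₂²/4, ⟪y,a⟫² < r₂²/4}` and the open truncated shell
`AN = {r₁² < m < r₂², ⟪y,a⟫² < r₂²}` are open (hence measurable) and bounded, `PL ⊆ AN ⊆ B̄(0, 2|r₂|)`. [folklore] -/
theorem cyl_sets (a : E) (r₁ r₂ : ℝ) :
    MeasurableSet {y : E | 4 * r₁ ^ 2 < ‖y‖ ^ 2 - ⟪y, a⟫ ^ 2 ∧ ‖y‖ ^ 2 - ⟪y, a⟫ ^ 2 < r₂ ^ 2 / 4 ∧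
        ⟪y, a⟫ ^ 2 < r₂ ^ 2 / 4} ∧
      MeasurableSet {y : E | r₁ ^ 2 < ‖y‖ ^ 2 - ⟪y, a⟫ ^ 2 ∧ ‖y‖ ^ 2 - ⟪y, a⟫ ^ 2 < r₂ ^ 2 ∧ ⟪y, a⟫ ^ 2 < r₂ ^ 2} ∧
      Bornology.IsBounded {y : E | r₁ ^ 2 < ‖y‖ ^ 2 - ⟪y, a⟫ ^ 2 ∧ ‖y‖ ^ 2 - ⟪y, a⟫ ^ 2 < r₂ ^ 2 ∧ ⟪y, a⟫ ^ 2 < r₂ ^ 2} ∧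
      {y : E | 4 * r₁ ^ 2 < ‖y‖ ^ 2 - ⟪y, a⟫ ^ 2 ∧ ‖y‖ ^ 2 - ⟪y, a⟫ ^ 2 < r₂ ^ 2 / 4 ∧ ⟪y, a⟫ ^ 2 < r₂ ^ 2 / 4} ⊆
        {y : E | r₁ ^ 2 < ‖y‖ ^ 2 - ⟪y, a⟫ ^ 2 ∧ ‖y‖ ^ 2 - ⟪y, a⟫ ^ 2 < r₂ ^ 2 ∧ ⟪y, a⟫ ^ 2 < r₂ ^ 2} ∧
      {y : E | r₁ ^ 2 < ‖y‖ ^ 2 - ⟪y, a⟫ ^ 2 ∧ ‖y‖ ^ 2 - ⟪y, a⟫ ^ 2 < r₂ ^ 2 ∧ ⟪y, a⟫ ^ 2 < r₂ ^ 2} ⊆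
        closedBall (0 : E) (2 * |r₂|) := by
  have hcM : Continuous fun y : E => ‖y‖ ^ 2 - ⟪y, a⟫ ^ 2 :=
    (continuous_norm.pow 2).sub ((continuous_id.inner continuous_const).pow 2)
  have hcZ : Continuous fun y : E => ⟪y, a⟫ ^ 2 := (continuous_id.inner continuous_const).pow 2
  have o1 : IsOpen {y : E | 4 * r₁ ^ 2 < ‖y‖ ^ 2 - ⟪y, a⟫ ^ 2 ∧ ‖y‖ ^ 2 - ⟪y, a⟫ ^ 2 < r₂ ^ 2 / 4 ∧
      ⟪y, a⟫ ^ 2 < r₂ ^ 2 / 4} :=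
    (isOpen_lt continuous_const hcM).inter ((isOpen_lt hcM continuous_const).inter (isOpen_lt hcZ continuous_const))
  have o2 : IsOpen {y : E | r₁ ^ 2 < ‖y‖ ^ 2 - ⟪y, a⟫ ^ 2 ∧ ‖y‖ ^ 2 - ⟪y, a⟫ ^ 2 < r₂ ^ 2 ∧ ⟪y, a⟫ ^ 2 < r₂ ^ 2} :=
    (isOpen_lt continuous_const hcM).inter ((isOpen_lt hcM continuous_const).inter (isOpen_lt hcZ continuous_const))
  have hsub : {y : E | r₁ ^ 2 < ‖y‖ ^ 2 - ⟪y, a⟫ ^ 2 ∧ ‖y‖ ^ 2 - ⟪y, a⟫ ^ 2 < r₂ ^ 2 ∧ ⟪y, a⟫ ^ 2 < r₂ ^ 2} ⊆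
      closedBall (0 : E) (2 * |r₂|) := fun y hy => by
    rw [mem_closedBall, dist_zero_right]
    have h1 : ‖y‖ ^ 2 < (2 * |r₂|) ^ 2 := by
      rw [mul_pow, sq_abs]
      nlinarith [hy.2.1, hy.2.2, sq_nonneg r₂]
    exact (lt_of_pow_lt_pow_left₀ 2 (by positivity) h1).le
  refine ⟨o1.measurableSet, o2.measurableSet, isBounded_closedBall.subset hsub, fun y hy => ⟨?_, ?_, ?_⟩, hsub⟩
  · nlinarith [hy.1, sq_nonneg r₁]
  · nlinarith [hy.2.1, sq_nonneg r₂]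
  · nlinarith [hy.2.2, sq_nonneg r₂]

include hψ0 hW in
omit [FiniteDimensional ℝ E] [MeasurableSpace E] [BorelSpace E] in
/-- The cut-off field vanishes where `ψ` does. [folklore] -/
theorem cylField_eq_zero {s : ℝ} {x : E}
    (hx : m (s, x) ≤ 36 / 25 * r₁ ^ 2 ∨ 81 / 100 * r₂ ^ 2 ≤ m (s, x) ∨ 9 / 25 * r₂ ^ 2 ≤ ⟪x, a⟫ ^ 2) :
    W (s, x) = 0 := by
  rw [hW]
  simp [hψ0 (s, x) hx]

include hm in
omit [FiniteDimensional ℝ E] [MeasurableSpace E] [BorelSpace E] in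
/-- Outside `B̄(0, 2|r₂|)` one is in the vanishing region of the cut-off (strict form). [folklore] -/
theorem cyl_vout {s : ℝ} {x : E} (hx : x ∉ closedBall (0 : E) (2 * |r₂|)) :
    81 / 100 * r₂ ^ 2 < m (s, x) ∨ 9 / 25 * r₂ ^ 2 < ⟪x, a⟫ ^ 2 := by
  rw [mem_closedBall, dist_zero_right, not_le] at hx
  have h2 : 4 * r₂ ^ 2 < ‖x‖ ^ 2 := by
    have := sq_lt_sq' (by linarith [abs_nonneg r₂, norm_nonneg x, mul_nonneg zero_le_two (abs_nonneg r₂)]) hx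
    rwa [mul_pow, sq_abs, show (2 : ℝ) ^ 2 * r₂ ^ 2 = 4 * r₂ ^ 2 by norm_num] at this
  rw [cylSq_slice hm]
  by_contra h
  rw [not_or, not_lt, not_lt] at h
  nlinarith [h.1, h.2, sq_nonneg r₂]

include hm hψ0 hW in
omit [FiniteDimensional ℝ E] [MeasurableSpace E] [BorelSpace E] in
/-- Slice support in `B̄(0, 2|r₂|)`, and vanishing on `m ≤ r₁²`. [folklore] -/
theorem cylField_support :
    (∀ s ∈ Ioo 0 T, ∀ x ∉ closedBall (0 : E) (2 * |r₂|), W (s, x) = 0) ∧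
      (∀ s ∈ Ioo 0 T, ∀ x : E, m (s, x) ≤ r₁ ^ 2 → W (s, x) = 0) := by
  refine ⟨fun s _ x hx => cylField_eq_zero hψ0 hW (Or.inr ?_), fun s _ x hx => cylField_eq_zero hψ0 hW (Or.inl ?_)⟩
  · exact (cyl_vout hm hx).imp le_of_lt le_of_lt
  · nlinarith [sq_nonneg r₁]

include hψ1 hψd0 hGS hGW hW in
omit [MeasurableSpace E] [BorelSpace E] in
/-- **On the plateau the cut-off is invisible**: `GW = GS` and `W = u` for
`4r₁² < m < r₂²/4`, `⟪x,a⟫² < r₂²/4`. [folklore] -/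
theorem cylField_plateau {z : ℝ × E} (hz : 4 * r₁ ^ 2 < m z ∧ m z < r₂ ^ 2 / 4 ∧ ⟪z.2, a⟫ ^ 2 < r₂ ^ 2 / 4) :
    GW z = GS z ∧ W z = uncurry u z := by
  have h1 : ψ z = 1 := hψ1 z hz.1.le hz.2.1.le hz.2.2.le
  have h0 := (hψd0 z (Or.inr (Or.inr (Or.inr hz)))).1
  refine ⟨?_, ?_⟩
  · rw [hGW, hGS]
    exact Finset.sum_congr rfl fun i _ => by rw [h1, h0, one_smul, zero_smul, add_zero]
  · rw [hW]
    simp [h1]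

include hψnn hψle hψg hψ0 hψd0 hGS hGW in
omit [MeasurableSpace E] [BorelSpace E] in
/-- `GW ≤ 2 GS + 2 (C/r₁²) |u|²` everywhere, and `GW = 0` off the support of `ψ`. [cite: Palasek2021, §4 (proof of Prop 9: "`|∇(ψu)|² ≲ |∇u|² + (C₀T)⁻¹|u|²`")] -/
theorem cylField_GW_le (z : ℝ × E) :
    GW z ≤ 2 * GS z + 2 * (Cψ / r₁ ^ 2) * ‖u z.1 z.2‖ ^ 2 ∧
      (m z < 36 / 25 * r₁ ^ 2 ∨ 81 / 100 * r₂ ^ 2 < m z ∨ 9 / 25 * r₂ ^ 2 < ⟪z.2, a⟫ ^ 2 → GW z = 0) := by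
  rw [hGW, hGS]
  refine ⟨?_, fun hz => ?_⟩
  · have hψ2 : ψ z ^ 2 ≤ 1 := by nlinarith [hψnn z, hψle z]
    calc ∑ i, ‖ψ z • fderiv ℝ (u z.1) z.2 (stdOrthonormalBasis ℝ E i) +
          dx (stdOrthonormalBasis ℝ E i) ψ z • u z.1 z.2‖ ^ 2
        ≤ ∑ i, (2 * ψ z ^ 2 * ‖fderiv ℝ (u z.1) z.2 (stdOrthonormalBasis ℝ E i)‖ ^ 2 +
            2 * dx (stdOrthonormalBasis ℝ E i) ψ z ^ 2 * ‖u z.1 z.2‖ ^ 2) :=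
          Finset.sum_le_sum fun i _ => norm_smul_add_smul_sq_le _ _ _ _
      _ = 2 * ψ z ^ 2 * ∑ i, ‖fderiv ℝ (u z.1) z.2 (stdOrthonormalBasis ℝ E i)‖ ^ 2 +
            2 * gradSq ψ z * ‖u z.1 z.2‖ ^ 2 := by
          simp only [gradSq, Finset.mul_sum, Finset.sum_mul, ← Finset.sum_add_distrib]
          refine Finset.sum_congr rfl fun i _ => ?_
          rw [Real.norm_eq_abs, sq_abs]
      _ ≤ 2 * 1 * ∑ i, ‖fderiv ℝ (u z.1) z.2 (stdOrthonormalBasis ℝ E i)‖ ^ 2 +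
            2 * (Cψ / r₁ ^ 2) * ‖u z.1 z.2‖ ^ 2 := by
          have hS0 : 0 ≤ ∑ i, ‖fderiv ℝ (u z.1) z.2 (stdOrthonormalBasis ℝ E i)‖ ^ 2 :=
            Finset.sum_nonneg fun i _ => sq_nonneg _
          have hu2 : 0 ≤ ‖u z.1 z.2‖ ^ 2 := sq_nonneg _
          have hg := hψg z
          nlinarith [mul_le_mul_of_nonneg_right hψ2 hS0, mul_le_mul_of_nonneg_right hg hu2]
      _ = _ := by ring
  · have hψz : ψ z = 0 := hψ0 z (hz.elim (fun h => Or.inl h.le) fun h => Or.inr (h.imp le_of_lt le_of_lt))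
    have hd : ∀ e, dx e ψ z = 0 :=
      (hψd0 z (hz.elim (fun h => Or.inl h) fun h => Or.inr (h.elim (fun h' => Or.inl h') fun h' => Or.inr (Or.inl h')))).1
    exact Finset.sum_eq_zero fun i _ => by
      rw [hψz, hd, zero_smul, zero_smul, add_zero, norm_zero, zero_pow two_ne_zero]

set_option maxHeartbeats 400000 in
include hm hr₁ hr₁₂ hu hψs hψnn hψle hψt hψ1 hψ0 hψd0 hψg hψl hW hGS in
omit [MeasurableSpace E] [BorelSpace E] in
/-- **The backwards heat operator of the cylindrical cut-off field** (Palasek: "In the region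
`{2r₋ ≤ r ≤ r₊/2, |z| ≤ r₊/2}`, `ψ` is identically `1` so … `L(ψu) = Lu` … throughout all of `𝒞`,
using the bounds on `∇ʲψ` and `r₋`, `|L(ψu)|² = |ψLu + 2∇ψ·∇u + (Δψ)u|² ≲ (C₀T)⁻²|u|² + (C₀T)⁻¹|∇u|²`"),
with `b = (C₀T)⁻¹`, the shell condition `4 ≤ b r₁²`, `C_sh = 4(1 + C)²`. [cite: Palasek2021, §4 (proof of Prop 9)] -/
theorem cylField_norm_sq_L_le (hCψ : 0 ≤ Cψ) (hb : 0 < b) (hbr : 4 ≤ b * r₁ ^ 2)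
    (hL : ∀ t ∈ Ioo 0 T, ∀ x : E, r₁ ^ 2 ≤ ‖x‖ ^ 2 - ⟪x, a⟫ ^ 2 → ‖x‖ ^ 2 - ⟪x, a⟫ ^ 2 ≤ r₂ ^ 2 → ⟪x, a⟫ ^ 2 ≤ r₂ ^ 2 →
      ‖FluidPDE.timeDeriv u t x + Δ (u t) x‖ ≤ b * ‖u t x‖ + Real.sqrt b * ‖fderiv ℝ (u t) x‖)
    {t : ℝ} (ht : t ∈ Ioo 0 T) (x : E) :
    ‖dt W (t, x) + lap W (t, x)‖ ^ 2 ≤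
      {y : E | 4 * r₁ ^ 2 < ‖y‖ ^ 2 - ⟪y, a⟫ ^ 2 ∧ ‖y‖ ^ 2 - ⟪y, a⟫ ^ 2 < r₂ ^ 2 / 4 ∧ ⟪y, a⟫ ^ 2 < r₂ ^ 2 / 4}.indicator
          (fun x => 2 * (b ^ 2 * ‖u t x‖ ^ 2 + b * GS (t, x))) x +
        ({y : E | r₁ ^ 2 < ‖y‖ ^ 2 - ⟪y, a⟫ ^ 2 ∧ ‖y‖ ^ 2 - ⟪y, a⟫ ^ 2 < r₂ ^ 2 ∧ ⟪y, a⟫ ^ 2 < r₂ ^ 2} \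
          {y : E | 4 * r₁ ^ 2 < ‖y‖ ^ 2 - ⟪y, a⟫ ^ 2 ∧ ‖y‖ ^ 2 - ⟪y, a⟫ ^ 2 < r₂ ^ 2 / 4 ∧ ⟪y, a⟫ ^ 2 < r₂ ^ 2 / 4}).indicator
          (fun x => 4 * (1 + Cψ) ^ 2 * (b ^ 2 * ‖u t x‖ ^ 2 + b * GS (t, x))) x := by
  have hSo : IsOpen (Ioo 0 T ×ˢ (univ : Set E)) := isOpen_Ioo.prod isOpen_univ
  have hz : ((t, x) : ℝ × E) ∈ Ioo 0 T ×ˢ (univ : Set E) := mk_mem_prod ht (mem_univ x)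
  have hus : ContDiffOn ℝ 2 (uncurry u) (Ioo 0 T ×ˢ univ) := contDiffOn_strip_of_slab hu
  have hψ2 : ContDiff ℝ 2 ψ := hψs.of_le (WithTop.coe_le_coe.2 le_top)
  have hr₂ : 0 < r₂ := by linarith
  have hr₁2 : 0 < r₁ ^ 2 := by positivity
  have hmx : m (t, x) = ‖x‖ ^ 2 - ⟪x, a⟫ ^ 2 := cylSq_slice hm t x
  -- Leibniz
  have hLeib : dt W (t, x) + lap W (t, x) = ψ (t, x) • (dt (uncurry u) (t, x) + lap (uncurry u) (t, x)) +
      (dt ψ (t, x) + lap ψ (t, x)) • u t x +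
      (2 : ℝ) • ∑ i, dx (stdOrthonormalBasis ℝ E i) ψ (t, x) • dx (stdOrthonormalBasis ℝ E i) (uncurry u) (t, x) := by
    rw [hW]
    exact dt_add_lap_smul_apply hSo hψ2 hus hz
  have hLu : dt (uncurry u) (t, x) + lap (uncurry u) (t, x) = FluidPDE.timeDeriv u t x + Δ (u t) x := by
    rw [dt_uncurry (differentiableAt_uncurry_of_slab hu two_ne_zero ht x), lap_uncurry hSo hz hus]
  have hgradU : gradSq (uncurry u) (t, x) = GS (t, x) := by
    rw [hGS]
    unfold gradSq
    exact Finset.sum_congr rfl fun i _ => by rw [fderiv_slice_eq_dx hu two_ne_zero ht x]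
  have hGS0 : 0 ≤ GS (t, x) := by rw [← hgradU]; exact gradSq_nonneg _ _
  have hGop : ‖fderiv ℝ (u t) x‖ ^ 2 ≤ GS (t, x) := by
    rw [hGS]
    exact opNorm_sq_le_sum_sq _
  have hsqb : Real.sqrt b ^ 2 = b := Real.sq_sqrt hb.le
  -- `|Lu|² ≤ 2b²|u|² + 2b GS` wherever the differential inequality applies
  have hLu2 : r₁ ^ 2 ≤ ‖x‖ ^ 2 - ⟪x, a⟫ ^ 2 → ‖x‖ ^ 2 - ⟪x, a⟫ ^ 2 ≤ r₂ ^ 2 → ⟪x, a⟫ ^ 2 ≤ r₂ ^ 2 →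
      ‖FluidPDE.timeDeriv u t x + Δ (u t) x‖ ^ 2 ≤ 2 * (b ^ 2 * ‖u t x‖ ^ 2 + b * GS (t, x)) := fun h1 h2 h3 => by
    have hb' := hL t ht x h1 h2 h3
    calc ‖FluidPDE.timeDeriv u t x + Δ (u t) x‖ ^ 2
        ≤ (b * ‖u t x‖ + Real.sqrt b * ‖fderiv ℝ (u t) x‖) ^ 2 := pow_le_pow_left₀ (norm_nonneg _) hb' 2
      _ ≤ 2 * (b * ‖u t x‖) ^ 2 + 2 * (Real.sqrt b * ‖fderiv ℝ (u t) x‖) ^ 2 := by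
          nlinarith [sq_nonneg (b * ‖u t x‖ - Real.sqrt b * ‖fderiv ℝ (u t) x‖)]
      _ = 2 * (b ^ 2 * ‖u t x‖ ^ 2 + b * ‖fderiv ℝ (u t) x‖ ^ 2) := by
          rw [mul_pow, mul_pow, hsqb]
          ring
      _ ≤ 2 * (b ^ 2 * ‖u t x‖ ^ 2 + b * GS (t, x)) := by
          nlinarith [mul_le_mul_of_nonneg_left hGop hb.le]
  set PL : Set E := {y : E | 4 * r₁ ^ 2 < ‖y‖ ^ 2 - ⟪y, a⟫ ^ 2 ∧ ‖y‖ ^ 2 - ⟪y, a⟫ ^ 2 < r₂ ^ 2 / 4 ∧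
    ⟪y, a⟫ ^ 2 < r₂ ^ 2 / 4} with hPL
  set AN : Set E := {y : E | r₁ ^ 2 < ‖y‖ ^ 2 - ⟪y, a⟫ ^ 2 ∧ ‖y‖ ^ 2 - ⟪y, a⟫ ^ 2 < r₂ ^ 2 ∧ ⟪y, a⟫ ^ 2 < r₂ ^ 2}
    with hAN
  by_cases hpl : 4 * r₁ ^ 2 < ‖x‖ ^ 2 - ⟪x, a⟫ ^ 2 ∧ ‖x‖ ^ 2 - ⟪x, a⟫ ^ 2 < r₂ ^ 2 / 4 ∧ ⟪x, a⟫ ^ 2 < r₂ ^ 2 / 4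
  · -- plateau: `LW = Lu`
    have hxpl : x ∈ PL := hpl
    have hxsh : x ∉ AN \ PL := fun h => h.2 hxpl
    rw [indicator_of_mem hxpl, indicator_of_notMem hxsh, add_zero]
    have hge : r₁ ^ 2 ≤ ‖x‖ ^ 2 - ⟪x, a⟫ ^ 2 := by nlinarith [hpl.1]
    have hle : ‖x‖ ^ 2 - ⟪x, a⟫ ^ 2 ≤ r₂ ^ 2 := by nlinarith [hpl.2.1, sq_nonneg r₂]
    have hza : ⟪x, a⟫ ^ 2 ≤ r₂ ^ 2 := by nlinarith [hpl.2.2, sq_nonneg r₂]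
    have hpl' : 4 * r₁ ^ 2 < m (t, x) ∧ m (t, x) < r₂ ^ 2 / 4 ∧ ⟪x, a⟫ ^ 2 < r₂ ^ 2 / 4 := by rw [hmx]; exact hpl
    have hψ1x : ψ (t, x) = 1 := hψ1 (t, x) hpl'.1.le hpl'.2.1.le hpl'.2.2.le
    obtain ⟨hd0, hl0⟩ := hψd0 (t, x) (Or.inr (Or.inr (Or.inr hpl')))
    have h1 : dt W (t, x) + lap W (t, x) = FluidPDE.timeDeriv u t x + Δ (u t) x := by
      rw [hLeib, hLu, hψ1x, hψt, hl0, one_smul, zero_add, zero_smul, add_zero]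
      rw [Finset.sum_eq_zero fun i _ => by rw [hd0, zero_smul], smul_zero, add_zero]
    rw [h1]
    exact hLu2 hge hle hza
  · have hxpl : x ∉ PL := hpl
    rw [indicator_of_notMem hxpl, zero_add]
    by_cases hann : r₁ ^ 2 < ‖x‖ ^ 2 - ⟪x, a⟫ ^ 2 ∧ ‖x‖ ^ 2 - ⟪x, a⟫ ^ 2 < r₂ ^ 2 ∧ ⟪x, a⟫ ^ 2 < r₂ ^ 2
    · -- the transition layers
      have hxsh : x ∈ AN \ PL := ⟨hann, hpl⟩
      rw [indicator_of_mem hxsh]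
      have hb' := hL t ht x hann.1.le hann.2.1.le hann.2.2.le
      have hcross := norm_sum_dx_smul_dx_le ψ (uncurry u) (t, x)
      rw [hgradU] at hcross
      have hnormLW : ‖dt W (t, x) + lap W (t, x)‖ ≤
          (b * ‖u t x‖ + Real.sqrt b * ‖fderiv ℝ (u t) x‖) + Cψ / r₁ ^ 2 * ‖u t x‖ +
            2 * (Real.sqrt (Cψ / r₁ ^ 2) * Real.sqrt (GS (t, x))) := by
        rw [hLeib, hLu, hψt, zero_add]
        refine (norm_add₃_le ..).trans ?_
        have e1 : ‖ψ (t, x) • (FluidPDE.timeDeriv u t x + Δ (u t) x)‖ ≤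
            b * ‖u t x‖ + Real.sqrt b * ‖fderiv ℝ (u t) x‖ := by
          rw [norm_smul, Real.norm_eq_abs, abs_of_nonneg (hψnn _)]
          calc ψ (t, x) * ‖FluidPDE.timeDeriv u t x + Δ (u t) x‖
              ≤ 1 * ‖FluidPDE.timeDeriv u t x + Δ (u t) x‖ :=
                mul_le_mul_of_nonneg_right (hψle _) (norm_nonneg _)
            _ ≤ _ := by rw [one_mul]; exact hb'
        have e2 : ‖lap ψ (t, x) • u t x‖ ≤ Cψ / r₁ ^ 2 * ‖u t x‖ := by
          rw [norm_smul, Real.norm_eq_abs]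
          exact mul_le_mul_of_nonneg_right (hψl _) (norm_nonneg _)
        have e3 : ‖(2 : ℝ) • ∑ i, dx (stdOrthonormalBasis ℝ E i) ψ (t, x) •
            dx (stdOrthonormalBasis ℝ E i) (uncurry u) (t, x)‖ ≤
            2 * (Real.sqrt (Cψ / r₁ ^ 2) * Real.sqrt (GS (t, x))) := by
          rw [norm_smul, Real.norm_eq_abs, abs_of_nonneg (by norm_num : (0 : ℝ) ≤ 2)]
          refine mul_le_mul_of_nonneg_left (hcross.trans ?_) (by norm_num)
          exact mul_le_mul_of_nonneg_right (Real.sqrt_le_sqrt (hψg _)) (Real.sqrt_nonneg _)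
        linarith
      have hsq := pow_le_pow_left₀ (norm_nonneg _) hnormLW 2
      refine hsq.trans ?_
      have h4 : ∀ a₁ a₂ a₃ a₄ : ℝ, (a₁ + a₂ + a₃ + a₄) ^ 2 ≤ 4 * (a₁ ^ 2 + a₂ ^ 2 + a₃ ^ 2 + a₄ ^ 2) :=
        fun a₁ a₂ a₃ a₄ => by
          nlinarith [sq_nonneg (a₁ - a₂), sq_nonneg (a₁ - a₃), sq_nonneg (a₁ - a₄), sq_nonneg (a₂ - a₃),
            sq_nonneg (a₂ - a₄), sq_nonneg (a₃ - a₄)]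
      refine (h4 _ _ _ _).trans ?_
      -- `1/r₁² ≤ b/4`
      have hrinv : (r₁ ^ 2)⁻¹ ≤ b / 4 := by
        rw [inv_le_comm₀ hr₁2 (by positivity), inv_div]
        rw [div_le_iff₀ hb]
        linarith
      have s1 : (b * ‖u t x‖) ^ 2 = b ^ 2 * ‖u t x‖ ^ 2 := by ring
      have s2 : (Real.sqrt b * ‖fderiv ℝ (u t) x‖) ^ 2 ≤ b * GS (t, x) := by
        rw [mul_pow, hsqb]
        exact mul_le_mul_of_nonneg_left hGop hb.le
      have s3 : (Cψ / r₁ ^ 2 * ‖u t x‖) ^ 2 ≤ Cψ ^ 2 / 16 * (b ^ 2 * ‖u t x‖ ^ 2) := by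
        have hp : (r₁ ^ 2)⁻¹ ^ 2 ≤ (b / 4) ^ 2 := pow_le_pow_left₀ (inv_nonneg.2 hr₁2.le) hrinv 2
        have h := mul_le_mul_of_nonneg_left hp (by positivity : (0 : ℝ) ≤ Cψ ^ 2 * ‖u t x‖ ^ 2)
        calc (Cψ / r₁ ^ 2 * ‖u t x‖) ^ 2 = Cψ ^ 2 * ‖u t x‖ ^ 2 * (r₁ ^ 2)⁻¹ ^ 2 := by
              rw [div_eq_mul_inv]
              ring
          _ ≤ Cψ ^ 2 * ‖u t x‖ ^ 2 * (b / 4) ^ 2 := h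
          _ = _ := by ring
      have s4 : (2 * (Real.sqrt (Cψ / r₁ ^ 2) * Real.sqrt (GS (t, x)))) ^ 2 ≤ Cψ * (b * GS (t, x)) := by
        have h := mul_le_mul_of_nonneg_left hrinv (by positivity : (0 : ℝ) ≤ 4 * Cψ * GS (t, x))
        calc (2 * (Real.sqrt (Cψ / r₁ ^ 2) * Real.sqrt (GS (t, x)))) ^ 2
            = 4 * (Real.sqrt (Cψ / r₁ ^ 2) ^ 2 * Real.sqrt (GS (t, x)) ^ 2) := by ring
          _ = 4 * Cψ * GS (t, x) * (r₁ ^ 2)⁻¹ := by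
              rw [Real.sq_sqrt (by positivity), Real.sq_sqrt hGS0, div_eq_mul_inv]
              ring
          _ ≤ 4 * Cψ * GS (t, x) * (b / 4) := h
          _ = _ := by ring
      have hg2 : 0 ≤ b * GS (t, x) := by positivity
      have key : 4 * (1 + Cψ) ^ 2 * (b ^ 2 * ‖u t x‖ ^ 2 + b * GS (t, x)) -
          4 * (b ^ 2 * ‖u t x‖ ^ 2 + b * GS (t, x) + Cψ ^ 2 / 16 * (b ^ 2 * ‖u t x‖ ^ 2) + Cψ * (b * GS (t, x))) =
          4 * ((2 * Cψ + 15 / 16 * Cψ ^ 2) * (b ^ 2 * ‖u t x‖ ^ 2) + (Cψ + Cψ ^ 2) * (b * GS (t, x))) := by ring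
      have key0 : 0 ≤ 4 * ((2 * Cψ + 15 / 16 * Cψ ^ 2) * (b ^ 2 * ‖u t x‖ ^ 2) + (Cψ + Cψ ^ 2) * (b * GS (t, x))) := by
        positivity
      linarith [s1, s2, s3, s4, key, key0]
    · -- outside the open truncated shell: `LW = 0`
      have hxsh : x ∉ AN \ PL := fun h => hann h.1
      rw [indicator_of_notMem hxsh]
      have hout : m (t, x) < 36 / 25 * r₁ ^ 2 ∨ 81 / 100 * r₂ ^ 2 < m (t, x) ∨ 9 / 25 * r₂ ^ 2 < ⟪x, a⟫ ^ 2 := by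
        rw [hmx]
        have hA : r₁ ^ 2 < 36 / 25 * r₁ ^ 2 := by nlinarith
        have hr₂2 : 0 < r₂ ^ 2 := by positivity
        have hB : 81 / 100 * r₂ ^ 2 < r₂ ^ 2 := by nlinarith
        have hC : 9 / 25 * r₂ ^ 2 < r₂ ^ 2 := by nlinarith
        rcases not_and_or.1 hann with h | h
        · left
          push Not at h
          linarith
        · rcases not_and_or.1 h with h | h
          · right; left
            push Not at h
            linarith
          · right; right
            push Not at h
            linarith
      have hψz : ψ (t, x) = 0 := hψ0 (t, x) (hout.imp le_of_lt fun h => h.imp le_of_lt le_of_lt)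
      obtain ⟨hd0, hl0⟩ := hψd0 (t, x) (hout.elim (fun h => Or.inl h) fun h =>
        Or.inr (h.elim (fun h' => Or.inl h') fun h' => Or.inr (Or.inl h')))
      have h0 : dt W (t, x) + lap W (t, x) = 0 := by
        rw [hLeib, hψz, hψt, hl0, zero_smul, add_zero, zero_smul, zero_add, zero_add]
        rw [Finset.sum_eq_zero fun i _ => by rw [hd0, zero_smul], smul_zero]
      rw [h0, norm_zero, zero_pow two_ne_zero]

end CylField

/-! ### The core inequality for the cylindrical cut-off field -/

section CylCore

variable [FiniteDimensional ℝ E] [MeasurableSpace E] [BorelSpace E]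
variable {F : Type*} [NormedAddCommGroup F] [InnerProductSpace ℝ F]
variable {a : E} (ha : ‖a‖ = 1) {m : ℝ × E → ℝ} (hm : m = fun y : ℝ × E => ‖y.2‖ ^ 2 - ⟪y.2, a⟫ ^ 2)
variable {T r₁ r₂ Cψ b α T₀ : ℝ} {u : ℝ → E → F} {ψ : ℝ × E → ℝ} {P : ℝ → ℝ} {g Φ : ℝ × E → ℝ} {W : ℝ × E → F}
  {GS GW : ℝ × E → ℝ} {Eb Qp Pin Psh Iin : ℝ → ℝ} {PL AN : Set E}
variable (hT : 0 < T) (hr₁ : 0 < r₁) (hr₁₂ : 8 * r₁ ≤ r₂) (hb : 0 < b) (hα : 0 ≤ α) (hT₀ : 0 < T₀) (hT₀T : T₀ < T)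
  (hd3 : Module.finrank ℝ E = 3)
  (hu : ContDiffOn ℝ 2 (uncurry u) (Icc 0 T ×ˢ univ))
  (hψs : ContDiff ℝ (⊤ : ℕ∞) ψ)
  (hψnn : ∀ z, 0 ≤ ψ z) (hψle : ∀ z, ψ z ≤ 1) (hψt : ∀ z, dt ψ z = 0)
  (hψ1 : ∀ z : ℝ × E, 4 * r₁ ^ 2 ≤ m z → m z ≤ r₂ ^ 2 / 4 → ⟪z.2, a⟫ ^ 2 ≤ r₂ ^ 2 / 4 → ψ z = 1)
  (hψ0 : ∀ z : ℝ × E, m z ≤ 36 / 25 * r₁ ^ 2 ∨ 81 / 100 * r₂ ^ 2 ≤ m z ∨ 9 / 25 * r₂ ^ 2 ≤ ⟪z.2, a⟫ ^ 2 → ψ z = 0)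
  (hψd0 : ∀ z : ℝ × E, (m z < 36 / 25 * r₁ ^ 2 ∨ 81 / 100 * r₂ ^ 2 < m z ∨ 9 / 25 * r₂ ^ 2 < ⟪z.2, a⟫ ^ 2 ∨
      (4 * r₁ ^ 2 < m z ∧ m z < r₂ ^ 2 / 4 ∧ ⟪z.2, a⟫ ^ 2 < r₂ ^ 2 / 4)) → (∀ e, dx e ψ z = 0) ∧ lap ψ z = 0)
  (hψg : ∀ z, gradSq ψ z ≤ Cψ / r₁ ^ 2) (hψl : ∀ z, |lap ψ z| ≤ Cψ / r₁ ^ 2)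
  (hP : ContDiff ℝ (⊤ : ℕ∞) P)
  (hreg : ∀ s, r₁ ^ 2 / 4 < s → P s = Real.sqrt s ∧ deriv P s = 1 / (2 * Real.sqrt s) ∧
    deriv (deriv P) s = -1 / (4 * s * Real.sqrt s) ∧ deriv (deriv (deriv P)) s = 3 / (8 * s ^ 2 * Real.sqrt s))
  (hg : g = fun z : ℝ × E => α * (T₀ - z.1) * P (m z) + b * ‖z.2‖ ^ 2)
  (hΦ : Φ = fun z : ℝ × E => -(α + 4 * b * α * (T₀ - z.1)) * P (m z) +
    -(2 * ((Module.finrank ℝ E : ℝ) - 2) * α * (T₀ - z.1)) * deriv P (m z) +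
    (-(2 * b * (Module.finrank ℝ E : ℝ)) - (α * (T₀ - z.1)) ^ 2) + -(4 * b ^ 2) * ‖z.2‖ ^ 2)
  (hW : W = fun z => ψ z • uncurry u z)
  (hGS : GS = fun z : ℝ × E => ∑ i, ‖fderiv ℝ (u z.1) z.2 (stdOrthonormalBasis ℝ E i)‖ ^ 2)
  (hGW : GW = fun z : ℝ × E => ∑ i, ‖ψ z • fderiv ℝ (u z.1) z.2 (stdOrthonormalBasis ℝ E i) +
    dx (stdOrthonormalBasis ℝ E i) ψ z • u z.1 z.2‖ ^ 2)
  (hPLdef : PL = {y : E | 4 * r₁ ^ 2 < ‖y‖ ^ 2 - ⟪y, a⟫ ^ 2 ∧ ‖y‖ ^ 2 - ⟪y, a⟫ ^ 2 < r₂ ^ 2 / 4 ∧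
    ⟪y, a⟫ ^ 2 < r₂ ^ 2 / 4})
  (hANdef : AN = {y : E | r₁ ^ 2 < ‖y‖ ^ 2 - ⟪y, a⟫ ^ 2 ∧ ‖y‖ ^ 2 - ⟪y, a⟫ ^ 2 < r₂ ^ 2 ∧ ⟪y, a⟫ ^ 2 < r₂ ^ 2})
  (hEb : Eb = fun t => ∫ x, (GW (t, x) + 1 / 2 * Φ (t, x) * ‖ψ (t, x) • u t x‖ ^ 2) * Real.exp (g (t, x)))
  (hQp : Qp = fun t => ∫ x, (28 * b ^ 2 * ‖ψ (t, x) • u t x‖ ^ 2 + 4 * b * GW (t, x)) * Real.exp (g (t, x)))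
  (hPin : Pin = fun t => ∫ x in PL, 2 * (b ^ 2 * ‖u t x‖ ^ 2 + b * GS (t, x)) * Real.exp (g (t, x)))
  (hPsh : Psh = fun t => ∫ x in AN \ PL, 4 * (1 + Cψ) ^ 2 * (b ^ 2 * ‖u t x‖ ^ 2 + b * GS (t, x)) * Real.exp (g (t, x)))
  (hIin : Iin = fun t => ∫ x in PL, (27 * b ^ 2 * ‖u t x‖ ^ 2 + 3 * b * GS (t, x)) * Real.exp (g (t, x)))

/-! #### Sets, in the named form -/

include hPLdef hANdef in
omit [FiniteDimensional ℝ E] in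
/-- `PL`, `AN` measurable, `AN` bounded, `PL ⊆ AN ⊆ B̄(0, 2|r₂|)`. [folklore] -/
theorem cyl_sets' : MeasurableSet PL ∧ MeasurableSet AN ∧ Bornology.IsBounded AN ∧ PL ⊆ AN ∧
    AN ⊆ closedBall (0 : E) (2 * |r₂|) := by
  rw [hPLdef, hANdef]
  exact cyl_sets a r₁ r₂

/-! #### The weight and `Φ` on the support -/

include hm hP hg in
omit [MeasurableSpace E] [BorelSpace E] [FiniteDimensional ℝ E] in
/-- `eᵍ` is continuous. [folklore] -/
theorem continuous_exp_cylWeight : Continuous fun z : ℝ × E => Real.exp (g z) :=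
  Real.continuous_exp.comp (contDiff_cylWeight hm hP hg).continuous

include ha hm hP hg hr₁ hreg hΦ hα hb hd3 in
omit [MeasurableSpace E] [BorelSpace E] in
/-- **`F ≤ 0` and `LF ≥ 56 b²` on the support** (Palasek: "`F ≤ 0` … letting `C₀ ≥ 3(d₁+d₂)`,
`LF ≥ r₊r/(C₀²T³) ≥ 4/(C₀T²)`"; here, in dimension `3`, for `r₁² ≤ m`, `0 ≤ t ≤ T₀ ≤ T`, and the
side conditions `4 ≤ b r₁²`, `4T ≤ r₁²`, `40 b ≤ α r₁`, one gets `LF ≥ 56 b²` exactly as in the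
annular case). [cite: Palasek2021, §4 (proof of Prop 9)] -/
theorem Phi_cyl_support_bounds (hbr : 4 ≤ b * r₁ ^ 2) (h4T : 4 * T ≤ r₁ ^ 2) (hαr : 40 * b ≤ α * r₁) (hT₀T' : T₀ ≤ T)
    {z : ℝ × E} (hz : r₁ ^ 2 ≤ m z) (ht0 : 0 ≤ z.1) (htT : z.1 ≤ T₀) :
    Φ z ≤ 0 ∧ 56 * b ^ 2 ≤ dt Φ z + lap Φ z := by
  have hzr : r₁ ^ 2 / 4 < m z := by nlinarith [sq_nonneg r₁, hr₁]
  obtain ⟨hn, hs⟩ := sqrt_cylSq_region hr₁ hzr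
  have hd : (Module.finrank ℝ E : ℝ) = 3 := by exact_mod_cast hd3
  have hτ : 0 ≤ α * (T₀ - z.1) := mul_nonneg hα (by linarith)
  have hxr : r₁ ≤ Real.sqrt (m z) := by
    rw [Real.le_sqrt hr₁.le (by linarith)]
    exact hz
  constructor
  · rw [← Fg_eq_Phi_region ha hm hP hg hr₁ hreg hΦ hzr, (cylWeight_region_second ha hm hP hg hr₁ hreg hzr).2.2, hd]
    have h1 : 0 ≤ α * Real.sqrt (m z) := mul_nonneg hα (Real.sqrt_nonneg _)
    have h2 : 0 ≤ (3 - 2 : ℝ) * α * (T₀ - z.1) / Real.sqrt (m z) := by positivity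
    have h3 : 0 ≤ 4 * b * (α * (T₀ - z.1)) * Real.sqrt (m z) := by positivity
    nlinarith [sq_nonneg (α * (T₀ - z.1)), sq_nonneg (b * ‖z.2‖), hb]
  · -- `LF` on the region, `d = 3`
    have hV : IsOpen {y : ℝ × E | r₁ ^ 2 / 4 < m y} := isOpen_lt continuous_const (contDiff_cylSq hm (n := 0)).continuous
    have hEq : EqOn Φ (fun y => dt g y - lap g y - gradSq g y) {y : ℝ × E | r₁ ^ 2 / 4 < m y} :=
      fun y hy => (Fg_eq_Phi_region ha hm hP hg hr₁ hreg hΦ hy).symm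
    rw [dt_congr_of_eqOn hV hEq hzr, lap_congr_of_eqOn hV hEq hzr, LF_region ha hm hP hg hr₁ hreg hΦ hzr, hd]
    generalize Real.sqrt (m z) = ρ at hn hs hxr ⊢
    -- `ρ ≥ r₁`, `4T ≤ r₁² ≤ ρ²`, `T₀ − t ≤ T`, `b ρ² ≥ 4`
    have hTt : T₀ - z.1 ≤ T := by linarith
    have hρ2 : r₁ ^ 2 ≤ ρ ^ 2 := by nlinarith
    have hbρ : 4 ≤ b * ρ ^ 2 := hbr.trans (by nlinarith [hb])
    -- the two negative terms
    have e1 : 4 * (3 - 2 : ℝ) * b * α * (T₀ - z.1) / ρ ≤ b * α * ρ := by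
      rw [div_le_iff₀ hn]
      have : 4 * (T₀ - z.1) ≤ ρ ^ 2 := by nlinarith
      have := mul_le_mul_of_nonneg_left this (by positivity : (0 : ℝ) ≤ b * α)
      nlinarith
    have e2 : (3 - 2 : ℝ) * (4 - 3) * α * (T₀ - z.1) / ρ ^ 3 ≤ b * α * ρ / 16 := by
      rw [div_le_iff₀ (by positivity)]
      -- `α(T₀−t) ≤ αT ≤ α ρ²/4` and `1 ≤ bρ²/4`
      have h1 : α * (T₀ - z.1) ≤ α * ρ ^ 2 / 4 := by nlinarith [mul_le_mul_of_nonneg_left hTt hα]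
      have h2 : α * ρ ^ 2 / 4 ≤ α * ρ ^ 2 / 4 * (b * ρ ^ 2 / 4) := by
        have : (1 : ℝ) ≤ b * ρ ^ 2 / 4 := by linarith
        have h0 : 0 ≤ α * ρ ^ 2 / 4 := by positivity
        nlinarith
      nlinarith
    have e3 : b * α * r₁ ≤ b * α * ρ := by
      have := mul_le_mul_of_nonneg_left hxr (by positivity : (0 : ℝ) ≤ b * α)
      linarith
    have e4 : 40 * b ^ 2 ≤ b * α * r₁ := by nlinarith
    have e5 : 0 ≤ 2 * α ^ 2 * (T₀ - z.1) := by positivity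
    nlinarith

/-! #### The weighted integral of `|LW|²` and the energy rate -/

include hm hT hr₁ hr₁₂ hb hu hψs hψnn hψle hψt hψ1 hψ0 hψd0 hψg hψl hW hGS hP hg hPin hPsh hPLdef hANdef in
/-- `∫ |LW(t,x)|² eᵍ dx ≤ P_pl(t) + P_sh(t)` for `0 < t < T`. [cite: Palasek2021, §4 (proof of Prop 9)] -/
theorem cyl_integral_norm_sq_L_le (hCψ : 0 ≤ Cψ) (hbr : 4 ≤ b * r₁ ^ 2)
    (hL : ∀ t ∈ Ioo 0 T, ∀ x : E, r₁ ^ 2 ≤ ‖x‖ ^ 2 - ⟪x, a⟫ ^ 2 → ‖x‖ ^ 2 - ⟪x, a⟫ ^ 2 ≤ r₂ ^ 2 → ⟪x, a⟫ ^ 2 ≤ r₂ ^ 2 →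
      ‖FluidPDE.timeDeriv u t x + Δ (u t) x‖ ≤ b * ‖u t x‖ + Real.sqrt b * ‖fderiv ℝ (u t) x‖)
    {t : ℝ} (ht : t ∈ Ioo 0 T) :
    ∫ x, ‖dt W (t, x) + lap W (t, x)‖ ^ 2 * Real.exp (g (t, x)) ≤ Pin t + Psh t := by
  obtain ⟨mPL, mAN, bAN, hPLAN, hANball⟩ := cyl_sets' hPLdef hANdef (r₁ := r₁) (r₂ := r₂) (a := a)
  have htc : t ∈ Icc 0 T := Ioo_subset_Icc_self ht
  have hpt := fun x => cylField_norm_sq_L_le hm hr₁ hr₁₂ hu hψs hψnn hψle hψt hψ1 hψ0 hψd0 hψg hψl hW hGS hCψ hb hbr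
    hL ht x
  have cw := continuous_exp_cylWeight (E := E) hm hP hg
  have cB : ContinuousOn (fun z : ℝ × E => b ^ 2 * ‖u z.1 z.2‖ ^ 2 + b * GS z) (Icc 0 T ×ˢ univ) :=
    (continuousOn_const.mul ((hu.continuousOn.norm).pow 2)).add (continuousOn_const.mul (continuousOn_GS_slab hT hu hGS))
  have iin : IntegrableOn (fun x : E => 2 * (b ^ 2 * ‖u t x‖ ^ 2 + b * GS (t, x)) * Real.exp (g (t, x))) PL :=
    integrableOn_slab_slice (Φ := fun z : ℝ × E => 2 * (b ^ 2 * ‖u z.1 z.2‖ ^ 2 + b * GS z) * Real.exp (g z))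
      ((continuousOn_const.mul cB).mul cw.continuousOn) htc (bAN.subset hPLAN)
  have ish : IntegrableOn (fun x : E => 4 * (1 + Cψ) ^ 2 * (b ^ 2 * ‖u t x‖ ^ 2 + b * GS (t, x)) * Real.exp (g (t, x)))
      (AN \ PL) :=
    integrableOn_slab_slice (Φ := fun z : ℝ × E => 4 * (1 + Cψ) ^ 2 * (b ^ 2 * ‖u z.1 z.2‖ ^ 2 + b * GS z) *
      Real.exp (g z)) ((continuousOn_const.mul cB).mul cw.continuousOn) htc (bAN.subset Set.sdiff_subset)
  -- the left-hand side is integrable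
  have hWreg := (annField_regular (T := T) hu hψs hW).1
  obtain ⟨hWK, -⟩ := cylField_support (T := T) (r₁ := r₁) hm hψ0 hW
  have cLW : ContinuousOn (fun z : ℝ × E => ‖dt W z + lap W z‖ ^ 2 * Real.exp (g z)) (Ioo 0 T ×ˢ univ) :=
    ((((continuousOn_dtU hWreg).add (continuousOn_lapU hWreg)).norm).pow 2).mul cw.continuousOn
  have hPLsub : PL ⊆ closedBall (0 : E) (2 * |r₂|) := hPLAN.trans hANball
  have h0 : ∀ x ∉ closedBall (0 : E) (2 * |r₂|), ‖dt W (t, x) + lap W (t, x)‖ ^ 2 * Real.exp (g (t, x)) = 0 := by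
    intro x hx
    have hx1 : x ∉ PL := fun h => hx (hPLsub h)
    have hx2 : x ∉ AN \ PL := fun h => hx (hANball h.1)
    have := hpt x
    rw [← hPLdef, ← hANdef, indicator_of_notMem hx1, indicator_of_notMem hx2, add_zero] at this
    rw [le_antisymm this (sq_nonneg _), zero_mul]
  have iLW : Integrable fun x => ‖dt W (t, x) + lap W (t, x)‖ ^ 2 * Real.exp (g (t, x)) :=
    integrable_slice_of_vanish (isCompact_closedBall (0 : E) (2 * |r₂|)) ht cLW h0
  have key : ∫ x, ‖dt W (t, x) + lap W (t, x)‖ ^ 2 * Real.exp (g (t, x)) ≤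
      ∫ x, (PL.indicator (fun x => 2 * (b ^ 2 * ‖u t x‖ ^ 2 + b * GS (t, x)) * Real.exp (g (t, x))) x +
        (AN \ PL).indicator (fun x => 4 * (1 + Cψ) ^ 2 * (b ^ 2 * ‖u t x‖ ^ 2 + b * GS (t, x)) *
          Real.exp (g (t, x))) x) := by
    refine integral_mono iLW ((iin.integrable_indicator mPL).add (ish.integrable_indicator (mAN.diff mPL))) fun x => ?_
    have := mul_le_mul_of_nonneg_right (hpt x) (Real.exp_pos (g (t, x))).le
    rw [← hPLdef, ← hANdef] at this
    refine this.trans (le_of_eq ?_)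
    simp only [indicator_mul_left, add_mul]
  refine key.trans (le_of_eq ?_)
  rw [integral_add (iin.integrable_indicator mPL) (ish.integrable_indicator (mAN.diff mPL)), integral_indicator mPL,
    integral_indicator (mAN.diff mPL), hPin, hPsh]

include ha hm hT hr₁ hr₁₂ hb hα hT₀ hT₀T hd3 hu hψs hψnn hψle hψt hψ1 hψ0 hψd0 hψg hψl hP hreg hg hΦ hW hGS hGW hEb hQp hPin hPsh hPLdef hANdef in
/-- **The energy rate** ("apply the general Carleman inequality … and discard some terms"): for
`0 < t < T`, `t ≤ T₀`, the energy `E` is differentiable at `t` with derivative `D` and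
`Q(t) − ½(P_pl(t) + P_sh(t)) ≤ D`, `Q = ∫(28b²|W|² + 4b|∇W|²)eᵍ`. [cite: Palasek2021, §4 (proof of Prop 9)] -/
theorem cyl_hasDerivAt_Eb (hCψ : 0 ≤ Cψ) (hbr : 4 ≤ b * r₁ ^ 2) (h4T : 4 * T ≤ r₁ ^ 2) (hαr : 40 * b ≤ α * r₁)
    (hL : ∀ t ∈ Ioo 0 T, ∀ x : E, r₁ ^ 2 ≤ ‖x‖ ^ 2 - ⟪x, a⟫ ^ 2 → ‖x‖ ^ 2 - ⟪x, a⟫ ^ 2 ≤ r₂ ^ 2 → ⟪x, a⟫ ^ 2 ≤ r₂ ^ 2 →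
      ‖FluidPDE.timeDeriv u t x + Δ (u t) x‖ ≤ b * ‖u t x‖ + Real.sqrt b * ‖fderiv ℝ (u t) x‖)
    {t : ℝ} (ht : t ∈ Ioo 0 T) (htT : t ≤ T₀) :
    ∃ D : ℝ, HasDerivAt Eb D t ∧ Qp t - 1 / 2 * (Pin t + Psh t) ≤ D := by
  have htc : t ∈ Icc 0 T := Ioo_subset_Icc_self ht
  have hWreg := (annField_regular (T := T) hu hψs hW).1
  obtain ⟨hWK, hW0⟩ := cylField_support (T := T) (r₁ := r₁) hm hψ0 hW
  obtain ⟨D, hD, hR⟩ := cyl_carleman_rate (F := F) ha hm hP hg hr₁ hreg hΦ hWreg (isCompact_closedBall (0 : E) (2 * |r₂|))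
    hWK hW0 hα ht htT
  -- `Eb` is the energy of `cyl_carleman_rate`
  have hev : Eb =ᶠ[𝓝 t] fun s => ∫ x, (gradSq W (s, x) + 1 / 2 * Φ (s, x) * ‖W (s, x)‖ ^ 2) * Real.exp (g (s, x)) := by
    filter_upwards [isOpen_Ioo.mem_nhds ht] with s hs'
    rw [hEb]
    refine integral_congr_ae (Eventually.of_forall fun x => ?_)
    show (GW (s, x) + 1 / 2 * Φ (s, x) * ‖ψ (s, x) • u s x‖ ^ 2) * Real.exp (g (s, x)) =
      (gradSq W (s, x) + 1 / 2 * Φ (s, x) * ‖W (s, x)‖ ^ 2) * Real.exp (g (s, x))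
    rw [gradSq_cutoffField hu hψs hW hGW hs', hW]
    rfl
  refine ⟨D, hD.congr_of_eventuallyEq hev, le_trans ?_ hR⟩
  -- pointwise facts
  have hgradW : ∀ x, gradSq W (t, x) = GW (t, x) := fun x => gradSq_cutoffField hu hψs hW hGW ht x
  have hnormW : ∀ x, ‖W (t, x)‖ = ‖ψ (t, x) • u t x‖ := fun x => by rw [hW]; rfl
  have hLF : ∀ x, 28 * b ^ 2 * ‖W (t, x)‖ ^ 2 ≤ 1 / 2 * (dt Φ (t, x) + lap Φ (t, x)) * ‖W (t, x)‖ ^ 2 := by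
    intro x
    by_cases hx : m (t, x) ≤ 36 / 25 * r₁ ^ 2
    · rw [cylField_eq_zero hψ0 hW (Or.inl hx), norm_zero, zero_pow two_ne_zero, mul_zero, mul_zero]
    · push Not at hx
      have hz : r₁ ^ 2 ≤ m (t, x) := by nlinarith
      have := (Phi_cyl_support_bounds (T := T) ha hm hr₁ hb hα hd3 hP hreg hg hΦ hbr h4T hαr hT₀T.le hz ht.1.le htT).2
      nlinarith [sq_nonneg ‖W (t, x)‖]
  -- integrability
  have cw := continuous_exp_cylWeight (E := E) hm hP hg
  have cwS : ContinuousOn (fun z : ℝ × E => Real.exp (g z)) (Ioo 0 T ×ˢ univ) := cw.continuousOn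
  have cGWs := (continuousOn_GW_slab hT hu hψs hGW).mono
    (prod_mono (Ioo_subset_Icc_self (a := (0 : ℝ)) (b := T)) (Subset.refl (univ : Set E)))
  have cN := (continuousOn_norm_sq_cutoff_slab (T := T) hu hψs).mono
    (prod_mono (Ioo_subset_Icc_self (a := (0 : ℝ)) (b := T)) (Subset.refl (univ : Set E)))
  have cNW : ContinuousOn (fun z : ℝ × E => ‖W z‖ ^ 2) (Ioo 0 T ×ˢ univ) := (hWreg.continuousOn.norm).pow 2
  have cgradW : ContinuousOn (gradSq W) (Ioo 0 T ×ˢ univ) := (contDiffOn_gradSqU hWreg).continuousOn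
  have cLW : ContinuousOn (fun z : ℝ × E => ‖dt W z + lap W z‖ ^ 2) (Ioo 0 T ×ˢ univ) :=
    (((continuousOn_dtU hWreg).add (continuousOn_lapU hWreg)).norm).pow 2
  have hΦs := contDiff_Phi_top (E := E) hm hP hΦ
  have cΦL : ContinuousOn (fun z : ℝ × E => dt Φ z + lap Φ z) (Ioo 0 T ×ˢ univ) := by
    have h1 : Continuous (dt Φ) := (contDiff_fderiv_apply_const hΦs (1, 0)).continuous
    have h2 : Continuous (lap Φ) := by
      rw [show lap Φ = fun z => ∑ i, dx (stdOrthonormalBasis ℝ E i) (dx (stdOrthonormalBasis ℝ E i) Φ) z from rfl]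
      refine continuous_finsetSum _ fun i _ => ?_
      have : ContDiff ℝ (⊤ : ℕ∞) (dx (stdOrthonormalBasis ℝ E i) Φ) := contDiff_dx hΦs _
      exact (contDiff_fderiv_apply_const this (0, stdOrthonormalBasis ℝ E i)).continuous
    exact (h1.add h2).continuousOn
  -- vanishing outside `B̄(0, 2|r₂|)`
  have vout : ∀ x ∉ closedBall (0 : E) (2 * |r₂|),
      81 / 100 * r₂ ^ 2 < m (t, x) ∨ 9 / 25 * r₂ ^ 2 < ⟪x, a⟫ ^ 2 := fun x hx => cyl_vout hm hx
  have vW : ∀ x ∉ closedBall (0 : E) (2 * |r₂|), W (t, x) = 0 := hWK t ht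
  have vGW : ∀ x ∉ closedBall (0 : E) (2 * |r₂|), GW (t, x) = 0 := fun x hx =>
    (cylField_GW_le hψnn hψle hψ0 hψd0 hψg hGS hGW (t, x)).2 (Or.inr (vout x hx))
  have vψ : ∀ x ∉ closedBall (0 : E) (2 * |r₂|), ψ (t, x) = 0 := fun x hx =>
    hψ0 (t, x) (Or.inr ((vout x hx).imp le_of_lt le_of_lt))
  have vgrad : ∀ x ∉ closedBall (0 : E) (2 * |r₂|), gradSq W (t, x) = 0 := fun x hx => by rw [hgradW, vGW x hx]
  have vdt : ∀ x ∉ closedBall (0 : E) (2 * |r₂|), dt W (t, x) = 0 := fun x hx =>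
    dtU_slice_support (isCompact_closedBall (0 : E) (2 * |r₂|)) hWK t ht x hx
  have vlap : ∀ x ∉ closedBall (0 : E) (2 * |r₂|), lap W (t, x) = 0 := fun x hx => by
    rw [show lap W (t, x) = ∑ i, dx (stdOrthonormalBasis ℝ E i) (dx (stdOrthonormalBasis ℝ E i) W) (t, x) from rfl]
    exact Finset.sum_eq_zero fun i _ => by
      rw [dx_apply, fderiv_dxU_slice_support (isCompact_closedBall (0 : E) (2 * |r₂|)) hWK _ _ t ht x hx]
  have iQ : Integrable fun x => (28 * b ^ 2 * ‖ψ (t, x) • u t x‖ ^ 2 + 4 * b * GW (t, x)) * Real.exp (g (t, x)) := by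
    have c : ContinuousOn (fun z : ℝ × E => (28 * b ^ 2 * ‖ψ z • u z.1 z.2‖ ^ 2 + 4 * b * GW z) * Real.exp (g z))
        (Ioo 0 T ×ˢ univ) := ((continuousOn_const.mul cN).add (continuousOn_const.mul cGWs)).mul cwS
    refine integrable_slice_of_vanish (isCompact_closedBall (0 : E) (2 * |r₂|)) ht c fun x hx => ?_
    simp only [vGW x hx, vψ x hx, zero_smul, norm_zero, zero_pow two_ne_zero, mul_zero, add_zero, zero_mul]
  have iR : Integrable fun x => (1 / 2 * (dt Φ (t, x) + lap Φ (t, x)) * ‖W (t, x)‖ ^ 2 + 4 * b * gradSq W (t, x) -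
      1 / 2 * ‖dt W (t, x) + lap W (t, x)‖ ^ 2) * Real.exp (g (t, x)) := by
    refine integrable_slice_of_vanish (isCompact_closedBall (0 : E) (2 * |r₂|)) ht
      (((((continuousOn_const.mul cΦL).mul cNW).add (continuousOn_const.mul cgradW)).sub
        (continuousOn_const.mul cLW)).mul cwS) fun x hx => ?_
    simp only [Pi.mul_apply, Pi.add_apply, Pi.sub_apply, vW x hx, vgrad x hx, vdt x hx, vlap x hx, norm_zero,
      zero_pow two_ne_zero, mul_zero, add_zero, sub_zero, zero_mul]
  have iL : Integrable fun x => ‖dt W (t, x) + lap W (t, x)‖ ^ 2 * Real.exp (g (t, x)) := by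
    refine integrable_slice_of_vanish (isCompact_closedBall (0 : E) (2 * |r₂|)) ht (cLW.mul cwS) fun x hx => ?_
    simp only [Pi.mul_apply, vdt x hx, vlap x hx, add_zero, norm_zero, zero_pow two_ne_zero, zero_mul]
  -- compare
  have hPbound := cyl_integral_norm_sq_L_le hm hT hr₁ hr₁₂ hb hu hψs hψnn hψle hψt hψ1 hψ0 hψd0 hψg hψl hP hg hW hGS
    hPLdef hANdef hPin hPsh hCψ hbr hL ht
  have eQ : Qp t = ∫ x, (28 * b ^ 2 * ‖ψ (t, x) • u t x‖ ^ 2 + 4 * b * GW (t, x)) * Real.exp (g (t, x)) := by rw [hQp]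
  have step : (∫ x, (28 * b ^ 2 * ‖ψ (t, x) • u t x‖ ^ 2 + 4 * b * GW (t, x)) * Real.exp (g (t, x))) -
      1 / 2 * (∫ x, ‖dt W (t, x) + lap W (t, x)‖ ^ 2 * Real.exp (g (t, x))) ≤
      ∫ x, (1 / 2 * (dt Φ (t, x) + lap Φ (t, x)) * ‖W (t, x)‖ ^ 2 + 4 * b * gradSq W (t, x) -
        1 / 2 * ‖dt W (t, x) + lap W (t, x)‖ ^ 2) * Real.exp (g (t, x)) := by
    rw [← integral_const_mul, ← integral_sub iQ (iL.const_mul _)]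
    refine integral_mono (iQ.sub (iL.const_mul _)) iR fun x => ?_
    show (28 * b ^ 2 * ‖ψ (t, x) • u t x‖ ^ 2 + 4 * b * GW (t, x)) * Real.exp (g (t, x)) -
        1 / 2 * (‖dt W (t, x) + lap W (t, x)‖ ^ 2 * Real.exp (g (t, x))) ≤
      (1 / 2 * (dt Φ (t, x) + lap Φ (t, x)) * ‖W (t, x)‖ ^ 2 + 4 * b * gradSq W (t, x) -
        1 / 2 * ‖dt W (t, x) + lap W (t, x)‖ ^ 2) * Real.exp (g (t, x))
    rw [← hnormW, hgradW]
    have := mul_le_mul_of_nonneg_right (hLF x) (Real.exp_pos (g (t, x))).le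
    nlinarith [this]
  have := mul_le_mul_of_nonneg_left hPbound (by norm_num : (0 : ℝ) ≤ 1 / 2)
  linarith [step, eQ]

/-! #### Continuity in time -/

include hm hT hu hψs hψnn hψle hψ0 hψd0 hψg hP hg hΦ hGS hGW hEb hQp in
/-- `E` and `Q` are continuous on `[0, T]`. [folklore] -/
theorem cyl_continuousOn_Eb_Qp : ContinuousOn Eb (Icc 0 T) ∧ ContinuousOn Qp (Icc 0 T) := by
  have cw := (continuous_exp_cylWeight (E := E) hm hP hg).continuousOn (s := Icc 0 T ×ˢ univ)
  have cGW := continuousOn_GW_slab hT hu hψs hGW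
  have cN := continuousOn_norm_sq_cutoff_slab (T := T) hu hψs
  have cΦ : ContinuousOn Φ (Icc 0 T ×ˢ univ) := (contDiff_Phi_top (E := E) hm hP hΦ).continuous.continuousOn
  have vout : ∀ (s : ℝ), ∀ x ∉ closedBall (0 : E) (2 * |r₂|),
      81 / 100 * r₂ ^ 2 < m (s, x) ∨ 9 / 25 * r₂ ^ 2 < ⟪x, a⟫ ^ 2 := fun s x hx => cyl_vout hm hx
  have h00 : ∀ s : ℝ, ∀ x ∉ closedBall (0 : E) (2 * |r₂|), GW (s, x) = 0 ∧ ψ (s, x) = 0 := fun s x hx =>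
    ⟨(cylField_GW_le hψnn hψle hψ0 hψd0 hψg hGS hGW (s, x)).2 (Or.inr (vout s x hx)),
      hψ0 (s, x) (Or.inr ((vout s x hx).imp le_of_lt le_of_lt))⟩
  constructor
  · have c : ContinuousOn (fun z : ℝ × E => (GW z + 1 / 2 * Φ z * ‖ψ z • u z.1 z.2‖ ^ 2) * Real.exp (g z))
        (Icc 0 T ×ˢ univ) := (cGW.add ((continuousOn_const.mul cΦ).mul cN)).mul cw
    have h0 : ∀ s ∈ Icc 0 T, ∀ x ∉ closedBall (0 : E) (2 * |r₂|),
        (fun z : ℝ × E => (GW z + 1 / 2 * Φ z * ‖ψ z • u z.1 z.2‖ ^ 2) * Real.exp (g z)) (s, x) = 0 :=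
      fun s _ x hx => by
        obtain ⟨hGW0, hψ00⟩ := h00 s x hx
        simp only [hGW0, hψ00, zero_smul, norm_zero, zero_pow two_ne_zero, mul_zero, add_zero, zero_mul]
    rw [hEb]
    exact continuousOn_integral_slice c (isCompact_closedBall (0 : E) (2 * |r₂|)) h0
  · have c : ContinuousOn (fun z : ℝ × E => (28 * b ^ 2 * ‖ψ z • u z.1 z.2‖ ^ 2 + 4 * b * GW z) * Real.exp (g z))
        (Icc 0 T ×ˢ univ) := ((continuousOn_const.mul cN).add (continuousOn_const.mul cGW)).mul cw
    have h0 : ∀ s ∈ Icc 0 T, ∀ x ∉ closedBall (0 : E) (2 * |r₂|),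
        (fun z : ℝ × E => (28 * b ^ 2 * ‖ψ z • u z.1 z.2‖ ^ 2 + 4 * b * GW z) * Real.exp (g z)) (s, x) = 0 :=
      fun s _ x hx => by
        obtain ⟨hGW0, hψ00⟩ := h00 s x hx
        simp only [hGW0, hψ00, zero_smul, norm_zero, zero_pow two_ne_zero, mul_zero, add_zero, zero_mul]
    rw [hQp]
    exact continuousOn_integral_slice c (isCompact_closedBall (0 : E) (2 * |r₂|)) h0

include hm hT hu hGS hP hg hPin hPsh hIin hPLdef hANdef in
/-- `P_pl`, `P_sh`, `I_pl` are continuous on `[0, T]`. [folklore] -/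
theorem cyl_continuousOn_P :
    ContinuousOn Pin (Icc 0 T) ∧ ContinuousOn Psh (Icc 0 T) ∧ ContinuousOn Iin (Icc 0 T) := by
  obtain ⟨mPL, mAN, bAN, hPLAN, -⟩ := cyl_sets' hPLdef hANdef (r₁ := r₁) (r₂ := r₂) (a := a)
  have cw := continuous_exp_cylWeight (E := E) hm hP hg
  refine ⟨?_, ?_, ?_⟩
  · have := continuousOn_setIntegral_GS' hT hu hGS cw mPL (bAN.subset hPLAN) (2 * b) (2 * b ^ 2)
    rw [hPin]
    refine this.congr fun t _ => setIntegral_congr_fun mPL fun x _ => ?_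
    ring
  · have := continuousOn_setIntegral_GS' hT hu hGS cw (mAN.diff mPL) (bAN.subset Set.sdiff_subset)
      (4 * (1 + Cψ) ^ 2 * b) (4 * (1 + Cψ) ^ 2 * b ^ 2)
    rw [hPsh]
    refine this.congr fun t _ => setIntegral_congr_fun (mAN.diff mPL) fun x _ => ?_
    ring
  · have := continuousOn_setIntegral_GS' hT hu hGS cw mPL (bAN.subset hPLAN) (3 * b) (27 * b ^ 2)
    rw [hIin]
    refine this.congr fun t _ => setIntegral_congr_fun mPL fun x _ => ?_
    ring

/-! #### Boundary terms and absorption -/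

include ha hm hT hr₁ hr₁₂ hb hα hT₀ hT₀T hd3 hu hψs hψnn hψle hψ0 hψd0 hψg hP hreg hg hΦ hGS hGW hEb hANdef in
/-- **Top boundary term** (`F ≤ 0` on the support, `|∇(ψu)|² ≤ 2|∇u|² + 2(C/r₁²)|u|²`, support
in the open truncated shell): `E(T₀) ≤ ∫_{AN} (2|∇u|² + 2(C/r₁²)|u|²)(T₀) eᵍ`. [cite: Palasek2021, §4 (proof of Prop 9)] -/
theorem cyl_Eb_top_le (hbr : 4 ≤ b * r₁ ^ 2) (h4T : 4 * T ≤ r₁ ^ 2) (hαr : 40 * b ≤ α * r₁) :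
    Eb T₀ ≤ ∫ x in AN, (2 * GS (T₀, x) + 2 * (Cψ / r₁ ^ 2) * ‖u T₀ x‖ ^ 2) * Real.exp (g (T₀, x)) := by
  obtain ⟨-, mAN, bAN, -, hANball⟩ := cyl_sets' (PL := {y : E | 4 * r₁ ^ 2 < ‖y‖ ^ 2 - ⟪y, a⟫ ^ 2 ∧
    ‖y‖ ^ 2 - ⟪y, a⟫ ^ 2 < r₂ ^ 2 / 4 ∧ ⟪y, a⟫ ^ 2 < r₂ ^ 2 / 4}) rfl hANdef (r₁ := r₁) (r₂ := r₂) (a := a)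
  have hT₀c : T₀ ∈ Icc 0 T := ⟨hT₀.le, hT₀T.le⟩
  have hr₂ : 0 < r₂ := by linarith
  have cw := (continuous_exp_cylWeight (E := E) hm hP hg).continuousOn (s := Icc 0 T ×ˢ univ)
  have cGW := continuousOn_GW_slab hT hu hψs hGW
  have cGS := continuousOn_GS_slab hT hu hGS
  have cN := continuousOn_norm_sq_cutoff_slab (T := T) hu hψs
  have cΦ : ContinuousOn Φ (Icc 0 T ×ˢ univ) := (contDiff_Phi_top (E := E) hm hP hΦ).continuous.continuousOn
  have cu : ContinuousOn (fun z : ℝ × E => ‖u z.1 z.2‖ ^ 2) (Icc 0 T ×ˢ univ) := (hu.continuousOn.norm).pow 2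
  -- support facts at time `T₀`
  have hsupp : ∀ x : E, x ∉ AN → GW (T₀, x) = 0 ∧ ψ (T₀, x) = 0 := fun x hx => by
    rw [hANdef] at hx
    have hout : m (T₀, x) < 36 / 25 * r₁ ^ 2 ∨ 81 / 100 * r₂ ^ 2 < m (T₀, x) ∨ 9 / 25 * r₂ ^ 2 < ⟪x, a⟫ ^ 2 := by
      rw [cylSq_slice hm]
      have hA : r₁ ^ 2 < 36 / 25 * r₁ ^ 2 := by nlinarith
      have hB : 81 / 100 * r₂ ^ 2 < r₂ ^ 2 := by nlinarith
      have hC : 9 / 25 * r₂ ^ 2 < r₂ ^ 2 := by nlinarith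
      rcases not_and_or.1 hx with h | h
      · left; push Not at h; linarith
      · rcases not_and_or.1 h with h | h
        · right; left; push Not at h; linarith
        · right; right; push Not at h; linarith
    exact ⟨(cylField_GW_le hψnn hψle hψ0 hψd0 hψg hGS hGW (T₀, x)).2 hout,
      hψ0 (T₀, x) (hout.imp le_of_lt fun h => h.imp le_of_lt le_of_lt)⟩
  have iE : Integrable fun x : E => (GW (T₀, x) + 1 / 2 * Φ (T₀, x) * ‖ψ (T₀, x) • u T₀ x‖ ^ 2) *
      Real.exp (g (T₀, x)) :=
    integrable_slab_slice (Φ := fun z : ℝ × E => (GW z + 1 / 2 * Φ z * ‖ψ z • u z.1 z.2‖ ^ 2) * Real.exp (g z))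
      ((cGW.add ((continuousOn_const.mul cΦ).mul cN)).mul cw) hT₀c fun x hx => by
        obtain ⟨h1, h2⟩ := hsupp x fun h => hx (hANball h)
        show (GW (T₀, x) + 1 / 2 * Φ (T₀, x) * ‖ψ (T₀, x) • u T₀ x‖ ^ 2) * Real.exp (g (T₀, x)) = 0
        rw [h1, h2, zero_smul, norm_zero, zero_pow two_ne_zero, mul_zero, add_zero, zero_mul]
  have iR : IntegrableOn (fun x : E => (2 * GS (T₀, x) + 2 * (Cψ / r₁ ^ 2) * ‖u T₀ x‖ ^ 2) * Real.exp (g (T₀, x))) AN :=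
    integrableOn_slab_slice (Φ := fun z : ℝ × E => (2 * GS z + 2 * (Cψ / r₁ ^ 2) * ‖u z.1 z.2‖ ^ 2) *
      Real.exp (g z)) (((continuousOn_const.mul cGS).add (continuousOn_const.mul cu)).mul cw) hT₀c bAN
  rw [hEb, ← integral_indicator mAN]
  refine integral_mono iE (iR.integrable_indicator mAN) fun x => ?_
  have hΦW : Φ (T₀, x) * ‖ψ (T₀, x) • u T₀ x‖ ^ 2 ≤ 0 := by
    by_cases hx : m (T₀, x) ≤ 36 / 25 * r₁ ^ 2
    · rw [hψ0 (T₀, x) (Or.inl hx), zero_smul, norm_zero, zero_pow two_ne_zero, mul_zero]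
    · push Not at hx
      have hz : r₁ ^ 2 ≤ m (T₀, x) := by nlinarith
      have := (Phi_cyl_support_bounds (T := T) ha hm hr₁ hb hα hd3 hP hreg hg hΦ hbr h4T hαr hT₀T.le hz hT₀.le le_rfl).1
      exact mul_nonpos_of_nonpos_of_nonneg this (sq_nonneg _)
  by_cases hx : x ∈ AN
  · rw [indicator_of_mem hx]
    have h1 := (cylField_GW_le hψnn hψle hψ0 hψd0 hψg hGS hGW (T₀, x)).1
    have hw := (Real.exp_pos (g (T₀, x))).le
    show (GW (T₀, x) + 1 / 2 * Φ (T₀, x) * ‖ψ (T₀, x) • u T₀ x‖ ^ 2) * Real.exp (g (T₀, x)) ≤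
      (2 * GS (T₀, x) + 2 * (Cψ / r₁ ^ 2) * ‖u T₀ x‖ ^ 2) * Real.exp (g (T₀, x))
    refine mul_le_mul_of_nonneg_right ?_ hw
    have : GW (T₀, x) ≤ 2 * GS (T₀, x) + 2 * (Cψ / r₁ ^ 2) * ‖u ((T₀, x) : ℝ × E).1 ((T₀, x) : ℝ × E).2‖ ^ 2 := h1
    simp only at this
    nlinarith
  · rw [indicator_of_notMem hx]
    obtain ⟨h1, h2⟩ := hsupp x hx
    show (GW (T₀, x) + 1 / 2 * Φ (T₀, x) * ‖ψ (T₀, x) • u T₀ x‖ ^ 2) * Real.exp (g (T₀, x)) ≤ 0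
    rw [h1, h2, zero_smul, norm_zero, zero_pow two_ne_zero, mul_zero, add_zero, zero_mul]

include hm hT hr₁ hr₁₂ hu hψs hψnn hψle hψ0 hψd0 hψg hP hg hΦ hGS hGW hEb hANdef in
/-- **Bottom boundary term** (drop `|∇W|² ≥ 0`, `ψ² ≤ 1`, support in the open truncated shell):
`−E(0) ≤ ½ ∫_{AN} |F(0,x)| |u(0,x)|² e^{g(0,x)}`. [cite: Palasek2021, §4 (proof of Prop 9)] -/
theorem cyl_neg_Eb_zero_le :
    -Eb 0 ≤ 1 / 2 * ∫ x in AN, |Φ (0, x)| * ‖u 0 x‖ ^ 2 * Real.exp (g (0, x)) := by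
  obtain ⟨-, mAN, bAN, -, hANball⟩ := cyl_sets' (PL := {y : E | 4 * r₁ ^ 2 < ‖y‖ ^ 2 - ⟪y, a⟫ ^ 2 ∧
    ‖y‖ ^ 2 - ⟪y, a⟫ ^ 2 < r₂ ^ 2 / 4 ∧ ⟪y, a⟫ ^ 2 < r₂ ^ 2 / 4}) rfl hANdef (r₁ := r₁) (r₂ := r₂) (a := a)
  have h0c : (0 : ℝ) ∈ Icc 0 T := ⟨le_rfl, hT.le⟩
  have hr₂ : 0 < r₂ := by linarith
  have cw := (continuous_exp_cylWeight (E := E) hm hP hg).continuousOn (s := Icc 0 T ×ˢ univ)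
  have cGW := continuousOn_GW_slab hT hu hψs hGW
  have cN := continuousOn_norm_sq_cutoff_slab (T := T) hu hψs
  have cΦ : ContinuousOn Φ (Icc 0 T ×ˢ univ) := (contDiff_Phi_top (E := E) hm hP hΦ).continuous.continuousOn
  have cu : ContinuousOn (fun z : ℝ × E => ‖u z.1 z.2‖ ^ 2) (Icc 0 T ×ˢ univ) := (hu.continuousOn.norm).pow 2
  have hsupp : ∀ x : E, x ∉ AN → GW (0, x) = 0 ∧ ψ (0, x) = 0 := fun x hx => by
    rw [hANdef] at hx
    have hout : m (0, x) < 36 / 25 * r₁ ^ 2 ∨ 81 / 100 * r₂ ^ 2 < m (0, x) ∨ 9 / 25 * r₂ ^ 2 < ⟪x, a⟫ ^ 2 := by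
      rw [cylSq_slice hm]
      have hA : r₁ ^ 2 < 36 / 25 * r₁ ^ 2 := by nlinarith
      have hB : 81 / 100 * r₂ ^ 2 < r₂ ^ 2 := by nlinarith
      have hC : 9 / 25 * r₂ ^ 2 < r₂ ^ 2 := by nlinarith
      rcases not_and_or.1 hx with h | h
      · left; push Not at h; linarith
      · rcases not_and_or.1 h with h | h
        · right; left; push Not at h; linarith
        · right; right; push Not at h; linarith
    exact ⟨(cylField_GW_le hψnn hψle hψ0 hψd0 hψg hGS hGW (0, x)).2 hout,
      hψ0 (0, x) (hout.imp le_of_lt fun h => h.imp le_of_lt le_of_lt)⟩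
  have iE : Integrable fun x : E => (GW (0, x) + 1 / 2 * Φ (0, x) * ‖ψ (0, x) • u 0 x‖ ^ 2) * Real.exp (g (0, x)) :=
    integrable_slab_slice (Φ := fun z : ℝ × E => (GW z + 1 / 2 * Φ z * ‖ψ z • u z.1 z.2‖ ^ 2) * Real.exp (g z))
      ((cGW.add ((continuousOn_const.mul cΦ).mul cN)).mul cw) h0c fun x hx => by
        obtain ⟨h1, h2⟩ := hsupp x fun h => hx (hANball h)
        show (GW (0, x) + 1 / 2 * Φ (0, x) * ‖ψ (0, x) • u 0 x‖ ^ 2) * Real.exp (g (0, x)) = 0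
        rw [h1, h2, zero_smul, norm_zero, zero_pow two_ne_zero, mul_zero, add_zero, zero_mul]
  have iR : IntegrableOn (fun x : E => |Φ (0, x)| * ‖u 0 x‖ ^ 2 * Real.exp (g (0, x))) AN :=
    integrableOn_slab_slice (Φ := fun z : ℝ × E => |Φ z| * ‖u z.1 z.2‖ ^ 2 * Real.exp (g z))
      (((continuous_abs.comp_continuousOn cΦ).mul cu).mul cw) h0c bAN
  have iR2 : IntegrableOn (fun x : E => 1 / 2 * (|Φ (0, x)| * ‖u 0 x‖ ^ 2 * Real.exp (g (0, x)))) AN := iR.const_mul (1 / 2)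
  have key : -∫ x, (GW (0, x) + 1 / 2 * Φ (0, x) * ‖ψ (0, x) • u 0 x‖ ^ 2) * Real.exp (g (0, x)) ≤
      ∫ x, AN.indicator (fun x => 1 / 2 * (|Φ (0, x)| * ‖u 0 x‖ ^ 2 * Real.exp (g (0, x)))) x := by
    rw [← integral_neg]
    refine integral_mono iE.neg (iR2.integrable_indicator mAN) fun x => ?_
    · show -((GW (0, x) + 1 / 2 * Φ (0, x) * ‖ψ (0, x) • u 0 x‖ ^ 2) * Real.exp (g (0, x))) ≤
        AN.indicator (fun x => 1 / 2 * (|Φ (0, x)| * ‖u 0 x‖ ^ 2 * Real.exp (g (0, x)))) x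
      have hw := (Real.exp_pos (g (0, x))).le
      have hGW0 : 0 ≤ GW (0, x) := by rw [hGW]; exact Finset.sum_nonneg fun i _ => sq_nonneg _
      by_cases hx : x ∈ AN
      · rw [indicator_of_mem hx]
        have hψ2 : ‖ψ (0, x) • u 0 x‖ ^ 2 ≤ ‖u 0 x‖ ^ 2 := by
          rw [norm_smul, mul_pow, Real.norm_eq_abs, sq_abs]
          have : ψ (0, x) ^ 2 ≤ 1 := by nlinarith [hψnn (0, x), hψle (0, x)]
          nlinarith [sq_nonneg ‖u 0 x‖]
        have h1 : -(1 / 2 * Φ (0, x) * ‖ψ (0, x) • u 0 x‖ ^ 2) ≤ 1 / 2 * (|Φ (0, x)| * ‖u 0 x‖ ^ 2) := by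
          have := neg_abs_le (Φ (0, x))
          nlinarith [abs_nonneg (Φ (0, x)), sq_nonneg ‖ψ (0, x) • u 0 x‖,
            mul_le_mul_of_nonneg_left hψ2 (abs_nonneg (Φ (0, x)))]
        nlinarith [mul_le_mul_of_nonneg_right h1 hw, mul_nonneg hGW0 hw]
      · rw [indicator_of_notMem hx]
        obtain ⟨h1, h2⟩ := hsupp x hx
        rw [h1, h2, zero_smul, norm_zero, zero_pow two_ne_zero, mul_zero, add_zero, zero_mul, neg_zero]
  rw [hEb]
  refine key.trans (le_of_eq ?_)
  rw [integral_indicator mAN, integral_const_mul]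

include hm hT hb hu hψs hψ1 hψ0 hψd0 hψnn hψle hψg hP hg hGS hGW hQp hPin hIin hW hPLdef hANdef in
/-- **Absorption of the plateau**: `I_pl(t) + ½ P_pl(t) ≤ Q(t)` for `t ∈ [0, T]` (on the plateau
`W = u`, `|∇W|² = |∇u|²`; the integrand of `Q` is nonnegative elsewhere). [cite: Palasek2021, §4 (proof of Prop 9)] -/
theorem cyl_Iin_add_half_Pin_le_Qp {t : ℝ} (ht : t ∈ Icc 0 T) : Iin t + 1 / 2 * Pin t ≤ Qp t := by
  obtain ⟨mPL, mAN, bAN, hPLAN, hANball⟩ := cyl_sets' hPLdef hANdef (r₁ := r₁) (r₂ := r₂) (a := a)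
  have cw := (continuous_exp_cylWeight (E := E) hm hP hg).continuousOn (s := Icc 0 T ×ˢ univ)
  have cGW := continuousOn_GW_slab hT hu hψs hGW
  have cGS := continuousOn_GS_slab hT hu hGS
  have cN := continuousOn_norm_sq_cutoff_slab (T := T) hu hψs
  have cu : ContinuousOn (fun z : ℝ × E => ‖u z.1 z.2‖ ^ 2) (Icc 0 T ×ˢ univ) := (hu.continuousOn.norm).pow 2
  have vout : ∀ x ∉ closedBall (0 : E) (2 * |r₂|),
      81 / 100 * r₂ ^ 2 < m (t, x) ∨ 9 / 25 * r₂ ^ 2 < ⟪x, a⟫ ^ 2 := fun x hx => cyl_vout hm hx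
  have iQ : Integrable fun x : E => (28 * b ^ 2 * ‖ψ (t, x) • u t x‖ ^ 2 + 4 * b * GW (t, x)) * Real.exp (g (t, x)) :=
    integrable_slab_slice (Φ := fun z : ℝ × E => (28 * b ^ 2 * ‖ψ z • u z.1 z.2‖ ^ 2 + 4 * b * GW z) * Real.exp (g z))
      (((continuousOn_const.mul cN).add (continuousOn_const.mul cGW)).mul cw) ht fun x hx => by
        have h1 := (cylField_GW_le hψnn hψle hψ0 hψd0 hψg hGS hGW (t, x)).2 (Or.inr (vout x hx))
        show (28 * b ^ 2 * ‖ψ (t, x) • u t x‖ ^ 2 + 4 * b * GW (t, x)) * Real.exp (g (t, x)) = 0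
        rw [h1, hψ0 (t, x) (Or.inr ((vout x hx).imp le_of_lt le_of_lt)), zero_smul, norm_zero, zero_pow two_ne_zero,
          mul_zero, mul_zero, add_zero, zero_mul]
  have i1 : IntegrableOn (fun x : E => (27 * b ^ 2 * ‖u t x‖ ^ 2 + 3 * b * GS (t, x)) * Real.exp (g (t, x))) PL :=
    integrableOn_slab_slice (Φ := fun z : ℝ × E => (27 * b ^ 2 * ‖u z.1 z.2‖ ^ 2 + 3 * b * GS z) * Real.exp (g z))
      (((continuousOn_const.mul cu).add (continuousOn_const.mul cGS)).mul cw) ht (bAN.subset hPLAN)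
  have i2 : IntegrableOn (fun x : E => 2 * (b ^ 2 * ‖u t x‖ ^ 2 + b * GS (t, x)) * Real.exp (g (t, x))) PL :=
    integrableOn_slab_slice (Φ := fun z : ℝ × E => 2 * (b ^ 2 * ‖u z.1 z.2‖ ^ 2 + b * GS z) * Real.exp (g z))
      ((continuousOn_const.mul ((continuousOn_const.mul cu).add (continuousOn_const.mul cGS))).mul cw) ht
      (bAN.subset hPLAN)
  have hnn : ∀ x, 0 ≤ (28 * b ^ 2 * ‖ψ (t, x) • u t x‖ ^ 2 + 4 * b * GW (t, x)) * Real.exp (g (t, x)) := fun x => by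
    have : 0 ≤ GW (t, x) := by rw [hGW]; exact Finset.sum_nonneg fun i _ => sq_nonneg _
    positivity
  rw [hIin, hQp, hPin]
  dsimp only
  rw [← integral_const_mul, ← integral_add i1 (i2.const_mul _)]
  calc ∫ x in PL, (27 * b ^ 2 * ‖u t x‖ ^ 2 + 3 * b * GS (t, x)) * Real.exp (g (t, x)) +
          1 / 2 * (2 * (b ^ 2 * ‖u t x‖ ^ 2 + b * GS (t, x)) * Real.exp (g (t, x)))
      = ∫ x in PL, (28 * b ^ 2 * ‖ψ (t, x) • u t x‖ ^ 2 + 4 * b * GW (t, x)) * Real.exp (g (t, x)) := by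
        refine setIntegral_congr_fun mPL fun x hx => ?_
        rw [hPLdef] at hx
        have hx' : 4 * r₁ ^ 2 < m (t, x) ∧ m (t, x) < r₂ ^ 2 / 4 ∧ ⟪x, a⟫ ^ 2 < r₂ ^ 2 / 4 := by
          rw [cylSq_slice hm]; exact hx
        obtain ⟨hG, hWu⟩ := cylField_plateau hψ1 hψd0 hW hGS hGW (z := (t, x)) hx'
        have hψ1x : ψ (t, x) = 1 := hψ1 (t, x) hx'.1.le hx'.2.1.le hx'.2.2.le
        rw [hG, hψ1x, one_smul]
        ring
    _ ≤ ∫ x, (28 * b ^ 2 * ‖ψ (t, x) • u t x‖ ^ 2 + 4 * b * GW (t, x)) * Real.exp (g (t, x)) :=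
        setIntegral_le_integral iQ (Eventually.of_forall hnn)

/-! #### The core inequality -/

set_option maxHeartbeats 800000 in
include ha hm hT hr₁ hr₁₂ hb hα hT₀ hT₀T hd3 hu hψs hψnn hψle hψt hψ1 hψ0 hψd0 hψg hψl hP hreg hg hΦ hW hGS hGW hEb hQp hPin hPsh hIin hPLdef hANdef in
/-- **Palasek 2021, Prop 9, the integrated Carleman inequality after absorption**: in the setting of
Prop 9 (`u` of class `C²` on `[0,T] × E`, the differential inequality with `b = (C₀T)⁻¹` on
`]0,T[ × {r₁² ≤ m ≤ r₂², ⟪x,a⟫² ≤ r₂²}`), with the cylindrical cut-off, the weight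
`g = α(T₀−t)P(m) + b|x|²`, `0 < T₀ < T`, dimension `3`, and the side conditions `4 ≤ b r₁²`,
`4T ≤ r₁²`, `40 b ≤ α r₁`, one has
`∫₀^{T₀} I_pl ≤ ½∫₀^{T₀} P_sh + ∫_{AN} (2|∇u|² + 2(C/r₁²)|u|²)(T₀)eᵍ + ½∫_{AN} |F(0,x)| |u(0,x)|² e^{g(0,x)}`,
`I_pl(t) = ∫_{PL} (27b²|u|² + 3b|∇u|²)eᵍ`, `P_sh(t) = ∫_{AN∖PL} 4(1+C)²(b²|u|² + b|∇u|²)eᵍ`. [cite: Palasek2021, §4 (proof of Prop 9)] -/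
theorem core_cyl_carleman (hCψ : 0 ≤ Cψ) (hbr : 4 ≤ b * r₁ ^ 2) (h4T : 4 * T ≤ r₁ ^ 2) (hαr : 40 * b ≤ α * r₁)
    (hL : ∀ t ∈ Ioo 0 T, ∀ x : E, r₁ ^ 2 ≤ ‖x‖ ^ 2 - ⟪x, a⟫ ^ 2 → ‖x‖ ^ 2 - ⟪x, a⟫ ^ 2 ≤ r₂ ^ 2 → ⟪x, a⟫ ^ 2 ≤ r₂ ^ 2 →
      ‖FluidPDE.timeDeriv u t x + Δ (u t) x‖ ≤ b * ‖u t x‖ + Real.sqrt b * ‖fderiv ℝ (u t) x‖) :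
    ∫ t in (0 : ℝ)..T₀, Iin t ≤
      1 / 2 * (∫ t in (0 : ℝ)..T₀, Psh t) +
        (∫ x in AN, (2 * GS (T₀, x) + 2 * (Cψ / r₁ ^ 2) * ‖u T₀ x‖ ^ 2) * Real.exp (g (T₀, x))) +
        1 / 2 * ∫ x in AN, |Φ (0, x)| * ‖u 0 x‖ ^ 2 * Real.exp (g (0, x)) := by
  have hIccT : Icc 0 T₀ ⊆ Icc 0 T := Icc_subset_Icc_right hT₀T.le
  obtain ⟨cEb, cQp⟩ := cyl_continuousOn_Eb_Qp hm hT hu hψs hψnn hψle hψ0 hψd0 hψg hP hg hΦ hGS hGW hEb hQp (b := b)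
  obtain ⟨cPin, cPsh, cIin⟩ := cyl_continuousOn_P hm hT hu hP hg hGS hPLdef hANdef hPin hPsh hIin (Cψ := Cψ) (b := b)
  have cEb' := cEb.mono hIccT
  have cQp' := cQp.mono hIccT
  have cP : ContinuousOn (fun t => Pin t + Psh t) (Icc 0 T₀) := (cPin.add cPsh).mono hIccT
  have hPint : IntegrableOn (fun t => Pin t + Psh t) (uIcc 0 T₀) := by
    rw [uIcc_of_le hT₀.le]
    exact cP.integrableOn_compact isCompact_Icc
  have hQint : IntegrableOn Qp (uIcc 0 T₀) := by
    rw [uIcc_of_le hT₀.le]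
    exact cQp'.integrableOn_compact isCompact_Icc
  -- the monotone quantity `G = E + ½ ∫ (P_pl + P_sh) − ∫ Q`
  have cG : ContinuousOn (fun t => Eb t + 1 / 2 * (∫ τ in (0 : ℝ)..t, (Pin τ + Psh τ)) - ∫ τ in (0 : ℝ)..t, Qp τ)
      (Icc 0 T₀) := by
    refine (cEb'.add (continuousOn_const.mul ?_)).sub ?_
    · have := intervalIntegral.continuousOn_primitive_interval hPint
      rwa [uIcc_of_le hT₀.le] at this
    · have := intervalIntegral.continuousOn_primitive_interval hQint
      rwa [uIcc_of_le hT₀.le] at this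
  have dG : ∀ t ∈ Ioo 0 T₀, ∃ D, HasDerivAt (fun t => Eb t + 1 / 2 * (∫ τ in (0 : ℝ)..t, (Pin τ + Psh τ)) -
      ∫ τ in (0 : ℝ)..t, Qp τ) D t ∧ 0 ≤ D := by
    intro t ht
    have htT : t ∈ Ioo 0 T := ⟨ht.1, ht.2.trans hT₀T⟩
    obtain ⟨D, hD, hineq⟩ := cyl_hasDerivAt_Eb ha hm hT hr₁ hr₁₂ hb hα hT₀ hT₀T hd3 hu hψs hψnn hψle hψt hψ1 hψ0 hψd0 hψg hψl
      hP hreg hg hΦ hW hGS hGW hPLdef hANdef hEb hQp hPin hPsh hCψ hbr h4T hαr hL htT ht.2.le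
    have hPc := cP.continuousAt (Icc_mem_nhds ht.1 ht.2)
    have hQc : ContinuousAt Qp t := cQp'.continuousAt (Icc_mem_nhds ht.1 ht.2)
    have hPm : StronglyMeasurableAtFilter (fun t => Pin t + Psh t) (𝓝 t) volume :=
      ContinuousOn.stronglyMeasurableAtFilter isOpen_Ioo (cP.mono Ioo_subset_Icc_self) t ht
    have hQm : StronglyMeasurableAtFilter Qp (𝓝 t) volume :=
      ContinuousOn.stronglyMeasurableAtFilter isOpen_Ioo (cQp'.mono Ioo_subset_Icc_self) t ht
    have hPi := (cP.mono (Icc_subset_Icc_right ht.2.le)).intervalIntegrable_of_Icc (μ := volume) ht.1.le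
    have hQi : IntervalIntegrable Qp volume 0 t :=
      (cQp'.mono (Icc_subset_Icc_right ht.2.le)).intervalIntegrable_of_Icc ht.1.le
    have dP := intervalIntegral.integral_hasDerivAt_right hPi hPm hPc
    have dQ := intervalIntegral.integral_hasDerivAt_right hQi hQm hQc
    refine ⟨_, (hD.add (dP.const_mul (1 / 2))).sub dQ, ?_⟩
    linarith [hineq]
  have hmono : MonotoneOn (fun t => Eb t + 1 / 2 * (∫ τ in (0 : ℝ)..t, (Pin τ + Psh τ)) - ∫ τ in (0 : ℝ)..t, Qp τ)
      (Icc 0 T₀) := by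
    refine monotoneOn_of_deriv_nonneg (convex_Icc 0 T₀) cG (fun t ht => ?_) fun t ht => ?_
    · rw [interior_Icc] at ht
      obtain ⟨D, hD, -⟩ := dG t ht
      exact hD.differentiableAt.differentiableWithinAt
    · rw [interior_Icc] at ht
      obtain ⟨D, hD, hD0⟩ := dG t ht
      rwa [hD.deriv]
  have hG0T := hmono (left_mem_Icc.2 hT₀.le) (right_mem_Icc.2 hT₀.le) hT₀.le
  simp only [intervalIntegral.integral_same, mul_zero, add_zero, sub_zero] at hG0T
  -- the pieces
  have hTop := cyl_Eb_top_le ha hm hT hr₁ hr₁₂ hb hα hT₀ hT₀T hd3 hu hψs hψnn hψle hψ0 hψd0 hψg hP hreg hg hΦ hGS hGW hANdef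
    hEb (Cψ := Cψ) hbr h4T hαr
  have hBot := cyl_neg_Eb_zero_le hm hT hr₁ hr₁₂ hu hψs hψnn hψle hψ0 hψd0 hψg hP hg hΦ hGS hGW hANdef hEb (b := b)
  have iIin : IntervalIntegrable Iin volume 0 T₀ := (cIin.mono hIccT).intervalIntegrable_of_Icc hT₀.le
  have iQpI : IntervalIntegrable Qp volume 0 T₀ := cQp'.intervalIntegrable_of_Icc hT₀.le
  have iPin : IntervalIntegrable Pin volume 0 T₀ := (cPin.mono hIccT).intervalIntegrable_of_Icc hT₀.le
  have iPsh : IntervalIntegrable Psh volume 0 T₀ := (cPsh.mono hIccT).intervalIntegrable_of_Icc hT₀.le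
  have e1 : ∫ t in (0 : ℝ)..T₀, (Iin t + 1 / 2 * Pin t) ≤ ∫ t in (0 : ℝ)..T₀, Qp t :=
    intervalIntegral.integral_mono_on hT₀.le (iIin.add (iPin.const_mul _)) iQpI fun t ht =>
      cyl_Iin_add_half_Pin_le_Qp hm hT hb hu hψs hψnn hψle hψ1 hψ0 hψd0 hψg hP hg hW hGS hGW hPLdef hANdef hQp hPin hIin
        (hIccT ht)
  have e2 : ∫ t in (0 : ℝ)..T₀, (Iin t + 1 / 2 * Pin t) = (∫ t in (0 : ℝ)..T₀, Iin t) + 1 / 2 * ∫ t in (0 : ℝ)..T₀, Pin t := by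
    rw [intervalIntegral.integral_add iIin (iPin.const_mul _), intervalIntegral.integral_const_mul]
  have e3 : ∫ t in (0 : ℝ)..T₀, (Pin t + Psh t) = (∫ t in (0 : ℝ)..T₀, Pin t) + ∫ t in (0 : ℝ)..T₀, Psh t :=
    intervalIntegral.integral_add iPin iPsh
  rw [e3] at hG0T
  linarith [hG0T, e1, e2, hTop, hBot]

end CylCore

/-! ### The four terms -/

section Terms

variable [FiniteDimensional ℝ E] [MeasurableSpace E] [BorelSpace E]
variable {F : Type*} [NormedAddCommGroup F] [InnerProductSpace ℝ F]
variable {a : E} (ha : ‖a‖ = 1) {m : ℝ × E → ℝ} (hm : m = fun y : ℝ × E => ‖y.2‖ ^ 2 - ⟪y.2, a⟫ ^ 2)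
variable {T r₁ r₂ Cψ b α T₀ C₀ : ℝ} {u : ℝ → E → F} {P : ℝ → ℝ} {g Φ : ℝ × E → ℝ} {GS : ℝ × E → ℝ} {φ : ℝ → ℝ}
  {PL AN : Set E}
variable (hT : 0 < T) (hr₁ : 0 < r₁) (hr₁₂ : 20 * r₁ ≤ r₂) (hC₀ : 1 ≤ C₀) (hbdef : b = (C₀ * T)⁻¹)
  (hαdef : α = b * r₂ / (2 * T)) (hT₀mem : T₀ ∈ Icc (T / 2) (3 * T / 4)) (hr₁T : 4 * C₀ * T ≤ r₁ ^ 2)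
  (hu : ContDiffOn ℝ 2 (uncurry u) (Icc 0 T ×ˢ univ))
  (hGS : GS = fun z : ℝ × E => ∑ i, ‖fderiv ℝ (u z.1) z.2 (stdOrthonormalBasis ℝ E i)‖ ^ 2)
  (hP : ContDiff ℝ (⊤ : ℕ∞) P)
  (hreg : ∀ s, r₁ ^ 2 / 4 < s → P s = Real.sqrt s ∧ deriv P s = 1 / (2 * Real.sqrt s) ∧
    deriv (deriv P) s = -1 / (4 * s * Real.sqrt s) ∧ deriv (deriv (deriv P)) s = 3 / (8 * s ^ 2 * Real.sqrt s))
  (hg : g = fun z : ℝ × E => α * (T₀ - z.1) * P (m z) + b * ‖z.2‖ ^ 2)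
  (hΦ : Φ = fun z : ℝ × E => -(α + 4 * b * α * (T₀ - z.1)) * P (m z) +
    -(2 * ((Module.finrank ℝ E : ℝ) - 2) * α * (T₀ - z.1)) * deriv P (m z) +
    (-(2 * b * (Module.finrank ℝ E : ℝ)) - (α * (T₀ - z.1)) ^ 2) + -(4 * b ^ 2) * ‖z.2‖ ^ 2)
  (hPLdef : PL = {y : E | 4 * r₁ ^ 2 < ‖y‖ ^ 2 - ⟪y, a⟫ ^ 2 ∧ ‖y‖ ^ 2 - ⟪y, a⟫ ^ 2 < r₂ ^ 2 / 4 ∧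
    ⟪y, a⟫ ^ 2 < r₂ ^ 2 / 4})
  (hANdef : AN = {y : E | r₁ ^ 2 < ‖y‖ ^ 2 - ⟪y, a⟫ ^ 2 ∧ ‖y‖ ^ 2 - ⟪y, a⟫ ^ 2 < r₂ ^ 2 ∧ ⟪y, a⟫ ^ 2 < r₂ ^ 2})
  (hφ : φ = fun t => ∫ x in AN, Real.exp (2 * b * ‖x‖ ^ 2) * (T⁻¹ * ‖u t x‖ ^ 2 + ‖fderiv ℝ (u t) x‖ ^ 2))

include hT hu hφ hANdef in
/-- `φ♯(t) = ∫_{AN} e^{2b|x|²}(T⁻¹|u|² + |∇u|²)(t,x) dx` is continuous on `[0,T]` and nonnegative. [folklore] -/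
theorem continuousOn_cylPhiSharp : ContinuousOn φ (Icc 0 T) ∧ ∀ t, 0 ≤ φ t := by
  obtain ⟨-, mAN, bAN, -, -⟩ := cyl_sets' (PL := {y : E | 4 * r₁ ^ 2 < ‖y‖ ^ 2 - ⟪y, a⟫ ^ 2 ∧
    ‖y‖ ^ 2 - ⟪y, a⟫ ^ 2 < r₂ ^ 2 / 4 ∧ ⟪y, a⟫ ^ 2 < r₂ ^ 2 / 4}) rfl hANdef (r₁ := r₁) (r₂ := r₂) (a := a)
  rw [hφ]
  refine ⟨?_, fun t => setIntegral_nonneg mAN fun x _ => by positivity⟩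
  have c : ContinuousOn (fun z : ℝ × E => Real.exp (2 * b * ‖z.2‖ ^ 2) * (T⁻¹ * ‖u z.1 z.2‖ ^ 2 + ‖fderiv ℝ (u z.1) z.2‖ ^ 2))
      (Icc 0 T ×ˢ univ) :=
    (Real.continuous_exp.comp (continuous_const.mul (continuous_snd.norm.pow 2))).continuousOn.mul
      ((continuousOn_const.mul ((hu.continuousOn.norm).pow 2)).add (continuousOn_norm_sliceFDeriv_sq hT hu (by norm_num)))
  exact continuousOn_setIntegral_slice mAN bAN (c.mono (prod_mono Subset.rfl (subset_univ _)))

include hm hT hr₁ hr₁₂ hC₀ hbdef hαdef hT₀mem hu hGS hP hreg hg hPLdef hANdef in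
/-- **Left-hand side**: for `t ∈ [0, T/4]`,
`(3b/C₀) e^{(5/2)αTr₁} ∫_{10r₁ < r < r₂/2, |z| < r₂/2} (T⁻¹|u|² + |∇u|²) ≤ I_pl(t)` (Palasek: "by
limiting the time interval to `[0,T/4]` and the `r` interval to `[10r₋, r₊/2]`, we find that on this
region `g ≥ 5r₋r₊/(4C₀T)`"). [cite: Palasek2021, §4 (proof of Prop 9)] -/
theorem cyl_Iin_lower {t : ℝ} (ht : t ∈ Icc 0 (T / 4)) :
    3 * b / C₀ * Real.exp (5 / 2 * α * T * r₁) *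
        ∫ x in {y : E | 100 * r₁ ^ 2 < ‖y‖ ^ 2 - ⟪y, a⟫ ^ 2 ∧ ‖y‖ ^ 2 - ⟪y, a⟫ ^ 2 < r₂ ^ 2 / 4 ∧ ⟪y, a⟫ ^ 2 < r₂ ^ 2 / 4},
          (T⁻¹ * ‖u t x‖ ^ 2 + ‖fderiv ℝ (u t) x‖ ^ 2) ≤
      ∫ x in PL, (27 * b ^ 2 * ‖u t x‖ ^ 2 + 3 * b * GS (t, x)) * Real.exp (g (t, x)) := by
  obtain ⟨hb, hbT, hbTC, hC⟩ := b_facts hT hC₀ hbdef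
  obtain ⟨mPL, mAN, bAN, hPLAN, -⟩ := cyl_sets' hPLdef hANdef (r₁ := r₁) (r₂ := r₂) (a := a)
  have hC₀0 : 0 < C₀ := by linarith
  have hr₂ : 0 ≤ r₂ := by linarith
  have hα : 0 ≤ α := by rw [hαdef]; positivity
  have htc : t ∈ Icc 0 T := ⟨ht.1, by linarith [ht.2]⟩
  set Lf : Set E := {y : E | 100 * r₁ ^ 2 < ‖y‖ ^ 2 - ⟪y, a⟫ ^ 2 ∧ ‖y‖ ^ 2 - ⟪y, a⟫ ^ 2 < r₂ ^ 2 / 4 ∧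
    ⟪y, a⟫ ^ 2 < r₂ ^ 2 / 4} with hLf
  have hLsub : Lf ⊆ PL := fun y hy => by
    rw [hPLdef]
    exact ⟨by nlinarith [hy.1, sq_nonneg r₁], hy.2.1, hy.2.2⟩
  have hcM : Continuous fun y : E => ‖y‖ ^ 2 - ⟪y, a⟫ ^ 2 :=
    (continuous_norm.pow 2).sub ((continuous_id.inner continuous_const).pow 2)
  have hcZ : Continuous fun y : E => ⟪y, a⟫ ^ 2 := (continuous_id.inner continuous_const).pow 2
  have mL : MeasurableSet Lf :=
    ((isOpen_lt continuous_const hcM).inter ((isOpen_lt hcM continuous_const).inter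
      (isOpen_lt hcZ continuous_const))).measurableSet
  have cw := (continuous_exp_cylWeight (E := E) hm hP hg).continuousOn (s := Icc 0 T ×ˢ univ)
  have cGS := continuousOn_GS_slab hT hu hGS
  have cu : ContinuousOn (fun z : ℝ × E => ‖u z.1 z.2‖ ^ 2) (Icc 0 T ×ˢ univ) := (hu.continuousOn.norm).pow 2
  have cG := continuousOn_norm_sliceFDeriv_sq hT hu (by norm_num : (1 : WithTop ℕ∞) ≤ 2)
  have iR : IntegrableOn (fun x : E => (27 * b ^ 2 * ‖u t x‖ ^ 2 + 3 * b * GS (t, x)) * Real.exp (g (t, x))) PL :=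
    integrableOn_slab_slice (Φ := fun z : ℝ × E => (27 * b ^ 2 * ‖u z.1 z.2‖ ^ 2 + 3 * b * GS z) * Real.exp (g z))
      (((continuousOn_const.mul cu).add (continuousOn_const.mul cGS)).mul cw) htc (bAN.subset hPLAN)
  have iL : IntegrableOn (fun x : E => 3 * b / C₀ * Real.exp (5 / 2 * α * T * r₁) *
      (T⁻¹ * ‖u t x‖ ^ 2 + ‖fderiv ℝ (u t) x‖ ^ 2)) Lf :=
    integrableOn_slab_slice (Φ := fun z : ℝ × E => 3 * b / C₀ * Real.exp (5 / 2 * α * T * r₁) *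
      (T⁻¹ * ‖u z.1 z.2‖ ^ 2 + ‖fderiv ℝ (u z.1) z.2‖ ^ 2)) (continuousOn_const.mul ((continuousOn_const.mul cu).add cG))
      htc (bAN.subset (hLsub.trans hPLAN))
  have hnn : ∀ x, 0 ≤ (27 * b ^ 2 * ‖u t x‖ ^ 2 + 3 * b * GS (t, x)) * Real.exp (g (t, x)) := fun x => by
    have := (GS_compare hGS (t, x)).2.2
    positivity
  rw [← integral_const_mul]
  calc ∫ x in Lf, 3 * b / C₀ * Real.exp (5 / 2 * α * T * r₁) * (T⁻¹ * ‖u t x‖ ^ 2 + ‖fderiv ℝ (u t) x‖ ^ 2)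
      ≤ ∫ x in Lf, (27 * b ^ 2 * ‖u t x‖ ^ 2 + 3 * b * GS (t, x)) * Real.exp (g (t, x)) := by
        refine setIntegral_mono_on iL (iR.mono_set hLsub) mL fun x hx => ?_
        obtain ⟨hGop, -, hGS0⟩ := GS_compare hGS (t, x)
        -- the weight from below
        have hmx : m (t, x) = ‖x‖ ^ 2 - ⟪x, a⟫ ^ 2 := cylSq_slice hm t x
        have hxr : r₁ ^ 2 / 4 < m (t, x) := by rw [hmx]; nlinarith [hx.1, sq_nonneg r₁]
        obtain ⟨hn, hs⟩ := sqrt_cylSq_region hr₁ hxr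
        have hP0 : P (m (t, x)) = Real.sqrt (m (t, x)) := (hreg _ hxr).1
        have hx10 : 10 * r₁ ≤ Real.sqrt (m (t, x)) := by
          rw [Real.le_sqrt (by positivity) (le_of_lt (lt_trans (by positivity) hxr)), hmx]
          nlinarith [hx.1]
        have hgl : 5 / 2 * α * T * r₁ ≤ g (t, x) := by
          rw [hg]
          show 5 / 2 * α * T * r₁ ≤ α * (T₀ - t) * P (m (t, x)) + b * ‖x‖ ^ 2
          rw [hP0]
          have h1 : T / 4 ≤ T₀ - t := by linarith [hT₀mem.1, ht.2]
          have h2 : α * (T / 4) * (10 * r₁) ≤ α * (T₀ - t) * Real.sqrt (m (t, x)) :=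
            mul_le_mul (mul_le_mul_of_nonneg_left h1 hα) hx10 (by positivity) (by nlinarith)
          have h3 : 0 ≤ b * ‖x‖ ^ 2 := by positivity
          nlinarith
        have hexp : Real.exp (5 / 2 * α * T * r₁) ≤ Real.exp (g (t, x)) := Real.exp_le_exp.2 hgl
        -- the coefficient
        have hA : 3 * b / C₀ * (T⁻¹ * ‖u t x‖ ^ 2 + ‖fderiv ℝ (u t) x‖ ^ 2) ≤ 27 * b ^ 2 * ‖u t x‖ ^ 2 + 3 * b * GS (t, x) := by
          have e1 : 3 * b / C₀ * T⁻¹ ≤ 27 * b ^ 2 := by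
            have hbCT : b / C₀ * T⁻¹ = b ^ 2 := by
              rw [hbdef]
              field_simp
            calc 3 * b / C₀ * T⁻¹ = 3 * (b / C₀ * T⁻¹) := by ring
              _ = 3 * b ^ 2 := by rw [hbCT]
              _ ≤ 27 * b ^ 2 := by nlinarith [sq_nonneg b]
          have e2 : 3 * b / C₀ ≤ 3 * b := by
            rw [div_le_iff₀ hC₀0]
            nlinarith
          have := mul_le_mul_of_nonneg_right e1 (sq_nonneg ‖u t x‖)
          have := mul_le_mul e2 hGop (sq_nonneg _) (by positivity)
          nlinarith
        calc 3 * b / C₀ * Real.exp (5 / 2 * α * T * r₁) * (T⁻¹ * ‖u t x‖ ^ 2 + ‖fderiv ℝ (u t) x‖ ^ 2)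
            = (3 * b / C₀ * (T⁻¹ * ‖u t x‖ ^ 2 + ‖fderiv ℝ (u t) x‖ ^ 2)) * Real.exp (5 / 2 * α * T * r₁) := by ring
          _ ≤ (27 * b ^ 2 * ‖u t x‖ ^ 2 + 3 * b * GS (t, x)) * Real.exp (g (t, x)) :=
              mul_le_mul hA hexp (Real.exp_pos _).le (by positivity)
    _ ≤ ∫ x in PL, (27 * b ^ 2 * ‖u t x‖ ^ 2 + 3 * b * GS (t, x)) * Real.exp (g (t, x)) :=
        setIntegral_mono_set iR (Eventually.of_forall hnn) (Eventually.of_forall hLsub)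

set_option maxHeartbeats 800000 in
include hm hT hr₁ hr₁₂ hC₀ hbdef hαdef hT₀mem hu hGS hP hreg hg hφ hPLdef hANdef in
/-- **Shell term**: for `t ∈ [0, T₀]`, `P_sh(t) ≤ 3b · C_sh · e^{2αTr₁} φ♯(t)` (Palasek: within the
transition regions `g − 2|x|²/(C₀T) − 5r₋r₊/(4C₀T) ≤ −r₊r₋/(4C₀T)`, i.e. `eᵍ ≤ e^{r₋r₊/(C₀T)} e^{2|x|²/(C₀T)}`
on the inner shell `r ≤ 2r₋`, the outer shell `r ≥ r₊/2` and the axial caps `|z| ≥ r₊/2`; here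
`2αTr₁ = r₁r₂/(C₀T)`). [cite: Palasek2021, §4 (proof of Prop 9)] -/
theorem cyl_Psh_le (hd3 : Module.finrank ℝ E = 3) (hCψ : 0 ≤ Cψ) {t : ℝ} (ht : t ∈ Icc 0 T₀) :
    ∫ x in AN \ PL, 4 * (1 + Cψ) ^ 2 * (b ^ 2 * ‖u t x‖ ^ 2 + b * GS (t, x)) * Real.exp (g (t, x)) ≤
      3 * b * (4 * (1 + Cψ) ^ 2) * Real.exp (2 * α * T * r₁) * φ t := by
  obtain ⟨hb, hbT, -, -⟩ := b_facts hT hC₀ hbdef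
  obtain ⟨mPL, mAN, bAN, hPLAN, -⟩ := cyl_sets' hPLdef hANdef (r₁ := r₁) (r₂ := r₂) (a := a)
  have hr₂ : 0 < r₂ := by linarith
  have hα : 0 ≤ α := by rw [hαdef]; positivity
  have hT₀T : T₀ ≤ T := by linarith [hT₀mem.2]
  have htc : t ∈ Icc 0 T := ⟨ht.1, ht.2.trans hT₀T⟩
  have hd3' : (Module.finrank ℝ E : ℝ) = 3 := by exact_mod_cast hd3
  have cw := (continuous_exp_cylWeight (E := E) hm hP hg).continuousOn (s := Icc 0 T ×ˢ univ)
  have cGS := continuousOn_GS_slab hT hu hGS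
  have cu : ContinuousOn (fun z : ℝ × E => ‖u z.1 z.2‖ ^ 2) (Icc 0 T ×ˢ univ) := (hu.continuousOn.norm).pow 2
  have cG := continuousOn_norm_sliceFDeriv_sq hT hu (by norm_num : (1 : WithTop ℕ∞) ≤ 2)
  have ce : Continuous fun z : ℝ × E => Real.exp (2 * b * ‖z.2‖ ^ 2) :=
    Real.continuous_exp.comp (continuous_const.mul (continuous_snd.norm.pow 2))
  set Csh : ℝ := 4 * (1 + Cψ) ^ 2 with hCsh
  have hCsh0 : 0 ≤ Csh := by positivity
  have iL : IntegrableOn (fun x : E => Csh * (b ^ 2 * ‖u t x‖ ^ 2 + b * GS (t, x)) * Real.exp (g (t, x))) (AN \ PL) :=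
    integrableOn_slab_slice (Φ := fun z : ℝ × E => Csh * (b ^ 2 * ‖u z.1 z.2‖ ^ 2 + b * GS z) * Real.exp (g z))
      ((continuousOn_const.mul ((continuousOn_const.mul cu).add (continuousOn_const.mul cGS))).mul cw) htc
      (bAN.subset Set.sdiff_subset)
  have iM : IntegrableOn (fun x : E => 3 * b * Csh * Real.exp (2 * α * T * r₁) *
      (Real.exp (2 * b * ‖x‖ ^ 2) * (T⁻¹ * ‖u t x‖ ^ 2 + ‖fderiv ℝ (u t) x‖ ^ 2))) AN :=
    integrableOn_slab_slice (Φ := fun z : ℝ × E => 3 * b * Csh * Real.exp (2 * α * T * r₁) *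
      (Real.exp (2 * b * ‖z.2‖ ^ 2) * (T⁻¹ * ‖u z.1 z.2‖ ^ 2 + ‖fderiv ℝ (u z.1) z.2‖ ^ 2)))
      (continuousOn_const.mul (ce.continuousOn.mul ((continuousOn_const.mul cu).add cG))) htc bAN
  have step1 : ∫ x in AN \ PL, Csh * (b ^ 2 * ‖u t x‖ ^ 2 + b * GS (t, x)) * Real.exp (g (t, x)) ≤
      ∫ x in AN \ PL, 3 * b * Csh * Real.exp (2 * α * T * r₁) *
            (Real.exp (2 * b * ‖x‖ ^ 2) * (T⁻¹ * ‖u t x‖ ^ 2 + ‖fderiv ℝ (u t) x‖ ^ 2)) := by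
    refine setIntegral_mono_on iL (iM.mono_set Set.sdiff_subset) (mAN.diff mPL) fun x hx => ?_
    obtain ⟨hxan, hxpl⟩ := hx
    rw [hANdef] at hxan
    rw [hPLdef] at hxpl
    obtain ⟨hx1, hx2, hx3⟩ := hxan
    obtain ⟨hGop, hGSd, hGS0⟩ := GS_compare hGS (t, x)
    -- the weight on the transition regions
    have hmx : m (t, x) = ‖x‖ ^ 2 - ⟪x, a⟫ ^ 2 := cylSq_slice hm t x
    have hxr : r₁ ^ 2 / 4 < m (t, x) := by rw [hmx]; nlinarith [sq_nonneg r₁]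
    obtain ⟨hn, hs⟩ := sqrt_cylSq_region hr₁ hxr
    have hP0 : P (m (t, x)) = Real.sqrt (m (t, x)) := (hreg _ hxr).1
    have hgup : g (t, x) ≤ 2 * α * T * r₁ + 2 * b * ‖x‖ ^ 2 := by
      rw [hg]
      show α * (T₀ - t) * P (m (t, x)) + b * ‖x‖ ^ 2 ≤ 2 * α * T * r₁ + 2 * b * ‖x‖ ^ 2
      rw [hP0]
      generalize Real.sqrt (m (t, x)) = ρ at hn hs
      rw [hmx] at hs
      have hTt : T₀ - t ≤ T := by linarith [ht.1]
      have h1 : α * (T₀ - t) * ρ ≤ α * T * ρ := mul_le_mul_of_nonneg_right (mul_le_mul_of_nonneg_left hTt hα) hn.le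
      have hbx : 0 ≤ b * ‖x‖ ^ 2 := by positivity
      have hζ : 0 ≤ ⟪x, a⟫ ^ 2 := sq_nonneg _
      rcases not_and_or.1 hxpl with h | h
      · -- inner shell: `ρ ≤ 2 r₁`
        push Not at h
        have hx2r : ρ ≤ 2 * r₁ :=
          (pow_le_pow_iff_left₀ hn.le (by positivity) two_ne_zero).1 (by nlinarith)
        have h3 : α * T * ρ ≤ α * T * (2 * r₁) := mul_le_mul_of_nonneg_left hx2r (by positivity)
        linarith [h1, h3, hbx]
      · have h4 : 0 ≤ 2 * α * T * r₁ := by positivity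
        have hαT : α * T = b * (r₂ / 2) := by rw [hαdef]; field_simp
        rcases not_and_or.1 h with h | h
        · -- outer shell: `r₂/2 ≤ ρ`, `αTρ = bρ r₂/2 ≤ bρ² ≤ b|x|²`
          push Not at h
          have hxR : r₂ / 2 ≤ ρ :=
            (pow_le_pow_iff_left₀ (by positivity) hn.le two_ne_zero).1 (by nlinarith)
          have h3 : α * T * ρ ≤ b * ‖x‖ ^ 2 := by
            rw [hαT]
            have : b * (r₂ / 2) * ρ ≤ b * ρ * ρ := by
              have := mul_le_mul_of_nonneg_left hxR (by positivity : (0 : ℝ) ≤ b * ρ)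
              linarith
            nlinarith
          linarith [h1, h3, h4]
        · -- axial cap: `r₂²/4 ≤ ⟪x,a⟫²`, `|x|² = ρ² + ⟪x,a⟫² ≥ r₂ ρ`
          push Not at h
          have h3 : α * T * ρ ≤ b * ‖x‖ ^ 2 := by
            rw [hαT]
            have hamgm : r₂ * ρ ≤ ρ ^ 2 + ⟪x, a⟫ ^ 2 := by nlinarith [sq_nonneg (ρ - r₂ / 2)]
            have : b * (r₂ * ρ) ≤ b * (ρ ^ 2 + ⟪x, a⟫ ^ 2) := mul_le_mul_of_nonneg_left hamgm hb.le
            nlinarith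
          linarith [h1, h3, h4]
    have hexp : Real.exp (g (t, x)) ≤ Real.exp (2 * α * T * r₁) * Real.exp (2 * b * ‖x‖ ^ 2) := by
      rw [← Real.exp_add]
      exact Real.exp_le_exp.2 hgup
    have hB : b ^ 2 * ‖u t x‖ ^ 2 + b * GS (t, x) ≤ 3 * b * (T⁻¹ * ‖u t x‖ ^ 2 + ‖fderiv ℝ (u t) x‖ ^ 2) := by
      rw [hd3'] at hGSd
      have e1 : b ^ 2 ≤ 3 * b * T⁻¹ := by
        have h0 : b * b ≤ b * T⁻¹ := mul_le_mul_of_nonneg_left hbT hb.le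
        have hpos : 0 ≤ b * T⁻¹ := by positivity
        rw [sq]
        linarith
      have h5 := mul_le_mul_of_nonneg_right e1 (sq_nonneg ‖u t x‖)
      have h6 := mul_le_mul_of_nonneg_left hGSd hb.le
      simp only at h6
      linarith [h5, h6]
    calc Csh * (b ^ 2 * ‖u t x‖ ^ 2 + b * GS (t, x)) * Real.exp (g (t, x))
        ≤ Csh * (3 * b * (T⁻¹ * ‖u t x‖ ^ 2 + ‖fderiv ℝ (u t) x‖ ^ 2)) *
            (Real.exp (2 * α * T * r₁) * Real.exp (2 * b * ‖x‖ ^ 2)) :=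
          mul_le_mul (mul_le_mul_of_nonneg_left hB hCsh0) hexp (Real.exp_pos _).le (by positivity)
      _ = _ := by ring
  have step2 : ∫ x in AN \ PL, 3 * b * Csh * Real.exp (2 * α * T * r₁) *
          (Real.exp (2 * b * ‖x‖ ^ 2) * (T⁻¹ * ‖u t x‖ ^ 2 + ‖fderiv ℝ (u t) x‖ ^ 2)) ≤
      ∫ x in AN, 3 * b * Csh * Real.exp (2 * α * T * r₁) *
          (Real.exp (2 * b * ‖x‖ ^ 2) * (T⁻¹ * ‖u t x‖ ^ 2 + ‖fderiv ℝ (u t) x‖ ^ 2)) :=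
    setIntegral_mono_set iM (Eventually.of_forall fun x => by positivity) (Eventually.of_forall Set.sdiff_subset)
  refine (step1.trans step2).trans (le_of_eq ?_)
  rw [hφ, ← integral_const_mul]

include hm hT hr₁ hC₀ hbdef hT₀mem hr₁T hu hGS hP hg hφ hANdef in
/-- **Top term**: `∫_{AN} (2|∇u|² + 2(C/r₁²)|u|²)(T₀) eᵍ ≤ (6 + C) φ♯(T₀)` (`g(T₀, x) = |x|²/(C₀T)`). [cite: Palasek2021, §4 (proof of Prop 9)] -/
theorem cyl_top_le (hd3 : Module.finrank ℝ E = 3) (hCψ : 0 ≤ Cψ) :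
    ∫ x in AN, (2 * GS (T₀, x) + 2 * (Cψ / r₁ ^ 2) * ‖u T₀ x‖ ^ 2) * Real.exp (g (T₀, x)) ≤ (6 + Cψ) * φ T₀ := by
  obtain ⟨hb, hbT, -, -⟩ := b_facts hT hC₀ hbdef
  obtain ⟨-, mAN, bAN, -, -⟩ := cyl_sets' (PL := {y : E | 4 * r₁ ^ 2 < ‖y‖ ^ 2 - ⟪y, a⟫ ^ 2 ∧
    ‖y‖ ^ 2 - ⟪y, a⟫ ^ 2 < r₂ ^ 2 / 4 ∧ ⟪y, a⟫ ^ 2 < r₂ ^ 2 / 4}) rfl hANdef (r₁ := r₁) (r₂ := r₂) (a := a)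
  have hT₀c : T₀ ∈ Icc 0 T := ⟨by linarith [hT₀mem.1], by linarith [hT₀mem.2]⟩
  have hd3' : (Module.finrank ℝ E : ℝ) = 3 := by exact_mod_cast hd3
  have hr2 : 0 < r₁ ^ 2 := by positivity
  have cw := (continuous_exp_cylWeight (E := E) hm hP hg).continuousOn (s := Icc 0 T ×ˢ univ)
  have cGS := continuousOn_GS_slab hT hu hGS
  have cu : ContinuousOn (fun z : ℝ × E => ‖u z.1 z.2‖ ^ 2) (Icc 0 T ×ˢ univ) := (hu.continuousOn.norm).pow 2
  have cG := continuousOn_norm_sliceFDeriv_sq hT hu (by norm_num : (1 : WithTop ℕ∞) ≤ 2)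
  have ce : Continuous fun z : ℝ × E => Real.exp (2 * b * ‖z.2‖ ^ 2) :=
    Real.continuous_exp.comp (continuous_const.mul (continuous_snd.norm.pow 2))
  have iL : IntegrableOn (fun x : E => (2 * GS (T₀, x) + 2 * (Cψ / r₁ ^ 2) * ‖u T₀ x‖ ^ 2) * Real.exp (g (T₀, x))) AN :=
    integrableOn_slab_slice (Φ := fun z : ℝ × E => (2 * GS z + 2 * (Cψ / r₁ ^ 2) * ‖u z.1 z.2‖ ^ 2) * Real.exp (g z))
      (((continuousOn_const.mul cGS).add (continuousOn_const.mul cu)).mul cw) hT₀c bAN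
  have iR : IntegrableOn (fun x : E => (6 + Cψ) * (Real.exp (2 * b * ‖x‖ ^ 2) *
      (T⁻¹ * ‖u T₀ x‖ ^ 2 + ‖fderiv ℝ (u T₀) x‖ ^ 2))) AN :=
    integrableOn_slab_slice (Φ := fun z : ℝ × E => (6 + Cψ) * (Real.exp (2 * b * ‖z.2‖ ^ 2) *
      (T⁻¹ * ‖u z.1 z.2‖ ^ 2 + ‖fderiv ℝ (u z.1) z.2‖ ^ 2)))
      (continuousOn_const.mul (ce.continuousOn.mul ((continuousOn_const.mul cu).add cG))) hT₀c bAN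
  have key : ∫ x in AN, (2 * GS (T₀, x) + 2 * (Cψ / r₁ ^ 2) * ‖u T₀ x‖ ^ 2) * Real.exp (g (T₀, x)) ≤
      ∫ x in AN, (6 + Cψ) * (Real.exp (2 * b * ‖x‖ ^ 2) * (T⁻¹ * ‖u T₀ x‖ ^ 2 + ‖fderiv ℝ (u T₀) x‖ ^ 2)) := by
    refine setIntegral_mono_on iL iR mAN fun x _ => ?_
    obtain ⟨hGop, hGSd, hGS0⟩ := GS_compare hGS (T₀, x)
    rw [hd3'] at hGSd
    have hgT : g (T₀, x) = b * ‖x‖ ^ 2 := by rw [hg]; simp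
    have hexp : Real.exp (g (T₀, x)) ≤ Real.exp (2 * b * ‖x‖ ^ 2) := by
      rw [hgT]
      exact Real.exp_le_exp.2 (by nlinarith [sq_nonneg ‖x‖, hb])
    have hB : 2 * GS (T₀, x) + 2 * (Cψ / r₁ ^ 2) * ‖u T₀ x‖ ^ 2 ≤
        (6 + Cψ) * (T⁻¹ * ‖u T₀ x‖ ^ 2 + ‖fderiv ℝ (u T₀) x‖ ^ 2) := by
      have h2 : 2 * (Cψ / r₁ ^ 2) ≤ Cψ * T⁻¹ := by
        rw [div_eq_mul_inv, show 2 * (Cψ * (r₁ ^ 2)⁻¹) = Cψ * (2 * (r₁ ^ 2)⁻¹) by ring]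
        refine mul_le_mul_of_nonneg_left ?_ hCψ
        rw [← div_eq_mul_inv, div_le_iff₀ hr2, inv_mul_eq_div, le_div_iff₀ hT]
        nlinarith
      have h3 := mul_le_mul_of_nonneg_right h2 (sq_nonneg ‖u T₀ x‖)
      have hT0 : 0 ≤ T⁻¹ := inv_nonneg.2 hT.le
      nlinarith [hGSd, mul_nonneg hCψ (sq_nonneg ‖fderiv ℝ (u T₀) x‖), mul_nonneg hT0 (sq_nonneg ‖u T₀ x‖)]
    have hBnn : 0 ≤ 2 * GS (T₀, x) + 2 * (Cψ / r₁ ^ 2) * ‖u T₀ x‖ ^ 2 := by positivity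
    calc (2 * GS (T₀, x) + 2 * (Cψ / r₁ ^ 2) * ‖u T₀ x‖ ^ 2) * Real.exp (g (T₀, x))
        ≤ ((6 + Cψ) * (T⁻¹ * ‖u T₀ x‖ ^ 2 + ‖fderiv ℝ (u T₀) x‖ ^ 2)) * Real.exp (2 * b * ‖x‖ ^ 2) :=
          mul_le_mul hB hexp (Real.exp_pos _).le (by positivity)
      _ = _ := by ring
  refine key.trans (le_of_eq ?_)
  rw [hφ, ← integral_const_mul]

set_option maxHeartbeats 800000 in
include ha hm hT hr₁ hr₁₂ hC₀ hbdef hαdef hT₀mem hr₁T hu hP hreg hg hΦ hANdef in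
/-- **Bottom term** (at `t = 0`: on the open truncated shell `|x|² = r² + z² < 2r₊²`, hence
`eᵍ ≤ e^{(5/2) r₊²/(C₀T)}` — Palasek prints `e^{3r₊²/(2C₀T)}`, which would need `|x| ≤ r₊` — and
`|F(0,·)| ≤ 12 r₊²/T²`):
`∫_{AN} |F(0,x)| |u(0,x)|² e^{g(0,x)} ≤ 12 (r₂²/T²) e^{(5/2) b r₂²} ∫_{AN} |u(0,x)|²`. [cite: Palasek2021, §4 (proof of Prop 9, last display)] -/
theorem cyl_bot_le (hd3 : Module.finrank ℝ E = 3) :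
    ∫ x in AN, |Φ (0, x)| * ‖u 0 x‖ ^ 2 * Real.exp (g (0, x)) ≤
      12 * (r₂ ^ 2 / T ^ 2) * Real.exp (5 / 2 * b * r₂ ^ 2) * ∫ x in AN, ‖u 0 x‖ ^ 2 := by
  obtain ⟨hb, hbT, -, -⟩ := b_facts hT hC₀ hbdef
  obtain ⟨-, mAN, bAN, -, -⟩ := cyl_sets' (PL := {y : E | 4 * r₁ ^ 2 < ‖y‖ ^ 2 - ⟪y, a⟫ ^ 2 ∧
    ‖y‖ ^ 2 - ⟪y, a⟫ ^ 2 < r₂ ^ 2 / 4 ∧ ⟪y, a⟫ ^ 2 < r₂ ^ 2 / 4}) rfl hANdef (r₁ := r₁) (r₂ := r₂) (a := a)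
  have hr₂ : 0 < r₂ := by linarith
  have hα : 0 ≤ α := by rw [hαdef]; positivity
  have hT₀ : 0 ≤ T₀ := by linarith [hT₀mem.1]
  have hT₀T : T₀ ≤ T := by linarith [hT₀mem.2]
  have h0c : (0 : ℝ) ∈ Icc 0 T := ⟨le_rfl, hT.le⟩
  have hd3' : (Module.finrank ℝ E : ℝ) = 3 := by exact_mod_cast hd3
  have cw := (continuous_exp_cylWeight (E := E) hm hP hg).continuousOn (s := Icc 0 T ×ˢ univ)
  have cu : ContinuousOn (fun z : ℝ × E => ‖u z.1 z.2‖ ^ 2) (Icc 0 T ×ˢ univ) := (hu.continuousOn.norm).pow 2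
  have cΦ : ContinuousOn Φ (Icc 0 T ×ˢ univ) := (contDiff_Phi_top (E := E) hm hP hΦ).continuous.continuousOn
  have iL : IntegrableOn (fun x : E => |Φ (0, x)| * ‖u 0 x‖ ^ 2 * Real.exp (g (0, x))) AN :=
    integrableOn_slab_slice (Φ := fun z : ℝ × E => |Φ z| * ‖u z.1 z.2‖ ^ 2 * Real.exp (g z))
      (((continuous_abs.comp_continuousOn cΦ).mul cu).mul cw) h0c bAN
  have iR : IntegrableOn (fun x : E => 12 * (r₂ ^ 2 / T ^ 2) * Real.exp (5 / 2 * b * r₂ ^ 2) * ‖u 0 x‖ ^ 2) AN :=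
    integrableOn_slab_slice (Φ := fun z : ℝ × E => 12 * (r₂ ^ 2 / T ^ 2) * Real.exp (5 / 2 * b * r₂ ^ 2) * ‖u z.1 z.2‖ ^ 2)
      (continuousOn_const.mul cu) h0c bAN
  rw [← integral_const_mul]
  refine setIntegral_mono_on iL iR mAN fun x hx => ?_
  rw [hANdef] at hx
  obtain ⟨hx1, hx2, hx3⟩ := hx
  have hmx : m (0, x) = ‖x‖ ^ 2 - ⟪x, a⟫ ^ 2 := cylSq_slice hm 0 x
  have hxr : r₁ ^ 2 / 4 < m (0, x) := by rw [hmx]; nlinarith [sq_nonneg r₁]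
  obtain ⟨hn, hs⟩ := sqrt_cylSq_region hr₁ hxr
  have hP0 : P (m (0, x)) = Real.sqrt (m (0, x)) := (hreg _ hxr).1
  -- `Φ(0, x)` from the region formula, `d = 3`
  have hΦ0 : Φ (0, x) = -α * Real.sqrt (m (0, x)) - (3 - 2 : ℝ) * α * (T₀ - 0) / Real.sqrt (m (0, x)) - 2 * b * 3 -
      (α * (T₀ - 0)) ^ 2 - 4 * b * (α * (T₀ - 0)) * Real.sqrt (m (0, x)) - 4 * b ^ 2 * ‖x‖ ^ 2 := by
    rw [← Fg_eq_Phi_region ha hm hP hg hr₁ hreg hΦ (z := ((0 : ℝ), x)) hxr,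
      (cylWeight_region_second ha hm hP hg hr₁ hreg (z := ((0 : ℝ), x)) hxr).2.2, hd3']
  have hgeq : g (0, x) = α * (T₀ - 0) * Real.sqrt (m (0, x)) + b * ‖x‖ ^ 2 := by
    rw [hg]
    show α * (T₀ - 0) * P (m (0, x)) + b * ‖x‖ ^ 2 = _
    rw [hP0]
  rw [hΦ0, hgeq]
  generalize Real.sqrt (m (0, x)) = ρ at hn hs
  rw [hmx] at hs
  have hxlo : r₁ ≤ ρ := (pow_le_pow_iff_left₀ hr₁.le hn.le two_ne_zero).1 (by nlinarith)
  have hxhi : ρ ≤ r₂ := (pow_le_pow_iff_left₀ hn.le hr₂.le two_ne_zero).1 (by nlinarith)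
  have hxsq : ‖x‖ ^ 2 ≤ 2 * r₂ ^ 2 := by nlinarith
  have hαT : α * T = 1 / 2 * b * r₂ := by rw [hαdef]; field_simp
  -- the weight at `t = 0`
  have hgup : α * (T₀ - 0) * ρ + b * ‖x‖ ^ 2 ≤ 5 / 2 * b * r₂ ^ 2 := by
    rw [sub_zero]
    have h1 : α * T₀ * ρ ≤ α * T * r₂ := mul_le_mul (mul_le_mul_of_nonneg_left hT₀T hα) hxhi hn.le (by positivity)
    have h2 : α * T * r₂ = 1 / 2 * b * r₂ ^ 2 := by rw [hαT]; ring
    have h3 : b * ‖x‖ ^ 2 ≤ b * (2 * r₂ ^ 2) := mul_le_mul_of_nonneg_left hxsq hb.le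
    linarith [h1, h2, h3]
  have hexp : Real.exp (α * (T₀ - 0) * ρ + b * ‖x‖ ^ 2) ≤ Real.exp (5 / 2 * b * r₂ ^ 2) := Real.exp_le_exp.2 hgup
  -- `|F(0, x)| ≤ 12 r₂²/T²`
  have hFabs : |-α * ρ - (3 - 2 : ℝ) * α * (T₀ - 0) / ρ - 2 * b * 3 - (α * (T₀ - 0)) ^ 2 -
      4 * b * (α * (T₀ - 0)) * ρ - 4 * b ^ 2 * ‖x‖ ^ 2| ≤ 12 * (r₂ ^ 2 / T ^ 2) := by
    rw [sub_zero]
    have t1 : 0 ≤ α * ρ := by positivity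
    have t2 : 0 ≤ (3 - 2 : ℝ) * α * T₀ / ρ := by positivity
    have t3 : 0 ≤ (α * T₀) ^ 2 := sq_nonneg _
    have t4 : 0 ≤ 4 * b * (α * T₀) * ρ := by positivity
    have t5 : 0 ≤ 4 * b ^ 2 * ‖x‖ ^ 2 := by positivity
    rw [abs_of_nonpos (by linarith [t1, t2, t3, t4, t5, hb.le])]
    -- each term against `r₂²/T²`
    have e1 : α * ρ ≤ 1 / 2 * (r₂ ^ 2 / T ^ 2) := by
      have h1 : α * ρ ≤ α * r₂ := mul_le_mul_of_nonneg_left hxhi hα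
      have h2 : α * r₂ = 1 / 2 * b * r₂ ^ 2 / T := by rw [hαdef]; field_simp
      have h3 : 1 / 2 * b * r₂ ^ 2 / T ≤ 1 / 2 * T⁻¹ * r₂ ^ 2 / T :=
        div_le_div_of_nonneg_right (mul_le_mul_of_nonneg_right
          (mul_le_mul_of_nonneg_left hbT (by norm_num)) (sq_nonneg _)) hT.le
      have h4 : 1 / 2 * T⁻¹ * r₂ ^ 2 / T = 1 / 2 * (r₂ ^ 2 / T ^ 2) := by field_simp
      linarith
    have e2 : (3 - 2 : ℝ) * α * T₀ / ρ ≤ 1 / 4 * (r₂ ^ 2 / T ^ 2) := by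
      have h1 : (3 - 2 : ℝ) * α * T₀ / ρ ≤ 2 * α * T / r₁ := by
        rw [div_le_div_iff₀ hn hr₁]
        have := mul_le_mul (mul_le_mul_of_nonneg_left hT₀T (by positivity : (0 : ℝ) ≤ 2 * α)) hxlo hr₁.le
          (by positivity)
        nlinarith [mul_nonneg (mul_nonneg hα hT₀) hr₁.le]
      have h2 : 2 * α * T / r₁ = b * r₂ / r₁ := by
        rw [show 2 * α * T = 2 * (α * T) by ring, hαT]
        ring
      have h3 : b * r₂ / r₁ ≤ b * r₂ ^ 2 / (20 * r₁ ^ 2) := by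
        rw [div_le_div_iff₀ hr₁ (by positivity)]
        have := mul_le_mul_of_nonneg_left hr₁₂ (by positivity : (0 : ℝ) ≤ b * r₂ * r₁)
        linarith
      have h4 : b * r₂ ^ 2 / (20 * r₁ ^ 2) ≤ T⁻¹ * r₂ ^ 2 / (20 * (4 * T)) := by
        have hC₀T : 4 * T ≤ r₁ ^ 2 := by nlinarith
        calc b * r₂ ^ 2 / (20 * r₁ ^ 2) ≤ T⁻¹ * r₂ ^ 2 / (20 * r₁ ^ 2) :=
              div_le_div_of_nonneg_right (mul_le_mul_of_nonneg_right hbT (sq_nonneg _)) (by positivity)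
          _ ≤ T⁻¹ * r₂ ^ 2 / (20 * (4 * T)) :=
              div_le_div_of_nonneg_left (by positivity) (by positivity) (by linarith)
      have h5 : T⁻¹ * r₂ ^ 2 / (20 * (4 * T)) = 1 / 80 * (r₂ ^ 2 / T ^ 2) := by field_simp; ring
      have h6 : 0 ≤ r₂ ^ 2 / T ^ 2 := by positivity
      linarith
    have e3 : 2 * b * 3 ≤ 1 * (r₂ ^ 2 / T ^ 2) := by
      have h1 : r₂ ^ 2 ≥ 1600 * T := by nlinarith
      have h2 : 6 * T⁻¹ ≤ r₂ ^ 2 / T ^ 2 := by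
        rw [le_div_iff₀ (by positivity), show 6 * T⁻¹ * T ^ 2 = 6 * T by field_simp]
        linarith
      have h3 : 2 * b * 3 ≤ 6 * T⁻¹ := by linarith
      linarith
    have hbTr : b * r₂ ≤ T⁻¹ * r₂ := mul_le_mul_of_nonneg_right hbT hr₂.le
    have e4 : (α * T₀) ^ 2 ≤ 1 / 4 * (r₂ ^ 2 / T ^ 2) := by
      have h1 : α * T₀ ≤ 1 / 2 * b * r₂ := by nlinarith [mul_le_mul_of_nonneg_left hT₀T hα]
      have h2 : α * T₀ ≤ 1 / 2 * T⁻¹ * r₂ := by linarith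
      have h3 : (α * T₀) ^ 2 ≤ (1 / 2 * T⁻¹ * r₂) ^ 2 := pow_le_pow_left₀ (by positivity) h2 2
      have h4 : (1 / 2 * T⁻¹ * r₂) ^ 2 = 1 / 4 * (r₂ ^ 2 / T ^ 2) := by field_simp; ring
      linarith
    have e5 : 4 * b * (α * T₀) * ρ ≤ 2 * (r₂ ^ 2 / T ^ 2) := by
      have h1 : α * T₀ ≤ 1 / 2 * b * r₂ := by nlinarith [mul_le_mul_of_nonneg_left hT₀T hα]
      have h2 : 4 * b * (α * T₀) * ρ ≤ 4 * b * (1 / 2 * b * r₂) * r₂ :=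
        mul_le_mul (mul_le_mul_of_nonneg_left h1 (by positivity)) hxhi hn.le (by positivity)
      have h3 : 4 * b * (1 / 2 * b * r₂) * r₂ = 2 * (b * r₂) ^ 2 := by ring
      have h4 : (b * r₂) ^ 2 ≤ (T⁻¹ * r₂) ^ 2 := pow_le_pow_left₀ (by positivity) hbTr 2
      have h5 : (T⁻¹ * r₂) ^ 2 = r₂ ^ 2 / T ^ 2 := by field_simp
      linarith
    have e6 : 4 * b ^ 2 * ‖x‖ ^ 2 ≤ 8 * (r₂ ^ 2 / T ^ 2) := by
      have h1 : 4 * b ^ 2 * ‖x‖ ^ 2 ≤ 4 * b ^ 2 * (2 * r₂ ^ 2) := mul_le_mul_of_nonneg_left hxsq (by positivity)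
      have h2 : 4 * b ^ 2 * (2 * r₂ ^ 2) = 8 * (b * r₂) ^ 2 := by ring
      have h4 : (b * r₂) ^ 2 ≤ (T⁻¹ * r₂) ^ 2 := pow_le_pow_left₀ (by positivity) hbTr 2
      have h5 : (T⁻¹ * r₂) ^ 2 = r₂ ^ 2 / T ^ 2 := by field_simp
      linarith
    linarith [e1, e2, e3, e4, e5, e6]
  have hw := (Real.exp_pos (α * (T₀ - 0) * ρ + b * ‖x‖ ^ 2)).le
  calc |-α * ρ - (3 - 2 : ℝ) * α * (T₀ - 0) / ρ - 2 * b * 3 - (α * (T₀ - 0)) ^ 2 -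
        4 * b * (α * (T₀ - 0)) * ρ - 4 * b ^ 2 * ‖x‖ ^ 2| * ‖u 0 x‖ ^ 2 * Real.exp (α * (T₀ - 0) * ρ + b * ‖x‖ ^ 2)
      ≤ 12 * (r₂ ^ 2 / T ^ 2) * ‖u 0 x‖ ^ 2 * Real.exp (5 / 2 * b * r₂ ^ 2) :=
        mul_le_mul (mul_le_mul_of_nonneg_right hFabs (sq_nonneg _)) hexp hw (by positivity)
    _ = _ := by ring

end Terms

/-! ### The third coefficient (pure real arithmetic) -/

section Coef

omit [NormedAddCommGroup E] [InnerProductSpace ℝ E]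

/-- Third coefficient, cylindrical version: `(C₀/(3b)) e^{−(5/2)a} · (6 (r²/T²) e^{(5/2) b r²}) ≤
4 C₀³ e^{−a/2} e^{3 b r²}` when `bT = C₀⁻¹`, `a ≥ 0` (the bound `(r²/T) e^{−b r²/2} ≤ 2C₀`). [folklore] -/
theorem coef_cyl_three {C₀ b a r T : ℝ} (hb : 0 < b) (hT : 0 < T) (hC₀ : 0 < C₀) (hbT : b * T = C₀⁻¹) (ha : 0 ≤ a) :
    C₀ / (3 * b) * Real.exp (-(5 / 2 * a)) * (6 * (r ^ 2 / T ^ 2) * Real.exp (5 / 2 * b * r ^ 2)) ≤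
      4 * C₀ ^ 3 * Real.exp (-(1 / 2 * a)) * Real.exp (3 * b * r ^ 2) := by
  have hbTinv : 1 / (b * T) = C₀ := by rw [hbT, one_div, inv_inv]
  -- `(r²/T) e^{−b r²/2} ≤ 2 C₀`
  have hkey : r ^ 2 / T * Real.exp (-(1 / 2 * b * r ^ 2)) ≤ 2 * C₀ := by
    have h1 : 1 / 2 * b * r ^ 2 * Real.exp (-(1 / 2 * b * r ^ 2)) ≤ 1 := by
      have h := Real.add_one_le_exp (1 / 2 * b * r ^ 2)
      rw [Real.exp_neg, mul_inv_le_iff₀ (Real.exp_pos _)]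
      linarith
    have h2 : r ^ 2 / T = 2 * C₀ * (1 / 2 * b * r ^ 2) := by
      rw [← hbTinv]
      field_simp
    rw [h2, mul_assoc]
    nlinarith
  have e : C₀ / (3 * b) * Real.exp (-(5 / 2 * a)) * (6 * (r ^ 2 / T ^ 2) * Real.exp (5 / 2 * b * r ^ 2)) =
      2 * C₀ ^ 2 * (r ^ 2 / T * Real.exp (-(1 / 2 * b * r ^ 2))) * (Real.exp (-(5 / 2 * a)) * Real.exp (3 * b * r ^ 2)) := by
    have h1 : Real.exp (5 / 2 * b * r ^ 2) = Real.exp (-(1 / 2 * b * r ^ 2)) * Real.exp (3 * b * r ^ 2) := by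
      rw [← Real.exp_add]
      congr 1
      ring
    have h2 : C₀ / (3 * b) * (6 * (r ^ 2 / T ^ 2)) = 2 * (C₀ * (1 / (b * T))) * (r ^ 2 / T) := by field_simp; ring
    calc C₀ / (3 * b) * Real.exp (-(5 / 2 * a)) * (6 * (r ^ 2 / T ^ 2) * Real.exp (5 / 2 * b * r ^ 2))
        = C₀ / (3 * b) * (6 * (r ^ 2 / T ^ 2)) * (Real.exp (-(5 / 2 * a)) * Real.exp (5 / 2 * b * r ^ 2)) := by ring
      _ = _ := by rw [h2, hbTinv, h1]; ring
  rw [e]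
  have h3 : Real.exp (-(5 / 2 * a)) * Real.exp (3 * b * r ^ 2) ≤ Real.exp (-(1 / 2 * a)) * Real.exp (3 * b * r ^ 2) :=
    mul_le_mul_of_nonneg_right (Real.exp_le_exp.2 (by linarith)) (Real.exp_pos _).le
  calc 2 * C₀ ^ 2 * (r ^ 2 / T * Real.exp (-(1 / 2 * b * r ^ 2))) * (Real.exp (-(5 / 2 * a)) * Real.exp (3 * b * r ^ 2))
      ≤ 2 * C₀ ^ 2 * (2 * C₀) * (Real.exp (-(1 / 2 * a)) * Real.exp (3 * b * r ^ 2)) :=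
        mul_le_mul (mul_le_mul_of_nonneg_left hkey (by positivity)) h3 (by positivity) (by positivity)
    _ = _ := by ring

end Coef

/-! ### Prop 9 -/

section Main

variable [FiniteDimensional ℝ E] [MeasurableSpace E] [BorelSpace E]
variable {F : Type*} [NormedAddCommGroup F] [InnerProductSpace ℝ F]

set_option maxHeartbeats 1600000 in
/-- **The analytic part of Prop 9**: for the pigeonholed `T₀ ∈ [T/2, 3T/4]` with
`φ♯(T₀) ≤ (4/T) X`, the core inequality and the weight bounds give
`(3b/C₀) e^{(5/2)αTr₋} · LHS ≤ ½ · 3b C_sh e^{2αTr₋} X + (6 + C)(4/T) X + ½ · 12 (r₊²/T²) e^{(5/2) b r₊²} Y`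
(`b = (C₀T)⁻¹`, `α = b r₊/(2T)`). [cite: Palasek2021, §4 (proof of Prop 9)] -/
theorem cyl_carleman_assembled (hd3 : Module.finrank ℝ E = 3) {a : E} (ha : ‖a‖ = 1) {Cψ : ℝ} (hCψ : 0 ≤ Cψ)
    {ψ : ℝ × E → ℝ} {T C₀ r₁ r₂ T₀ b α : ℝ} {u : ℝ → E → F} {P : ℝ → ℝ} {m : ℝ × E → ℝ}
    (hm : m = fun y : ℝ × E => ‖y.2‖ ^ 2 - ⟪y.2, a⟫ ^ 2)
    (hT : 0 < T) (hr₁ : 0 < r₁) (hr₁₂ : 20 * r₁ ≤ r₂) (hC₀ : 1 ≤ C₀) (hbdef : b = (C₀ * T)⁻¹)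
    (hαdef : α = b * r₂ / (2 * T)) (hT₀mem : T₀ ∈ Icc (T / 2) (3 * T / 4)) (hr₁T : 4 * C₀ * T ≤ r₁ ^ 2)
    (hu : ContDiffOn ℝ 2 (uncurry u) (Icc 0 T ×ˢ univ))
    (hL : ∀ t ∈ Ioo 0 T, ∀ x : E, r₁ ^ 2 ≤ ‖x‖ ^ 2 - ⟪x, a⟫ ^ 2 → ‖x‖ ^ 2 - ⟪x, a⟫ ^ 2 ≤ r₂ ^ 2 → ⟪x, a⟫ ^ 2 ≤ r₂ ^ 2 →
      ‖FluidPDE.timeDeriv u t x + Δ (u t) x‖ ≤ b * ‖u t x‖ + Real.sqrt b * ‖fderiv ℝ (u t) x‖)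
    (hψs : ContDiff ℝ (⊤ : ℕ∞) ψ)
    (hψnn : ∀ z, 0 ≤ ψ z) (hψle : ∀ z, ψ z ≤ 1) (hψt : ∀ z, dt ψ z = 0)
    (hψ1 : ∀ z : ℝ × E, 4 * r₁ ^ 2 ≤ m z → m z ≤ r₂ ^ 2 / 4 → ⟪z.2, a⟫ ^ 2 ≤ r₂ ^ 2 / 4 → ψ z = 1)
    (hψ0 : ∀ z : ℝ × E, m z ≤ 36 / 25 * r₁ ^ 2 ∨ 81 / 100 * r₂ ^ 2 ≤ m z ∨ 9 / 25 * r₂ ^ 2 ≤ ⟪z.2, a⟫ ^ 2 → ψ z = 0)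
    (hψd0 : ∀ z : ℝ × E, (m z < 36 / 25 * r₁ ^ 2 ∨ 81 / 100 * r₂ ^ 2 < m z ∨ 9 / 25 * r₂ ^ 2 < ⟪z.2, a⟫ ^ 2 ∨
        (4 * r₁ ^ 2 < m z ∧ m z < r₂ ^ 2 / 4 ∧ ⟪z.2, a⟫ ^ 2 < r₂ ^ 2 / 4)) → (∀ e, dx e ψ z = 0) ∧ lap ψ z = 0)
    (hψg : ∀ z, gradSq ψ z ≤ Cψ / r₁ ^ 2) (hψl : ∀ z, |lap ψ z| ≤ Cψ / r₁ ^ 2)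
    (hP : ContDiff ℝ (⊤ : ℕ∞) P)
    (hreg : ∀ s, r₁ ^ 2 / 4 < s → P s = Real.sqrt s ∧ deriv P s = 1 / (2 * Real.sqrt s) ∧
      deriv (deriv P) s = -1 / (4 * s * Real.sqrt s) ∧ deriv (deriv (deriv P)) s = 3 / (8 * s ^ 2 * Real.sqrt s))
    (hφT₀ : ∫ x in {y : E | r₁ ^ 2 < ‖y‖ ^ 2 - ⟪y, a⟫ ^ 2 ∧ ‖y‖ ^ 2 - ⟪y, a⟫ ^ 2 < r₂ ^ 2 ∧ ⟪y, a⟫ ^ 2 < r₂ ^ 2},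
        Real.exp (2 * b * ‖x‖ ^ 2) * (T⁻¹ * ‖u T₀ x‖ ^ 2 + ‖fderiv ℝ (u T₀) x‖ ^ 2) ≤
      4 / T * ∫ t in (0 : ℝ)..T, ∫ x in {y : E | r₁ ^ 2 < ‖y‖ ^ 2 - ⟪y, a⟫ ^ 2 ∧ ‖y‖ ^ 2 - ⟪y, a⟫ ^ 2 < r₂ ^ 2 ∧
          ⟪y, a⟫ ^ 2 < r₂ ^ 2},
        Real.exp (2 * b * ‖x‖ ^ 2) * (T⁻¹ * ‖u t x‖ ^ 2 + ‖fderiv ℝ (u t) x‖ ^ 2)) :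
    3 * b / C₀ * Real.exp (5 / 2 * α * T * r₁) *
        ∫ t in (0 : ℝ)..T / 4, ∫ x in {y : E | 100 * r₁ ^ 2 < ‖y‖ ^ 2 - ⟪y, a⟫ ^ 2 ∧
            ‖y‖ ^ 2 - ⟪y, a⟫ ^ 2 < r₂ ^ 2 / 4 ∧ ⟪y, a⟫ ^ 2 < r₂ ^ 2 / 4},
          (T⁻¹ * ‖u t x‖ ^ 2 + ‖fderiv ℝ (u t) x‖ ^ 2) ≤
      1 / 2 * (3 * b * (4 * (1 + Cψ) ^ 2) * Real.exp (2 * α * T * r₁)) *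
          (∫ t in (0 : ℝ)..T, ∫ x in {y : E | r₁ ^ 2 < ‖y‖ ^ 2 - ⟪y, a⟫ ^ 2 ∧ ‖y‖ ^ 2 - ⟪y, a⟫ ^ 2 < r₂ ^ 2 ∧
              ⟪y, a⟫ ^ 2 < r₂ ^ 2},
            Real.exp (2 * b * ‖x‖ ^ 2) * (T⁻¹ * ‖u t x‖ ^ 2 + ‖fderiv ℝ (u t) x‖ ^ 2)) +
        (6 + Cψ) * (4 / T) *
          (∫ t in (0 : ℝ)..T, ∫ x in {y : E | r₁ ^ 2 < ‖y‖ ^ 2 - ⟪y, a⟫ ^ 2 ∧ ‖y‖ ^ 2 - ⟪y, a⟫ ^ 2 < r₂ ^ 2 ∧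
              ⟪y, a⟫ ^ 2 < r₂ ^ 2},
            Real.exp (2 * b * ‖x‖ ^ 2) * (T⁻¹ * ‖u t x‖ ^ 2 + ‖fderiv ℝ (u t) x‖ ^ 2)) +
        1 / 2 * (12 * (r₂ ^ 2 / T ^ 2) * Real.exp (5 / 2 * b * r₂ ^ 2)) *
          ∫ x in {y : E | r₁ ^ 2 < ‖y‖ ^ 2 - ⟪y, a⟫ ^ 2 ∧ ‖y‖ ^ 2 - ⟪y, a⟫ ^ 2 < r₂ ^ 2 ∧ ⟪y, a⟫ ^ 2 < r₂ ^ 2},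
            ‖u 0 x‖ ^ 2 := by
  obtain ⟨hb, hbT, hbTC, hC⟩ := b_facts hT hC₀ hbdef
  -- the named sets
  obtain ⟨PL, hPLdef⟩ : ∃ PL : Set E, PL = {y : E | 4 * r₁ ^ 2 < ‖y‖ ^ 2 - ⟪y, a⟫ ^ 2 ∧
      ‖y‖ ^ 2 - ⟪y, a⟫ ^ 2 < r₂ ^ 2 / 4 ∧ ⟪y, a⟫ ^ 2 < r₂ ^ 2 / 4} := ⟨_, rfl⟩
  obtain ⟨AN, hANdef⟩ : ∃ AN : Set E, AN = {y : E | r₁ ^ 2 < ‖y‖ ^ 2 - ⟪y, a⟫ ^ 2 ∧ ‖y‖ ^ 2 - ⟪y, a⟫ ^ 2 < r₂ ^ 2 ∧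
      ⟪y, a⟫ ^ 2 < r₂ ^ 2} := ⟨_, rfl⟩
  rw [← hANdef] at hφT₀ ⊢
  obtain ⟨mPL, mAN, bAN, hPLAN, -⟩ := cyl_sets' hPLdef hANdef (r₁ := r₁) (r₂ := r₂) (a := a)
  have hr₂ : 0 < r₂ := by linarith
  have hα : 0 ≤ α := by rw [hαdef]; positivity
  have hT₀ : 0 < T₀ := by linarith [hT₀mem.1]
  have hT₀T : T₀ < T := by linarith [hT₀mem.2]
  have hr₁₂' : 8 * r₁ ≤ r₂ := by linarith
  -- the side conditions of the core inequality
  have hbr : 4 ≤ b * r₁ ^ 2 := by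
    rw [hbdef, ← div_eq_inv_mul, le_div_iff₀ (by positivity)]
    linarith
  have h4T : 4 * T ≤ r₁ ^ 2 := by nlinarith
  have hαr : 40 * b ≤ α * r₁ := by
    rw [hαdef]
    have h1 : 80 * T ≤ r₂ * r₁ := by nlinarith
    have h2 : b * r₂ / (2 * T) * r₁ = b * (r₂ * r₁) / (2 * T) := by ring
    rw [h2, le_div_iff₀ (by positivity)]
    nlinarith [mul_le_mul_of_nonneg_left h1 hb.le]
  -- the weight and the auxiliary functions
  obtain ⟨g, hg⟩ : ∃ g : ℝ × E → ℝ, g = fun z : ℝ × E => α * (T₀ - z.1) * P (m z) + b * ‖z.2‖ ^ 2 := ⟨_, rfl⟩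
  obtain ⟨Φ, hΦ⟩ : ∃ Φ : ℝ × E → ℝ, Φ = fun z : ℝ × E => -(α + 4 * b * α * (T₀ - z.1)) * P (m z) +
      -(2 * ((Module.finrank ℝ E : ℝ) - 2) * α * (T₀ - z.1)) * deriv P (m z) +
      (-(2 * b * (Module.finrank ℝ E : ℝ)) - (α * (T₀ - z.1)) ^ 2) + -(4 * b ^ 2) * ‖z.2‖ ^ 2 := ⟨_, rfl⟩
  obtain ⟨GS, hGS⟩ : ∃ GS : ℝ × E → ℝ, GS = fun z : ℝ × E =>
      ∑ i, ‖fderiv ℝ (u z.1) z.2 (stdOrthonormalBasis ℝ E i)‖ ^ 2 := ⟨_, rfl⟩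
  obtain ⟨GW, hGW⟩ : ∃ GW : ℝ × E → ℝ, GW = fun z : ℝ × E => ∑ i, ‖ψ z • fderiv ℝ (u z.1) z.2
      (stdOrthonormalBasis ℝ E i) + dx (stdOrthonormalBasis ℝ E i) ψ z • u z.1 z.2‖ ^ 2 := ⟨_, rfl⟩
  obtain ⟨Eb, hEb⟩ : ∃ Eb : ℝ → ℝ, Eb = fun t => ∫ x, (GW (t, x) + 1 / 2 * Φ (t, x) * ‖ψ (t, x) • u t x‖ ^ 2) *
      Real.exp (g (t, x)) := ⟨_, rfl⟩
  obtain ⟨Qp, hQp⟩ : ∃ Qp : ℝ → ℝ, Qp = fun t => ∫ x, (28 * b ^ 2 * ‖ψ (t, x) • u t x‖ ^ 2 + 4 * b * GW (t, x)) *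
      Real.exp (g (t, x)) := ⟨_, rfl⟩
  obtain ⟨Pin, hPin⟩ : ∃ Pin : ℝ → ℝ, Pin = fun t => ∫ x in PL,
      2 * (b ^ 2 * ‖u t x‖ ^ 2 + b * GS (t, x)) * Real.exp (g (t, x)) := ⟨_, rfl⟩
  obtain ⟨Psh, hPsh⟩ : ∃ Psh : ℝ → ℝ, Psh = fun t => ∫ x in AN \ PL,
      4 * (1 + Cψ) ^ 2 * (b ^ 2 * ‖u t x‖ ^ 2 + b * GS (t, x)) * Real.exp (g (t, x)) := ⟨_, rfl⟩
  obtain ⟨Iin, hIin⟩ : ∃ Iin : ℝ → ℝ, Iin = fun t => ∫ x in PL,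
      (27 * b ^ 2 * ‖u t x‖ ^ 2 + 3 * b * GS (t, x)) * Real.exp (g (t, x)) := ⟨_, rfl⟩
  obtain ⟨φ, hφ⟩ : ∃ φ : ℝ → ℝ, φ = fun t => ∫ x in AN,
      Real.exp (2 * b * ‖x‖ ^ 2) * (T⁻¹ * ‖u t x‖ ^ 2 + ‖fderiv ℝ (u t) x‖ ^ 2) := ⟨_, rfl⟩
  obtain ⟨Z, hZ⟩ : ∃ Z : ℝ → ℝ, Z = fun t => ∫ x in {y : E | 100 * r₁ ^ 2 < ‖y‖ ^ 2 - ⟪y, a⟫ ^ 2 ∧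
      ‖y‖ ^ 2 - ⟪y, a⟫ ^ 2 < r₂ ^ 2 / 4 ∧ ⟪y, a⟫ ^ 2 < r₂ ^ 2 / 4},
      (T⁻¹ * ‖u t x‖ ^ 2 + ‖fderiv ℝ (u t) x‖ ^ 2) := ⟨_, rfl⟩
  -- the core inequality
  have core := core_cyl_carleman (E := E) (F := F) ha hm hT hr₁ hr₁₂' hb hα hT₀ hT₀T hd3 hu hψs hψnn hψle hψt hψ1 hψ0
    hψd0 hψg hψl hP hreg hg hΦ (W := fun z => ψ z • uncurry u z) rfl hGS hGW hPLdef hANdef hEb hQp hPin hPsh hIin hCψ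
    hbr h4T hαr hL
  -- continuity and signs
  obtain ⟨cφ, hφ0⟩ := continuousOn_cylPhiSharp hT hu hANdef hφ (r₁ := r₁) (r₂ := r₂) (b := b)
  obtain ⟨cPin, cPsh, cIin⟩ := cyl_continuousOn_P hm hT hu hP hg hGS hPLdef hANdef hPin hPsh hIin (Cψ := Cψ) (b := b)
  have hIin0 : ∀ t, 0 ≤ Iin t := fun t => by
    rw [hIin]
    refine setIntegral_nonneg mPL fun x _ => ?_
    have := (GS_compare hGS (t, x)).2.2
    positivity
  have hcM : Continuous fun y : E => ‖y‖ ^ 2 - ⟪y, a⟫ ^ 2 :=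
    (continuous_norm.pow 2).sub ((continuous_id.inner continuous_const).pow 2)
  have hcZ : Continuous fun y : E => ⟪y, a⟫ ^ 2 := (continuous_id.inner continuous_const).pow 2
  have mL : MeasurableSet {y : E | 100 * r₁ ^ 2 < ‖y‖ ^ 2 - ⟪y, a⟫ ^ 2 ∧ ‖y‖ ^ 2 - ⟪y, a⟫ ^ 2 < r₂ ^ 2 / 4 ∧
      ⟪y, a⟫ ^ 2 < r₂ ^ 2 / 4} :=
    ((isOpen_lt continuous_const hcM).inter ((isOpen_lt hcM continuous_const).inter
      (isOpen_lt hcZ continuous_const))).measurableSet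
  have hLsub : {y : E | 100 * r₁ ^ 2 < ‖y‖ ^ 2 - ⟪y, a⟫ ^ 2 ∧ ‖y‖ ^ 2 - ⟪y, a⟫ ^ 2 < r₂ ^ 2 / 4 ∧
      ⟪y, a⟫ ^ 2 < r₂ ^ 2 / 4} ⊆ AN := fun y hy => by
    rw [hANdef]
    exact ⟨by nlinarith [hy.1, sq_nonneg r₁], by nlinarith [hy.2.1, sq_nonneg r₂], by nlinarith [hy.2.2, sq_nonneg r₂]⟩
  have cZ : ContinuousOn Z (Icc 0 T) := by
    have c : ContinuousOn (fun z : ℝ × E => T⁻¹ * ‖u z.1 z.2‖ ^ 2 + ‖fderiv ℝ (u z.1) z.2‖ ^ 2) (Icc 0 T ×ˢ univ) :=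
      (continuousOn_const.mul ((hu.continuousOn.norm).pow 2)).add (continuousOn_norm_sliceFDeriv_sq hT hu (by norm_num))
    rw [hZ]
    exact continuousOn_setIntegral_slice mL (bAN.subset hLsub) (c.mono (prod_mono Subset.rfl (subset_univ _)))
  -- (L) the left-hand side
  have hT4 : T / 4 ≤ T₀ := by linarith [hT₀mem.1]
  have hL1 : 3 * b / C₀ * Real.exp (5 / 2 * α * T * r₁) * ∫ t in (0 : ℝ)..T / 4, Z t ≤ ∫ t in (0 : ℝ)..T₀, Iin t := by
    have step1 : ∫ t in (0 : ℝ)..T / 4, 3 * b / C₀ * Real.exp (5 / 2 * α * T * r₁) * Z t ≤ ∫ t in (0 : ℝ)..T / 4, Iin t := by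
      refine intervalIntegral.integral_mono_on (by positivity)
        (((cZ.mono (Icc_subset_Icc_right (by linarith))).intervalIntegrable_of_Icc (by positivity)).const_mul _)
        ((cIin.mono (Icc_subset_Icc_right (by linarith))).intervalIntegrable_of_Icc (by positivity)) fun t ht => ?_
      have := cyl_Iin_lower hm hT hr₁ hr₁₂ hC₀ hbdef hαdef hT₀mem hu hGS hP hreg hg hPLdef hANdef ht
      rw [hZ, hIin]
      exact this
    have step2 : ∫ t in (0 : ℝ)..T / 4, Iin t ≤ ∫ t in (0 : ℝ)..T₀, Iin t :=
      intervalIntegral.integral_mono_interval le_rfl (by positivity) hT4 (Eventually.of_forall fun t => hIin0 t)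
        ((cIin.mono (Icc_subset_Icc_right hT₀T.le)).intervalIntegrable_of_Icc hT₀.le)
    rw [intervalIntegral.integral_const_mul] at step1
    exact step1.trans step2
  -- (U1) the shell term
  have hU1 : ∫ t in (0 : ℝ)..T₀, Psh t ≤ 3 * b * (4 * (1 + Cψ) ^ 2) * Real.exp (2 * α * T * r₁) * ∫ t in (0 : ℝ)..T, φ t := by
    have step1 : ∫ t in (0 : ℝ)..T₀, Psh t ≤ ∫ t in (0 : ℝ)..T₀, 3 * b * (4 * (1 + Cψ) ^ 2) * Real.exp (2 * α * T * r₁) * φ t := by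
      refine intervalIntegral.integral_mono_on hT₀.le ((cPsh.mono (Icc_subset_Icc_right hT₀T.le)).intervalIntegrable_of_Icc hT₀.le)
        (((cφ.mono (Icc_subset_Icc_right hT₀T.le)).intervalIntegrable_of_Icc hT₀.le).const_mul _) fun t ht => ?_
      have := cyl_Psh_le hm hT hr₁ hr₁₂ hC₀ hbdef hαdef hT₀mem hu hGS hP hreg hg hPLdef hANdef hφ hd3 hCψ ht
      rw [hPsh]
      exact this
    refine step1.trans ?_
    rw [intervalIntegral.integral_const_mul]
    refine mul_le_mul_of_nonneg_left ?_ (by positivity)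
    exact intervalIntegral.integral_mono_interval le_rfl hT₀.le hT₀T.le (Eventually.of_forall fun t => hφ0 t)
      (cφ.intervalIntegrable_of_Icc hT.le)
  -- (U2) the top term
  have hU2 : ∫ x in AN, (2 * GS (T₀, x) + 2 * (Cψ / r₁ ^ 2) * ‖u T₀ x‖ ^ 2) * Real.exp (g (T₀, x)) ≤
      (6 + Cψ) * (4 / T) * ∫ t in (0 : ℝ)..T, φ t := by
    have htop := cyl_top_le hm hT hr₁ hC₀ hbdef hT₀mem hr₁T hu hGS hP hg hANdef hφ hd3 hCψ (r₂ := r₂) (α := α)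
    have hφT₀' : φ T₀ ≤ 4 / T * ∫ t in (0 : ℝ)..T, φ t := by rw [hφ]; exact hφT₀
    have := mul_le_mul_of_nonneg_left hφT₀' (by positivity : (0 : ℝ) ≤ 6 + Cψ)
    linarith
  -- (U3) the bottom term
  have hU3 := cyl_bot_le ha hm hT hr₁ hr₁₂ hC₀ hbdef hαdef hT₀mem hr₁T hu hP hreg hg hΦ hANdef hd3 (F := F)
  -- assemble
  have hXdef : (∫ t in (0 : ℝ)..T, ∫ x in AN,
      Real.exp (2 * b * ‖x‖ ^ 2) * (T⁻¹ * ‖u t x‖ ^ 2 + ‖fderiv ℝ (u t) x‖ ^ 2)) = ∫ t in (0 : ℝ)..T, φ t := by rw [hφ]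
  have hZdef : (∫ t in (0 : ℝ)..T / 4, ∫ x in {y : E | 100 * r₁ ^ 2 < ‖y‖ ^ 2 - ⟪y, a⟫ ^ 2 ∧
      ‖y‖ ^ 2 - ⟪y, a⟫ ^ 2 < r₂ ^ 2 / 4 ∧ ⟪y, a⟫ ^ 2 < r₂ ^ 2 / 4},
      (T⁻¹ * ‖u t x‖ ^ 2 + ‖fderiv ℝ (u t) x‖ ^ 2)) = ∫ t in (0 : ℝ)..T / 4, Z t := by rw [hZ]
  rw [hXdef, hZdef]
  have hpos : 0 ≤ 12 * (r₂ ^ 2 / T ^ 2) * Real.exp (5 / 2 * b * r₂ ^ 2) := by positivity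
  linarith [hL1, core, hU1, hU2, hU3]

set_option maxHeartbeats 800000 in
/-- **Palasek 2021, Prop 9 (backward-uniqueness Carleman estimate in truncated cylindrical shells;
`d₁ = 2`, `d₂ = 1`).** In dimension `3` there is `K > 0` (depending only on `E`) such that: for every
unit vector `a` (the axis; `r² = |x|² − ⟪x,a⟫²`, `z = ⟪x,a⟫`), `T > 0`, `C₀ ≥ 1`, `0 < r₋ < r₊` with
`r₋² ≥ 4C₀T`, and `u : [0,T] × E → F` with `uncurry u` of class `C²` on the closed slab obeying the
differential inequality `|∂ₜu + Δu| ≤ (C₀T)⁻¹|u| + (C₀T)^{-1/2}|∇u|` on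
`]0,T[ × {r₋ ≤ r ≤ r₊, |z| ≤ r₊}` (Palasek's `𝒞`),
`∫₀^{T/4} ∫_{10r₋ < r < r₊/2, |z| < r₊/2} (T⁻¹|u|² + |∇u|²) dx dt
  ≤ K C₀³ e^{−r₋r₊/(4C₀T)} ( X + e^{3r₊²/(C₀T)} Y )`,
`X = ∫₀ᵀ ∫_{𝒞°} e^{2|x|²/(C₀T)} (T⁻¹|u|² + |∇u|²)`, `Y = ∫_{𝒞°} |u(0,x)|²`, `𝒞° = {r₋ < r < r₊, |z| < r₊}`
(`|∇u|` the operator norm of `D(u t)(x)`; open regions, null-set changes). Printed: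
"`∫₀^{T/4}∫ (T⁻¹|u|² + |∇u|²) ≲ C₀ e^{−r₋r₊/(4C₀T)}(X + e^{2r₊²/(C₀T)}Y)`"; the tree's rendering keeps
track of the powers of `C₀` honestly (`K C₀³`, as for the annular `first_carleman_inequality`) and
records `e^{3r₊²/(C₀T)}` in front of `Y`: on the truncated shell `|x|² = r² + z² ≤ 2r₊²`, so that
`e^{g(0,x)} ≤ e^{(5/2)r₊²/(C₀T)}` (the printed `e^{3r₊²/(2C₀T)}` would need `|x| ≤ r₊`), which after
the absorption of `r₊²/T²` gives the exponent `3`; any `e^{O(r₊²/(C₀T))} = e^{O(A₆²)}` serves the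
application in Prop 11. [cite: Palasek2021, Prop 9 (§4, backward uniqueness Carleman estimate)] -/
theorem cyl_carleman_inequality (hd3 : Module.finrank ℝ E = 3) :
    ∃ K : ℝ, 0 < K ∧ ∀ (a : E), ‖a‖ = 1 → ∀ (T C₀ r₁ r₂ : ℝ) (u : ℝ → E → F),
      0 < T → 1 ≤ C₀ → 0 < r₁ → r₁ < r₂ → 4 * C₀ * T ≤ r₁ ^ 2 →
      ContDiffOn ℝ 2 (uncurry u) (Icc 0 T ×ˢ univ) →
      (∀ t ∈ Ioo 0 T, ∀ x : E, r₁ ^ 2 ≤ ‖x‖ ^ 2 - ⟪x, a⟫ ^ 2 → ‖x‖ ^ 2 - ⟪x, a⟫ ^ 2 ≤ r₂ ^ 2 → ⟪x, a⟫ ^ 2 ≤ r₂ ^ 2 →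
        ‖FluidPDE.timeDeriv u t x + Δ (u t) x‖ ≤
          (C₀ * T)⁻¹ * ‖u t x‖ + (Real.sqrt (C₀ * T))⁻¹ * ‖fderiv ℝ (u t) x‖) →
      ∫ t in (0 : ℝ)..T / 4, ∫ x in {y : E | 100 * r₁ ^ 2 < ‖y‖ ^ 2 - ⟪y, a⟫ ^ 2 ∧
            ‖y‖ ^ 2 - ⟪y, a⟫ ^ 2 < r₂ ^ 2 / 4 ∧ ⟪y, a⟫ ^ 2 < r₂ ^ 2 / 4},
          (T⁻¹ * ‖u t x‖ ^ 2 + ‖fderiv ℝ (u t) x‖ ^ 2) ≤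
        K * C₀ ^ 3 * Real.exp (-(r₁ * r₂) / (4 * C₀ * T)) *
          ((∫ t in (0 : ℝ)..T, ∫ x in {y : E | r₁ ^ 2 < ‖y‖ ^ 2 - ⟪y, a⟫ ^ 2 ∧ ‖y‖ ^ 2 - ⟪y, a⟫ ^ 2 < r₂ ^ 2 ∧
                ⟪y, a⟫ ^ 2 < r₂ ^ 2},
              Real.exp (2 * ‖x‖ ^ 2 / (C₀ * T)) * (T⁻¹ * ‖u t x‖ ^ 2 + ‖fderiv ℝ (u t) x‖ ^ 2)) +
            Real.exp (3 * r₂ ^ 2 / (C₀ * T)) *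
              ∫ x in {y : E | r₁ ^ 2 < ‖y‖ ^ 2 - ⟪y, a⟫ ^ 2 ∧ ‖y‖ ^ 2 - ⟪y, a⟫ ^ 2 < r₂ ^ 2 ∧ ⟪y, a⟫ ^ 2 < r₂ ^ 2},
                ‖u 0 x‖ ^ 2) := by
  obtain ⟨Cψ, hCψ, hcut⟩ := exists_cyl_cutoff E
  obtain ⟨K, hK⟩ : ∃ K : ℝ, K = 4 * (1 + Cψ) ^ 2 / 2 + 4 / 3 * (6 + Cψ) + 4 := ⟨_, rfl⟩
  have hKpos : 0 < K := by rw [hK]; positivity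
  refine ⟨K, hKpos, ?_⟩
  intro a ha T C₀ r₁ r₂ u hT hC₀ hr₁ hr₁₂ hr₁T hu hL
  have hC₀0 : 0 < C₀ := by linarith
  have hr₂ : 0 < r₂ := by linarith
  obtain ⟨-, mAN, -, -, -⟩ := cyl_sets a r₁ r₂ (E := E)
  -- `X, Y ≥ 0`
  set X : ℝ := ∫ t in (0 : ℝ)..T, ∫ x in {y : E | r₁ ^ 2 < ‖y‖ ^ 2 - ⟪y, a⟫ ^ 2 ∧ ‖y‖ ^ 2 - ⟪y, a⟫ ^ 2 < r₂ ^ 2 ∧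
      ⟪y, a⟫ ^ 2 < r₂ ^ 2},
    Real.exp (2 * ‖x‖ ^ 2 / (C₀ * T)) * (T⁻¹ * ‖u t x‖ ^ 2 + ‖fderiv ℝ (u t) x‖ ^ 2) with hX
  set Y : ℝ := ∫ x in {y : E | r₁ ^ 2 < ‖y‖ ^ 2 - ⟪y, a⟫ ^ 2 ∧ ‖y‖ ^ 2 - ⟪y, a⟫ ^ 2 < r₂ ^ 2 ∧ ⟪y, a⟫ ^ 2 < r₂ ^ 2},
    ‖u 0 x‖ ^ 2 with hY
  have hX0 : 0 ≤ X := intervalIntegral.integral_nonneg hT.le fun t _ =>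
    setIntegral_nonneg mAN fun x _ => by positivity
  have hY0 : 0 ≤ Y := setIntegral_nonneg mAN fun x _ => by positivity
  have hRHS0 : 0 ≤ K * C₀ ^ 3 * Real.exp (-(r₁ * r₂) / (4 * C₀ * T)) * (X + Real.exp (3 * r₂ ^ 2 / (C₀ * T)) * Y) := by
    positivity
  by_cases h20 : 20 * r₁ ≤ r₂
  swap
  · -- the final region is empty
    push Not at h20
    have hempty : {y : E | 100 * r₁ ^ 2 < ‖y‖ ^ 2 - ⟪y, a⟫ ^ 2 ∧ ‖y‖ ^ 2 - ⟪y, a⟫ ^ 2 < r₂ ^ 2 / 4 ∧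
        ⟪y, a⟫ ^ 2 < r₂ ^ 2 / 4} = ∅ := by
      ext y
      simp only [mem_setOf_eq, mem_empty_iff_false, iff_false, not_and, not_lt]
      intro hy _
      nlinarith
    rw [hempty]
    simp only [Measure.restrict_empty, integral_zero_measure, intervalIntegral.integral_zero]
    exact hRHS0
  -- main case
  obtain ⟨m, hm⟩ : ∃ m : ℝ × E → ℝ, m = fun y : ℝ × E => ‖y.2‖ ^ 2 - ⟪y.2, a⟫ ^ 2 := ⟨_, rfl⟩
  obtain ⟨ψ, hψs, hψnn, hψle, hψt, hψ1, hψ0, hψd0, hψg, hψl⟩ := hcut a ha m hm r₁ r₂ hr₁ (by linarith)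
  obtain ⟨P, hP, -, hreg⟩ := exists_regularised_radius hr₁
  set b : ℝ := (C₀ * T)⁻¹ with hbdef
  set α : ℝ := b * r₂ / (2 * T) with hαdef
  obtain ⟨hb, hbT, hbTC, hC⟩ := b_facts hT hC₀ hbdef
  have hα : 0 ≤ α := by positivity
  -- the differential inequality in terms of `b`
  have hL' : ∀ t ∈ Ioo 0 T, ∀ x : E, r₁ ^ 2 ≤ ‖x‖ ^ 2 - ⟪x, a⟫ ^ 2 → ‖x‖ ^ 2 - ⟪x, a⟫ ^ 2 ≤ r₂ ^ 2 → ⟪x, a⟫ ^ 2 ≤ r₂ ^ 2 →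
      ‖FluidPDE.timeDeriv u t x + Δ (u t) x‖ ≤ b * ‖u t x‖ + Real.sqrt b * ‖fderiv ℝ (u t) x‖ := by
    intro t ht x h1 h2 h3
    have := hL t ht x h1 h2 h3
    rwa [hbdef, Real.sqrt_inv]
  -- the pigeonholed `T₀`
  obtain ⟨φ, hφ⟩ : ∃ φ : ℝ → ℝ, φ = fun t => ∫ x in {y : E | r₁ ^ 2 < ‖y‖ ^ 2 - ⟪y, a⟫ ^ 2 ∧
      ‖y‖ ^ 2 - ⟪y, a⟫ ^ 2 < r₂ ^ 2 ∧ ⟪y, a⟫ ^ 2 < r₂ ^ 2},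
      Real.exp (2 * b * ‖x‖ ^ 2) * (T⁻¹ * ‖u t x‖ ^ 2 + ‖fderiv ℝ (u t) x‖ ^ 2) := ⟨_, rfl⟩
  obtain ⟨cφ, hφ0⟩ := continuousOn_cylPhiSharp hT hu rfl hφ (r₁ := r₁) (r₂ := r₂) (b := b) (a := a)
  have iφ : IntervalIntegrable φ volume 0 T := cφ.intervalIntegrable_of_Icc hT.le
  obtain ⟨T₀, hT₀mem, hT₀φ⟩ := exists_mul_le_intervalIntegral (c := T / 2) (d := 3 * T / 4) (by linarith)
    (cφ.mono (Icc_subset_Icc (by positivity) (by linarith)))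
  have hXb : X = ∫ t in (0 : ℝ)..T, φ t := by
    rw [hX, hφ]
    refine intervalIntegral.integral_congr fun t _ => setIntegral_congr_fun mAN fun x _ => ?_
    rw [hbdef]
    congr 2
    field_simp
  have hφT₀ : φ T₀ ≤ 4 / T * ∫ t in (0 : ℝ)..T, φ t := by
    have hsub : ∫ t in T / 2..3 * T / 4, φ t ≤ ∫ t in (0 : ℝ)..T, φ t :=
      intervalIntegral.integral_mono_interval (by positivity) (by linarith) (by linarith)
        (Eventually.of_forall fun t => hφ0 t) iφ
    rw [div_mul_eq_mul_div, le_div_iff₀ hT]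
    have : 3 * T / 4 - T / 2 = T / 4 := by ring
    rw [this] at hT₀φ
    nlinarith
  have hφT₀' : ∫ x in {y : E | r₁ ^ 2 < ‖y‖ ^ 2 - ⟪y, a⟫ ^ 2 ∧ ‖y‖ ^ 2 - ⟪y, a⟫ ^ 2 < r₂ ^ 2 ∧ ⟪y, a⟫ ^ 2 < r₂ ^ 2},
      Real.exp (2 * b * ‖x‖ ^ 2) * (T⁻¹ * ‖u T₀ x‖ ^ 2 + ‖fderiv ℝ (u T₀) x‖ ^ 2) ≤
      4 / T * ∫ t in (0 : ℝ)..T, ∫ x in {y : E | r₁ ^ 2 < ‖y‖ ^ 2 - ⟪y, a⟫ ^ 2 ∧ ‖y‖ ^ 2 - ⟪y, a⟫ ^ 2 < r₂ ^ 2 ∧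
          ⟪y, a⟫ ^ 2 < r₂ ^ 2},
        Real.exp (2 * b * ‖x‖ ^ 2) * (T⁻¹ * ‖u t x‖ ^ 2 + ‖fderiv ℝ (u t) x‖ ^ 2) := by
    have := hφT₀
    rw [hφ] at this
    exact this
  have main := cyl_carleman_assembled hd3 ha hCψ hm hT hr₁ h20 hC₀ hbdef hαdef hT₀mem hr₁T hu hL' hψs hψnn hψle hψt hψ1
    hψ0 hψd0 hψg hψl hP hreg hφT₀'
  rw [← hφ] at main
  rw [← hXb] at main
  -- divide by the left coefficient and bound the three coefficients
  have hc₀ : 0 < 3 * b / C₀ * Real.exp (5 / 2 * α * T * r₁) := by positivity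
  set LHS : ℝ := ∫ t in (0 : ℝ)..T / 4, ∫ x in {y : E | 100 * r₁ ^ 2 < ‖y‖ ^ 2 - ⟪y, a⟫ ^ 2 ∧
      ‖y‖ ^ 2 - ⟪y, a⟫ ^ 2 < r₂ ^ 2 / 4 ∧ ⟪y, a⟫ ^ 2 < r₂ ^ 2 / 4},
    (T⁻¹ * ‖u t x‖ ^ 2 + ‖fderiv ℝ (u t) x‖ ^ 2) with hLHS
  have hinv : (3 * b / C₀ * Real.exp (5 / 2 * α * T * r₁))⁻¹ = C₀ / (3 * b) * Real.exp (-(5 / 2 * (α * T * r₁))) := by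
    rw [mul_inv, Real.exp_neg, inv_div]
    congr 2
    ring
  have hdiv : LHS ≤ C₀ / (3 * b) * Real.exp (-(5 / 2 * (α * T * r₁))) *
      (1 / 2 * (3 * b * (4 * (1 + Cψ) ^ 2) * Real.exp (2 * α * T * r₁)) * X + (6 + Cψ) * (4 / T) * X +
        1 / 2 * (12 * (r₂ ^ 2 / T ^ 2) * Real.exp (5 / 2 * b * r₂ ^ 2)) * Y) := by
    have := mul_le_mul_of_nonneg_left main (inv_nonneg.2 hc₀.le)
    rw [← mul_assoc, inv_mul_cancel₀ hc₀.ne', one_mul, hinv] at this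
    exact this
  have ha0 : 0 ≤ α * T * r₁ := by positivity
  have c1 := coef_first_one (C₀ := C₀) (a := α * T * r₁) (C := 4 * (1 + Cψ) ^ 2) hb
  have c2 := coef_first_two (M := 6 + Cψ) hb hT hC₀0 hbTC ha0 (by positivity)
  have c3 := coef_cyl_three (r := r₂) hb hT hC₀0 hbTC ha0
  -- the exponents in the statement
  have hexp1 : Real.exp (-(1 / 2 * (α * T * r₁))) = Real.exp (-(r₁ * r₂) / (4 * C₀ * T)) := by
    congr 1
    rw [hαdef, hbdef]
    field_simp
    ring
  have hexp2 : Real.exp (3 * b * r₂ ^ 2) = Real.exp (3 * r₂ ^ 2 / (C₀ * T)) := by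
    congr 1
    rw [hbdef]
    field_simp
  have h2a : Real.exp (2 * α * T * r₁) = Real.exp (2 * (α * T * r₁)) := by ring_nf
  rw [h2a] at hdiv
  -- expand and bound
  have hE := Real.exp_pos (-(1 / 2 * (α * T * r₁)))
  have key : C₀ / (3 * b) * Real.exp (-(5 / 2 * (α * T * r₁))) *
      (1 / 2 * (3 * b * (4 * (1 + Cψ) ^ 2) * Real.exp (2 * (α * T * r₁))) * X + (6 + Cψ) * (4 / T) * X +
        1 / 2 * (12 * (r₂ ^ 2 / T ^ 2) * Real.exp (5 / 2 * b * r₂ ^ 2)) * Y) ≤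
      (C₀ * (4 * (1 + Cψ) ^ 2) / 2 * Real.exp (-(1 / 2 * (α * T * r₁)))) * X +
        (4 * (6 + Cψ) / 3 * C₀ ^ 2 * Real.exp (-(1 / 2 * (α * T * r₁)))) * X +
        (4 * C₀ ^ 3 * Real.exp (-(1 / 2 * (α * T * r₁))) * Real.exp (3 * b * r₂ ^ 2)) * Y := by
    have e1 : C₀ / (3 * b) * Real.exp (-(5 / 2 * (α * T * r₁))) *
        (1 / 2 * (3 * b * (4 * (1 + Cψ) ^ 2) * Real.exp (2 * (α * T * r₁))) * X) ≤
        (C₀ * (4 * (1 + Cψ) ^ 2) / 2 * Real.exp (-(1 / 2 * (α * T * r₁)))) * X := by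
      have : C₀ / (3 * b) * Real.exp (-(5 / 2 * (α * T * r₁))) *
          (1 / 2 * (3 * b * (4 * (1 + Cψ) ^ 2) * Real.exp (2 * (α * T * r₁))) * X) =
          (C₀ / (3 * b) * Real.exp (-(5 / 2 * (α * T * r₁))) *
            (3 / 2 * b * (4 * (1 + Cψ) ^ 2) * Real.exp (2 * (α * T * r₁)))) * X := by ring
      rw [this, c1]
    have e2 : C₀ / (3 * b) * Real.exp (-(5 / 2 * (α * T * r₁))) * ((6 + Cψ) * (4 / T) * X) ≤
        (4 * (6 + Cψ) / 3 * C₀ ^ 2 * Real.exp (-(1 / 2 * (α * T * r₁)))) * X := by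
      have : C₀ / (3 * b) * Real.exp (-(5 / 2 * (α * T * r₁))) * ((6 + Cψ) * (4 / T) * X) =
          (C₀ / (3 * b) * Real.exp (-(5 / 2 * (α * T * r₁))) * (4 * (6 + Cψ) / T)) * X := by ring
      rw [this]
      exact mul_le_mul_of_nonneg_right c2 hX0
    have e3 : C₀ / (3 * b) * Real.exp (-(5 / 2 * (α * T * r₁))) *
        (1 / 2 * (12 * (r₂ ^ 2 / T ^ 2) * Real.exp (5 / 2 * b * r₂ ^ 2)) * Y) ≤
        (4 * C₀ ^ 3 * Real.exp (-(1 / 2 * (α * T * r₁))) * Real.exp (3 * b * r₂ ^ 2)) * Y := by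
      have : C₀ / (3 * b) * Real.exp (-(5 / 2 * (α * T * r₁))) *
          (1 / 2 * (12 * (r₂ ^ 2 / T ^ 2) * Real.exp (5 / 2 * b * r₂ ^ 2)) * Y) =
          (C₀ / (3 * b) * Real.exp (-(5 / 2 * (α * T * r₁))) * (6 * (r₂ ^ 2 / T ^ 2) * Real.exp (5 / 2 * b * r₂ ^ 2))) * Y := by
        ring
      rw [this]
      exact mul_le_mul_of_nonneg_right c3 hY0
    have hsum : C₀ / (3 * b) * Real.exp (-(5 / 2 * (α * T * r₁))) *
        (1 / 2 * (3 * b * (4 * (1 + Cψ) ^ 2) * Real.exp (2 * (α * T * r₁))) * X + (6 + Cψ) * (4 / T) * X +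
          1 / 2 * (12 * (r₂ ^ 2 / T ^ 2) * Real.exp (5 / 2 * b * r₂ ^ 2)) * Y) =
        C₀ / (3 * b) * Real.exp (-(5 / 2 * (α * T * r₁))) *
            (1 / 2 * (3 * b * (4 * (1 + Cψ) ^ 2) * Real.exp (2 * (α * T * r₁))) * X) +
          C₀ / (3 * b) * Real.exp (-(5 / 2 * (α * T * r₁))) * ((6 + Cψ) * (4 / T) * X) +
          C₀ / (3 * b) * Real.exp (-(5 / 2 * (α * T * r₁))) *
            (1 / 2 * (12 * (r₂ ^ 2 / T ^ 2) * Real.exp (5 / 2 * b * r₂ ^ 2)) * Y) := by ring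
    rw [hsum]
    linarith [e1, e2, e3]
  -- `C₀ ≤ C₀³`, `C₀² ≤ C₀³`
  have hC13 : C₀ ≤ C₀ ^ 3 := by nlinarith [hC₀]
  have hC23 : C₀ ^ 2 ≤ C₀ ^ 3 := by nlinarith [hC₀]
  have final : (C₀ * (4 * (1 + Cψ) ^ 2) / 2 * Real.exp (-(1 / 2 * (α * T * r₁)))) * X +
      (4 * (6 + Cψ) / 3 * C₀ ^ 2 * Real.exp (-(1 / 2 * (α * T * r₁)))) * X +
      (4 * C₀ ^ 3 * Real.exp (-(1 / 2 * (α * T * r₁))) * Real.exp (3 * b * r₂ ^ 2)) * Y ≤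
      K * C₀ ^ 3 * Real.exp (-(1 / 2 * (α * T * r₁))) * (X + Real.exp (3 * b * r₂ ^ 2) * Y) := by
    rw [hK]
    have hP1 : 0 ≤ (1 + Cψ) ^ 2 * (Real.exp (-(1 / 2 * (α * T * r₁))) * X) := by positivity
    have hP2 : 0 ≤ (6 + Cψ) * (Real.exp (-(1 / 2 * (α * T * r₁))) * X) := by positivity
    have t1 := mul_le_mul_of_nonneg_left hC13 hP1
    have t2 := mul_le_mul_of_nonneg_left hC23 hP2
    have t3 : 0 ≤ C₀ ^ 3 * (Real.exp (-(1 / 2 * (α * T * r₁))) * X) := by positivity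
    have t4 : 0 ≤ (1 + Cψ) ^ 2 * (C₀ ^ 3 * (Real.exp (-(1 / 2 * (α * T * r₁))) * (Real.exp (3 * b * r₂ ^ 2) * Y))) := by positivity
    have t5 : 0 ≤ (6 + Cψ) * (C₀ ^ 3 * (Real.exp (-(1 / 2 * (α * T * r₁))) * (Real.exp (3 * b * r₂ ^ 2) * Y))) := by positivity
    have t6 : 0 ≤ C₀ ^ 3 * (Real.exp (-(1 / 2 * (α * T * r₁))) * (Real.exp (3 * b * r₂ ^ 2) * Y)) := by positivity
    linarith [t1, t2, t3, t4, t5, t6]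
  rw [hexp1, hexp2] at final key
  exact (hdiv.trans key).trans final

end Main


end PalasekCarleman

end Literature.Analysis.FluidPDE

end
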